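import Literature.MathematicalPhysics.QuantumFieldTheory.Dimock2011to13.LocalizedStepAssembly
import Literature.MathematicalPhysics.QuantumFieldTheory.Dimock2011to13.GaussianSingleStep
import Literature.MathematicalPhysics.QuantumFieldTheory.Dimock2011to13.BlockAveragingMatrix
import Literature.MathematicalPhysics.QuantumFieldTheory.GaussianToolkit
import Literature.MathematicalPhysics.QuantumFieldTheory.Dimock2011to13.BlockAveragingComposition

/-!
# Dimock, *The renormalization group according to Balaban* I §1.3 "the scaled model", §2.1 "block averaging"
# (first0)–(preserve), II §3.3 (lime), §3.15 "Identify Z_{k+1} = Z⁰_{k+1}L^{−|𝕋¹|/2}", III §1 — THE MEASURE SIDE OF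
# THE RG STEP: the normalization constant 𝒩_{a,Ω} = (2π/a)^{|Ω|/2}, the mass preservation of the block-averaging
# convolution, the Jacobian L^{−|𝕋|/2} of the rescaling Φ ↦ Φ_L, (preserve) ∫ρ_{k+1} = ∫ρ_k = ∫ρ₀ for every k, the
# constant identity 𝒩^{−1}_{aL}L^{−|𝕋¹|/2} = 𝒩^{−1}_a behind (Ziterate), the change of variables (first), and §1.3's
# dropped Jacobian in the relative partition function — PROVED with Lebesgue measure on the field spaces `ι → ℝ`

**Citation header (reproduction of PUBLISHED work; template of the Bałaban lattice Yang–Mills cell).**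
J. Dimock, *The renormalization group according to Balaban. I. Small fields*, Rev. Math. Phys. **25** (2013) 1330010
(= arXiv:1108.1335v2) [Dimock2013]: §1.3 `\subsection{the scaled model}` TeX L259–308 (the density ρ^N_0 L268–269, the
scaling Φ_{L^{−N}} L270–274, the change of variables L275–279, the dropped Jacobian L280–281, L283); §2.1
`\subsection{block averaging}` L311–465: (first0) L340–349, the two norms L350–355, the footnote 𝒩_{a,Ω} L358–360,
𝒩_{aL,𝕋¹} L361–365, the normalization L366–370, the rescaling Φ_{1,L} L377–381, ρ₁ L382–385, "This preserves the
integral" L386–390, the constant identity L394, (first) L395–405, the change of variables Φ₀ = φ_L and dφ^{(1)}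
L406–410, "Q is scale invariant" L411, (kth) L414–424, (scaleddensity) L425–429, (preserve) L430–435, LEMMA `second`
L447–465 with its proof (queen) L471–478 … (queen2) L538–545, (queen3) and the constant L546–554; §2.3 LEMMA 5 (scaling)
with (Ziterate) L797–807.  J. Dimock, *The renormalization group according to Balaban. II. Large fields*,
J. Math. Phys. **54** (2013) 092301 (= arXiv:1212.5562v2) [Dimock2013BalabanII]: §2.1 LEMMA 2.1 (mabel) L488–493 with its proof (sweet)∕(stringy) L497–513 …
L531–550; §3.3 (lime) L2329–2336 and the scaling L2337–2340; §3.8 the measure dμ_{Ω_{k+1}} L3276–3279, (sugar) L3280–3283 with Z⁰_{k+1} L3284–3287; §3.15 `\subsection{scaling}`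
L5663–5672.
J. Dimock, *The renormalization group according to Balaban III. Convergence*, Ann. Henri Poincaré **15** (2014)
2133–2175 (= arXiv:1304.0705v1) [Dimock2013BalabanIII]: §1 L158–162 (Z_{M,N} = ∫ρ^N_0(Φ)dΦ), L187–204 (the step,
footnote 𝒩_{a,Ω} L189, "Then for any k the partition function can be expressed as Z_{M,N} = ∫ρ^N_k(Φ_k)dΦ_k"
L200–204).  TeX line numbers refer to the arXiv sources held by the cell (`inputs/files/dimock/src/1108.1335/
1108.1335.tex`, sha256[:16] 7382e6540dded9be; `…/1212.5562/1212.5562.tex`, 75c5792fc48eacbc; `…/1304.0705/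
1304.0705.tex`, dfd556282834aeba; subsection numbering as in the cell's TEMPLATE.md CHANGES v2 (b)); every quotation
below was read there this session.  Dimock's papers are published and refereed and are the cell's TEMPLATE, not
manuscripts under audit; no quantity of the Bałaban series is touched.

**What the papers print (verbatim).**  I §1.3 L266–281: *"For fields Φ : 𝕋⁰_{M+N} → ℝ we define ρ^N_0(Φ) =
ρ^N(Φ_{L^{−N}}) where Φ_{L^{−N}} : 𝕋^{−N}_M → ℝ is defined by Φ_{L^{−N}}(x) = L^{N/2}Φ(L^Nx)  Making the change of
variables φ = Φ_{L^{−N}} in the partition function we have Z_{M,N} = ∫ρ^N_0(Φ) dΦ^{M,N} … There should actually be a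
factor (L^{N/2})^{|𝕋⁰_{M+N}|/2} here, but since it makes no contribution to the relative partition function we have
dropped it."*; L283: *"This scaling preserves the Laplacian term"*.  I §2.1 (first0) L340–349: *"Now starting with the
density ρ₀ on functions Φ₀ : 𝕋⁰_{M+N} → ℝ we define a transformed density ρ̃₁ on functions Φ₁ : 𝕋¹_{M+N} → ℝ by
ρ̃₁(Φ₁) = 𝒩^{−1}_{aL,𝕋¹_{M+N}} ∫ exp(−(a/2L²)‖Φ₁ − QΦ₀‖²) ρ₀(Φ₀) dΦ₀ = 𝒩^{−1}_{aL,𝕋¹_{M+N}} ∫ exp(−½aL|Φ₁ − QΦ₀|²)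
ρ₀(Φ₀) dΦ₀"*; L350–355: *"Here in the first expression norms are taken with the natural metric for the lattice so
‖Φ₁‖² = L³Σ_{x∈𝕋¹_{M+N}}|Φ₁(x)|². In the second expression we use an unweighted sum |Φ₁|² = Σ_{x∈𝕋¹_{M+N}}|Φ₁(x)|²."*;
the footnote L358–360: *"In general if Ω is a set and Φ : Ω → ℝ we define 𝒩_{a,Ω} = ∫exp(−½a|Φ|²)dΦ =
(2π/a)^{|Ω|/2}"*; L361–370: *"𝒩_{aL,𝕋¹_{M+N}} = ∫exp(−½aL|Φ₁|²)dΦ₁ = (2π/aL)^{|𝕋¹_{M+N}|/2}  the constant is chosen so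
that ∫ρ̃₁(Φ₁) dΦ₁ = ∫ρ₀(Φ₀) dΦ₀"*; L377–390: *"Now one scales back to the unit lattice. A function Φ₁ : 𝕋⁰_{M+N−1} → ℝ
scales up to Φ_{1,L} : 𝕋¹_{M+N} → ℝ defined by Φ_{1,L}(x) = L^{−1/2}Φ₁(x/L)  We define ρ₁(Φ₁) = ρ̃₁(Φ_{1,L})
L^{−|𝕋⁰_{M+N−1}|/2} = ρ̃₁(Φ_{1,L})L^{−|𝕋¹_{M+N}|/2}  This preserves the integral ∫ρ₁(Φ₁)dΦ₁ = ∫ρ₀(Φ₀) dΦ₀"*; L394–411: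
*"We compute, taking account that 𝒩^{−1}_{aL,𝕋¹_{M+N}}L^{−|𝕋¹_{M+N}|/2} = 𝒩^{−1}_{a,𝕋¹_{M+N}},  ρ₁(Φ₁) = 𝒩^{−1}_{a,𝕋¹_{M+N}}
∫exp(−(a/2L²)‖Φ_{1,L} − QΦ₀‖²)ρ₀(Φ₀) dΦ₀ = 𝒩^{−1}_{a,𝕋¹_{M+N}} ∫exp(−(a/2L²)‖Φ_{1,L} − Qφ_L‖²)ρ₀(φ_L) dφ^{(1)} =
𝒩^{−1}_{a,𝕋¹_{M+N}} ∫exp(−(a/2)‖Φ₁ − Qφ‖²)ρ₀(φ_L) dφ^{(1)}  (first)  In the second step we have made the change of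
variables by Φ₀ = φ_L where φ : 𝕋^{−1}_{M+N−1} → ℝ. Then dΦ₀ = L^{−|𝕋^{−1}_{M+N−1}|/2}dφ ≡ dφ^{(1)}  In the last step we
use that Q is scale invariant: Qφ_L = (Qφ)_L."*; (kth)–(preserve) L414–435: *"We repeat this step a number of times.
After k steps we will have a density ρ_k(Φ_k) defined on functions Φ_k : 𝕋⁰_{M+N−k} → ℝ. The next step is to define
a density on functions Φ_{k+1} : 𝕋¹_{M+N−k} → ℝ by ρ̃_{k+1}(Φ_{k+1}) = 𝒩^{−1}_{aL,𝕋¹_{M+N−k}} ∫exp(−½aL|Φ_{k+1} −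
QΦ_k|²)ρ_k(Φ_k) dΦ_k  (kth)  Then one scales back to the unit lattice. If Φ_{k+1} : 𝕋⁰_{M+N−k−1} → ℝ then Φ_{k+1,L} :
𝕋¹_{M+N−k} → ℝ and we define ρ_{k+1}(Φ_{k+1}) = ρ̃_{k+1}(Φ_{k+1,L})L^{−|𝕋¹_{M+N−k}|/2}  (scaleddensity)  Then we still
have the normalization ∫ρ_{k+1}(Φ_{k+1})dΦ_{k+1} = ∫ρ_k(Φ_k)dΦ_k = ∫ρ₀(Φ₀) dΦ₀  (preserve)"*.  I LEMMA `second`'s proof,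
L538–554: *"The linear terms in Z vanish and the terms quadratic in Z when integrated over Z yield a constant Thus we have
ρ̃_{k+1}(Φ_{k+1}) = const ∫exp(−(a_{k+1}/2L²)‖Φ_{k+1} − Q_{k+1}φ‖²)ρ₀(φ_{L^k}) d^{(k)}φ  (queen2)  Replacing Φ_{k+1} by Φ_{k+1,L}
… and replacing φ by φ_L … we find ρ_{k+1}(Φ_{k+1}) = const ∫exp(−(a_{k+1}/2)‖Φ_{k+1} − Q_{k+1}φ‖²)ρ₀(φ_{L^{k+1}})
d^{(k+1)}φ  (queen3)  But the constant must be 𝒩^{−1}_{a_{k+1},𝕋⁰_{M+N−k−1}} in order to preserve the identity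
(preserve)."*; II LEMMA 2.1's proof L550: *"The constant 𝒩^{−1}_{k,𝛀} can be evaluated by integrating over all fields."*
I LEMMA 5 (scaling),
(Ziterate) L805–807: *"Z_{k+1} = Z_k 𝒩^{−1}_{a,𝕋¹_{M+N−k}} (2π)^{|𝕋⁰_{M+N−k}|/2}(det C_k)^{1/2}"* (where LEMMA `tiny` L753
has the unscaled constant *"Z_k 𝒩^{−1}_{aL,𝕋¹_{N+M−k}} (2π)^{|𝕋⁰_{M+N−k}|/2}(det C_k)^{1/2}"*).  II §3.3 L2329–2340:
*"We repeatedly block average starting with ρ₀ given by (den0). Given ρ_k(Φ_k) we define first ρ̃_{k+1}(Φ_{k+1}) =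
𝒩^{−1}_{aL,𝕋¹_{M+N−k}} ∫exp(−½aL|Φ_{k+1} − QΦ_k|²)ρ_k(Φ_k)dΦ_k  (lime)  and then scale by ρ_{k+1}(Φ_{k+1}) =
ρ̃_{k+1}(Φ_{k+1,L})L^{−|𝕋¹_{M+N−k}|/2}"*; II §3.8 L3276–3279: *"We also introduce the Gaussian measure with identity covariance dμ_{Ω_{k+1}}(W_k) =
(2π)^{−½|Ω^{(k)}_{k+1}|} exp(−½‖W_k‖²) dW_k"*; L3284–3287: *"The first term contributes to Z⁰_{k+1} ≡
𝒩^{−1}_{aL,𝕋¹_{M+N−k}}(2π)^{½|𝕋⁰_{M+N−k}|}(det C_k)^{1/2}Z_k"*; II §3.15 L5663–5672: *"We scale and evaluate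
ρ_{k+1}(Φ_{k+1}) = ρ̃(Φ_{k+1,L})L^{−|𝕋¹_{M+N−k}|/2} where now Φ_{k+1} is defined on 𝕋⁰_{M+N−(k+1)}. We make the
following changes in this expression. This follows the discussion in section freeflow. • Identify Z_{k+1} =
Z⁰_{k+1}L^{−|𝕋¹_{M+N−k}|/2}"*.  III §1 L158–162: *"The theory is scaled up to the unit lattice 𝕋⁰_{M+N} and there the
partition function has the form Z_{M,N} = ∫ρ^N_0(Φ)dΦ"*; L187–204: *"Given ρ_k(Φ_k) we define for Φ_{k+1} :
𝕋¹_{M+N−k} → ℝ and block averaging operator Q [footnote: 𝒩_{a,Ω} = (2π/a)^{|Ω|/2} where |Ω| is the number of elements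
in Ω] ρ̃_{k+1}(Φ_{k+1}) = 𝒩^{−1}_{aL,𝕋¹_{M+N−k}} ∫exp(−½aL|Φ_{k+1} − QΦ_k|²)ρ_k(Φ_k)dΦ_k  Next we scale by ρ_{k+1}(Φ_{k+1})
= ρ̃_{k+1}(Φ_{k+1,L})L^{−|𝕋¹_{M+N−k}|/2}  Then for any k the partition function can be expressed as Z_{M,N} =
∫ρ^N_k(Φ_k)dΦ_k"*.

**Why this file (cell TEMPLATE.md §4.1 row «D1 §2.1 block averaging», §4.2 rows «D2 §3.15–3.16», «D2 Thm
maintheorem» item 1).**  The lineage's one-step kernel (`GaussianSingleStep`, I LEMMA `second` ∕ II LEMMA 2.1) declares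
as NOT claimed *"the print's normalised measures d^{(k)}φ, 𝒩^{−1} and the unit-lattice rescalings (scaleddensity)/(scale)
… the print's identification of the overall constant 'by integrating over all fields'"* and *"measures on field space,
the scalings between lattices, 𝒩-bookkeeping"*; gen 42's `LocalizedStepAssembly` proved the scaling RULES of §3.15 as
reindexings of lattice sums (`scaleField`, `vol_scale`, `nsq_scale`, `blockAvg_scale` = *"Q is scale invariant"*) and
typed item 1's constants as a sequence (`Zseq`) with *"Z_{k+1} = Z⁰_{k+1}L^{−|𝕋¹|/2} (a definition)"* not claimed, and
closed with the pointer *"the measure-side Jacobians of §3.15"*.  This module supplies that measure side, with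
LEBESGUE MEASURE `volume` on the finite field spaces `S → ℝ` (the convention of `GaussianSingleStep`): the scaled field
IS gen 42's `LocalizedStepAssembly.scaleField c σ` (imported, not re-declared), its Jacobian is Mathlib's
`volume_measurePreserving_piCongrLeft` (relabelling the sites) composed with `Measure.map_addHaar_smul` (the dilation
`Φ ↦ cΦ` of `ℝ^{|S|}`), and the normalizations are Tonelli + translation invariance + the one-dimensional Gaussian.

**What is reproduced here (kernel-checked, zero `sorry`; imports `LocalizedStepAssembly`, (v1.2) `GaussianSingleStep`,
(v1.3) `BlockAveragingMatrix`, (v1.4) the tree's `GaussianToolkit` and (v1.6) `BlockAveragingComposition`, hence Mathlib).**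
* Part 1 — THE NORMALIZATION CONSTANT (footnote L358–360; III L189).  `sqNorm Φ = Σ_xΦ(x)²` (the unweighted `|Φ|²` of
  L353–355), `normConst a n = (√(2π/a))ⁿ` with **`normConst_eq_rpow`** (`= (2π/a)^{n/2}`), `integral_exp_neg_half_mul_sq`
  (`∫exp(−½at²)dt = √(2π/a)`), **`integral_exp_neg_half_mul_sqNorm`** (`𝒩_{a,Ω} = ∫exp(−½a|Φ|²)dΦ = (2π/a)^{|Ω|/2}` on
  `Ω → ℝ`), `integrable_exp_neg_half_mul_sqNorm`, and **`normConst_mul_sqrt_pow`** ∕ **`normConst_inv_mul_jac`** (L394: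
  `𝒩^{−1}_{aL,𝕋¹}L^{−|𝕋¹|/2} = 𝒩^{−1}_{a,𝕋¹}`).
* Part 2 — THE JACOBIAN OF THE RESCALING (L406–410 `dΦ₀ = L^{−|𝕋^{−1}|/2}dφ`; (scaleddensity)'s `L^{−|𝕋¹|/2}`; §1.3's
  factor).  `scaleField_eq_smul_relabel` (`φ_L = c·(φ ∘ σ⁻¹)`), **`integral_comp_scaleField`** (`∫F(φ_c)dφ = |c|^{−|S₀|}∫F`
  for every `F`, every real `c`, Bochner), **`lintegral_comp_scaleField`** (the same for `ℝ≥0∞`-valued densities,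
  `c ≠ 0`), `jac L n = ((√L)ⁿ)⁻¹` with **`jac_eq_rpow`** (`= L^{−n/2}`), `abs_inv_scaleConst_pow` (for `c = L^{−1/2}` the
  factor is `(√L)ⁿ = L^{n/2}`), **`integral_comp_scaleField_scaleConst`** (`∫F(φ_L)dφ = L^{|S|/2}∫F(Φ)dΦ`, i.e. `dΦ₀ =
  L^{−|𝕋|/2}dφ`).
* Part 3 — (scaleddensity) AND ITS MASS (L382–390, L425–435; II L2339; II §3.15 L5664; III L196–198).  `scaledDensity L σ
  ρ̃ Φ = ρ̃(Φ_L)·L^{−|S₀|/2}`, **`integral_scaledDensity`** (`∫ρ̃(Φ_L)L^{−|𝕋¹|/2}dΦ = ∫ρ̃` — *"This preserves the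
  integral"*, for EVERY `ρ̃`), `integrable_scaledDensity`, `scaledDensity_nonneg`, and the `ℝ≥0∞` version
  `lintegral_scaledDensityE`.
* Part 4 — (first0) ∕ (kth) ∕ (lime) AND ITS MASS (L340–370, L414–424; II L2331–2336; III L190–195).  `blockDensity aL Q ρ
  Φ₁ = 𝒩^{−1}_{aL,|S₀′|}∫exp(−½aL|Φ₁ − QΦ₀|²)ρ(Φ₀)dΦ₀` for ANY measurable `Q` (the block averaging `LocalizedStepAssembly.
  blockAvg B w` is one: `continuous_blockAvg`), the shear `(Φ₀, Φ₁) ↦ (Φ₀, Φ₁ − QΦ₀)` as a measure-preserving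
  equivalence of the product space (`shear`, `measurePreserving_shear` — translation invariance of `dΦ₁`, fibrewise),
  `integrable_blockKernel`, **`integral_blockDensity`** (*"the constant is chosen so that ∫ρ̃₁(Φ₁)dΦ₁ = ∫ρ₀(Φ₀)dΦ₀"*,
  for every integrable `ρ₀`: Tonelli, the shear, `∫∫ = (∫ρ₀)·𝒩`), `integrable_blockDensity`, `blockDensity_nonneg`.
* Part 5 — THE STEP AND (preserve) (L430–435; III L200–204).  `rgStep a L Q σ ρ = scaledDensity L σ (blockDensity (aL) Q
  ρ)` (block-average at `aL`, then rescale), **`integral_rgStep`** (`∫ρ_{k+1} = ∫ρ_k`), `integrable_rgStep`,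
  `rgStep_nonneg`; the tower `densitySeq` over an abstract sequence of lattices `S k` (print `𝕋⁰_{M+N−k}`), `T k` (print
  `𝕋¹_{M+N−k}`), averaging maps `Q k` and relabellings `σ k : S (k+1) ≃ T k`, with **`integral_densitySeq`**: *"for any k
  the partition function can be expressed as Z_{M,N} = ∫ρ^N_k(Φ_k)dΦ_k"* (III L200–204) = (preserve).
* Part 6 — THE CONSTANTS OF ITEM 1 (II L5672, L3284–3287; I (Ziterate) L805–807, L394).  `Z0next` (`Z⁰_{k+1} = 𝒩^{−1}_{aL,n}
  ·g·Z_k` with `g` = the Gaussian factor `(2π)^{|𝕋⁰|/2}(det C_k)^{1/2}` — `GaussianSingleStep.fluctConst` by name, here a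
  real parameter), **`Ziterate`** (`Z⁰_{k+1}·L^{−n/2} = Z_k·𝒩^{−1}_{a,n}·g` — *"Identify Z_{k+1} = Z⁰_{k+1}L^{−|𝕋¹|/2}"* IS
  LEMMA 5's (Ziterate)), `Zseq_succ_eq_Ziterate` (gen 42's `LocalizedStepAssembly.Zseq` with `z_k = 𝒩^{−1}_{a}g_k` obeys it).
* Part 7 — (first) (L394–411).  **`first`**: for block maps transported by the relabellings (`B₀(σ′y) = σ(B₁y)`, the
  hypothesis of gen 42's `blockAvg_scale`), `ρ₁(Φ₁) = rgStep a L (blockAvg B₀ w) σ′ ρ₀ Φ₁ = 𝒩^{−1}_{a,|𝕋¹|}·(L^{−|𝕋^{−1}|/2}·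
  ∫exp(−(a/2)|Φ₁ − Qφ|²)ρ₀(φ_L)dφ)` — the three printed steps: the constant identity, the change of variables `Φ₀ =
  φ_L` (`integral_comp_scaleField_scaleConst`), and *"Q is scale invariant"* (`blockAvg_scale`) with `sqNorm_scaleField`
  (`|ψ_L|² = L^{−1}|ψ|²`, so `(aL/2)|Φ_{1,L} − (Qφ)_L|² = (a/2)|Φ₁ − Qφ|²`).
* Part 8 — §1.3 THE SCALED MODEL (L266–281; III L158–162).  `unitLatticeDensity L N τ ρ^N Φ = ρ^N(Φ_{L^{−N}})` (`c =
  (√L)^N = L^{N/2}`), **`partitionFunction_unitLattice`** (`Z_{M,N} = ∫ρ^N dφ = (L^{N/2})^{|𝕋⁰_{M+N}|}·∫ρ^N_0 dΦ` — the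
  factor the print drops), **`relativePartitionFunction_unitLattice`** (*"since it makes no contribution to the relative
  partition function"*: `∫ρ^N/∫ρ^N(V=0) = ∫ρ^N_0/∫ρ^N_{0}(V=0)`).
* Part 9 — non-vacuity (`normConst (2π) n = 1`, `jac L 2 = L⁻¹`, a one-site `rgStep`).
* Part 10 (v1.1) — (first0)'s TWO LINES AGREE (L344–355): **`weighted_eq_unweighted`**: `(a/2L²)‖Ψ‖² = ½aL|Ψ|²` with `‖Ψ‖² =
  L³Σ_x|Ψ(x)|²` = gen 42's `LocalizedStepAssembly.nsq L univ Ψ` (reading (iv) below, now a theorem).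
* Part 11 (v1.1) — II §3.8's GAUSSIAN MEASURE WITH IDENTITY COVARIANCE `dμ_{Ω_{k+1}}(W_k) = (2π)^{−½|Ω^{(k)}_{k+1}|}exp(−½‖W_k‖²)
  dW_k` (L3276–3279) IS A PROBABILITY MEASURE: `unitGaussian Ω` (Lebesgue with the printed density),
  **`integral_unitGaussian_density`** (`= 1`, Part 1 at `a = 1`), `unitGaussian_univ`, the instance
  `isProbabilityMeasure_unitGaussian`.
* Part 12 (v1.1) — DENSITIES AS `ℝ≥0∞`-VALUED MEASURABLE FUNCTIONS, NO FINITENESS HYPOTHESIS (Tonelli in place of Fubini):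
  `blockDensityE`, **`lintegral_blockKernelE`** (`∫⁻∫⁻exp(−½aL|Φ₁ − QΦ₀|²)ρ(Φ₀) = 𝒩_{aL}·∫⁻ρ` by `lintegral_lintegral_swap` +
  `lintegral_sub_right_eq_self`), **`lintegral_blockDensityE`** (`∫⁻ρ̃_{k+1} = ∫⁻ρ_k` for every measurable `ρ_k ≥ 0`),
  `measurable_blockDensityE`, `measurable_scaleField`, `measurable_scaledDensityE`, `rgStepE` + **`lintegral_rgStepE`** +
  `measurable_rgStepE`, the tower `densitySeqE` with **`lintegral_densitySeqE`** ((preserve) ∕ III L200–204 for every `k`,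
  measurable `ρ₀ ≥ 0` and `Q_k` only — both sides may be `∞`).
* Part 13 (v1.2) — (queen) → (queen2) WITH ITS CONSTANT AND ITS MEASURE (I LEMMA `second` L447–465, proof L471–545; II
  LEMMA 2.1 L488–550): `sqNorm_eq_dotProduct`, **`blockKernel_mul_gaussian_eq`** (the integrand of (kth) against a
  level-`k` Gaussian IS `exp(−FreeFlowSingleStep.stringy)`), **`blockDensity_gaussian`** (`𝒩^{−1}_{aL}∫exp(−½aL|Φ_{k+1} −
  QΦ_k|²)exp(−½a_k|Φ_k − Q_kφ|²)dΦ_k = 𝒩^{−1}_{aL}·𝒵·exp(−½a′|Φ_{k+1} − QQ_kφ|²)`, `a′ = aNext a_k aL`, `𝒵 =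
  GaussianSingleStep.gaussConst` — the lineage's `integral_exp_neg_stringy` inside `blockDensity`; frame: reading (vi)),
  `continuous_exp_neg_stringy`, **`integrable_gaussianMixtureKernel`** (Fubini licence for the fine-field mixture:
  `integrable_prod_iff'`, the `Φ_k`-integral bounded by `𝒵`), **`blockDensity_gaussianMixture`** (for `ρ_k = ∫ν(dφ)
  w(φ)exp(−½a_k|Φ_k − Q_kφ|²)` with ANY measure `ν` and integrable `w` — print `𝒩^{−1}_{a_k}ρ₀(φ_{L^k})dφ^{(k)}` —
  `ρ̃_{k+1} = 𝒩^{−1}_{aL}·𝒵·∫ν(dφ) w(φ)exp(−½a′|Φ_{k+1} − Q_{k+1}φ|²)`: (queen2) *"= const ∫exp(−(a_{k+1}/2L²)‖Φ_{k+1} −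
  Q_{k+1}φ‖²)ρ₀(φ_{L^k})d^{(k)}φ"* with `const` explicit — the inductive step of LEMMA `second` before the rescaling of
  Part 3∕7).
* Part 14 (v1.3) — THE FRAME (reading (vi)): **`blockDensity_gaussian_Qmat`** (Part 13 with `Q := BlockAveragingMatrix.Qmat b N`,
  the print's averaging over blocks of equal size `N` in the isometric normalisation — `hQ` DISCHARGED by
  `Qmat_mul_transpose`; `blockDensity_gaussianMixture_Qmat` likewise), **`normConst_isometric_frame`** (`𝒩_{a/L²,n} = (√L)^{3n}·𝒩_{aL,n}`: the constants of the two frames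
  differ by the Jacobian `L^{3n/2}` of `Φ ↦ L^{3/2}Φ`); `aNext a_k (a/L²) = a_{k+1}/L²` at the closed-form `a_k` is
  `BlockAveragingComposition.aNext_aK` (not imported here; by name).
* Part 15 (v1.3) — *"But the constant must be 𝒩^{−1}_{a_{k+1},𝕋⁰_{M+N−k−1}} in order to preserve the identity (preserve)"* (I
  L553; II L550 *"The constant 𝒩^{−1}_{k,𝛀} can be evaluated by integrating over all fields"*): `shearBy` ∕
  `measurePreserving_shearBy` ∕ `integrable_mixtureKernel` (Part 4's shear with an arbitrary s-finite parameter measure `ν`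
  in place of `dΦ₀`), **`integral_integral_mixture`** (`∫dΦ∫ν(dφ) w(φ)exp(−½β|Φ − Mφ|²) = 𝒩_{β,|S|}·∫ν w`),
  **`constant_by_mass`** ∕ `constant_by_mass'` (a density of the Gaussian-mixture form (queen3) with mass `m` and `∫ν w = m
  ≠ 0` has constant EXACTLY `𝒩^{−1}_{β,|S|}` — LEMMA `second`'s constant without any determinant, as the print argues).
* Part 16 (v1.3) — (queen) → (queen2) IN THE LITERAL FRAME: `sqNorm_smul`, **`blockDensity_gaussian_smul`** (Part 13 for a scaled
  coisometry `Q = cQ̂`: width `aLc²`, output width `aNext a_k (aLc²)/c²`), `avgMat b N` (the PRINTED `(Qf)(y) = N⁻¹Σ_{x∈B(y)}f(x)`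
  as a matrix: `avgMat_mulVec` = gen 30's `BlockAveragingMatrix.QD`, `avgMat_eq_smul_Qmat` = `(√N)⁻¹·Qmat`),
  **`blockDensity_gaussian_avg`** (for the printed `Q` on blocks of equal size `N`: output width `N·aNext a_k (aL/N)`, `hQ`
  discharged), `literal_width` (with `aL = a·L`, `N = L³`: `N·aNext a_k (aL/N) = L·(L²aNext a_k (a/L²)) = L·a_{k+1}` — the
  unweighted coefficient of (queen2)'s `(a_{k+1}/2L²)‖·‖²`; reading (vi) made constructive).
* Part 17 (v1.4) — II §3.8's *"Gaussian measure with identity covariance"* (L3276–3279) IDENTIFIED WITH MATHLIB'S PRODUCT GAUSSIAN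
  and its covariance COMPUTED: **`unitGaussian_eq_pi_gaussianReal`** (`unitGaussian Ω = Measure.pi (fun _ => gaussianReal 0 1)`,
  via the tree's `GaussianToolkit.pi_gaussianReal_eq_withDensity`), `measurePreserving_eval_unitGaussian` (each `W(x)` has law
  `N(0,1)`), `integral_eval_unitGaussian` (mean `0`), `integral_eval_sq_unitGaussian` (`∫W(x)²dμ = 1`),
  `integral_eval_mul_eval_unitGaussian` (`∫W(x)W(y)dμ = 0`, `x ≠ y`, by the independence of the coordinates under
  `Measure.pi`), **`covariance_unitGaussian`** (`∫W(x)W(y)dμ_Ω(W) = δ_{xy}` — "identity covariance" as a theorem).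
* Part 18 (v1.5) — LEMMA `second` ASSEMBLED BY INDUCTION OVER THE TOWER (I L447–465, proof L471–554): `relabelMat` ∕
  `relabelMat_mulVec` (the rescaling `φ ↦ φ_c` as a matrix), `sqNorm_scaleField_sub` ((queen2) → (queen3): `|Φ_c − v|² = c²|Φ −
  v_{c⁻¹}|²`), `blockDensity_const_mul`, `blockDensity_smul_transport`, **`blockDensity_gaussianMixture_smul`** (Part 13 for scaled
  coisometries), the printed recursions `secondWidth` ∕ `secondMean` ∕ `secondK` (+ `secondWidth_pos`),
  **`densitySeq_gaussianMixture`** (for EVERY `k`: `ρ_{k+1}(Φ) = K_k∫ρ₀(Φ₀)exp(−½β_k|Φ − M_kΦ₀|²)dΦ₀` along any tower of scaled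
  coisometries `c_kQ̂_k` — base (first), step (queen) → (queen2) → (queen3)), **`secondK_eq`** (`K_k = 𝒩^{−1}_{β_k,|S_{k+1}|}` BY
  MASS, Part 15 + (preserve): *"But the constant must be 𝒩^{−1}_{a_{k+1}} in order to preserve the identity (preserve)"* for
  every `k`), **`second_lemma`**, **`second_lemma_avg`** (the printed `avgMat` operators, NO hypothesis on `Q`),
  `secondWidth_avg_succ` (blocks of size `L³`: `β_{k+1} = L²·aNext β_k (a/L²)`, i.e. the printed `a_{k+2}` by
  `BlockAveragingComposition.aNext_aK`).
* Part 19 (v1.6) — LEMMA `second` WITH THE PRINTED WIDTHS *"a_k = a(1 − L^{−2})/(1 − L^{−2k})"* (L462–464): for blocks of size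
  `N_k = L³`, **`secondWidth_eq_aK`** (`β_k = a_{k+1}` = the tree's `King1986.aK a L (k+1)`, by gen 30's
  `BlockAveragingComposition.aNext_aK` now IMPORTED — the closed form instantiated, no longer by name) and **`second_lemma_printed`**
  (`ρ_{k+1}(Φ) = 𝒩^{−1}_{a_{k+1},|S_{k+1}|}∫ρ₀(Φ₀)exp(−½a_{k+1}|Φ − M_kΦ₀|²)dΦ₀` for the printed averaging operators, `L > 1`).
* Part 20 (v1.7) — BINDER ECONOMY (an outside reader's observation, cell journal l.23919): the constants `K_k` are `ρ₀`-free, so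
  **`secondK_eq'`** holds with NO density in the statement (Part 18's `secondK_eq` at the reference Gaussian of Part 1) and
  **`second_lemma'`** ∕ **`second_lemma_avg'`** ∕ **`second_lemma_printed'`** hold for EVERY integrable `ρ₀`, the hypothesis `∫ρ₀ ≠ 0`
  dropped.

**Readings (declared).**  (i) LATTICES ARE FINITE TYPES and `dΦ = Π_x dΦ(x)` is `volume` on `S → ℝ`; the sites of
`𝕋⁰_{M+N−k}`, `𝕋¹_{M+N−k}`, `𝕋^{−1}_{M+N−k−1}` are abstract finite types related by equivalences (`σ` = *"y ↦ Ly"*, as in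
`LocalizedStepAssembly`); `|𝕋⁰_{M+N−k−1}| = |𝕋¹_{M+N−k}|` is `Fintype.card_congr σ`.  (ii) DENSITIES are real functions
integrated in Bochner's sense; the mass identities of Parts 4–5 assume `ρ` INTEGRABLE (a finite partition function —
the print's densities are `exp(−S − V)` with `V` bounded below), those of Parts 2–3 and 8 hold for every `ρ̃`
(Mathlib's convention `∫` of a non-integrable function `= 0` makes `integral_comp_smul` unconditional); `ℝ≥0∞`
versions are given for the Jacobian and (scaleddensity) without any hypothesis and (v1.1, Part 12) for the whole step
and the tower under measurability alone.  (iii) `Q` in Part 4 is ANY measurable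
map `(S₀ → ℝ) → (S₀′ → ℝ)` — only the translation invariance of `dΦ₁` is used, exactly as in the print's "the constant
is chosen so that"; Part 7 specialises to `blockAvg`.  (iv) The unweighted form `½aL|Φ₁ − QΦ₀|²` of (first0)'s second
line is used throughout; its equality with the weighted `(a/2L²)‖·‖²`, `‖Φ₁‖² = L³Σ` (L350–352) is the arithmetic
`(a/2L²)·L³ = ½aL` (v1.1: `weighted_eq_unweighted`, Part 10).  (v) LOCATED PRECISION (INFO, records only, not a finding): the kernel's
Jacobian in §1.3 is `((√L)^N)^{|𝕋⁰_{M+N}|} = L^{N|𝕋⁰_{M+N}|/2}` (`partitionFunction_unitLattice`; consistent with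
(scaleddensity)'s `L^{−|𝕋¹|/2}` for the inverse scaling `L^{−1/2}`); L280 prints the dropped factor as
*"(L^{N/2})^{|𝕋⁰_{M+N}|/2}"* — immaterial as printed, since it cancels in the relative partition function
(`relativePartitionFunction_unitLattice`).  (vi) THE FRAME OF PART 13 (v1.3).  Part 13 is stated on the carrier of
`GaussianSingleStep`: `Q` a matrix with `QQᵀ = 1` for the UNWEIGHTED dot product and both quadratic terms of (queen) as
unweighted dot products — the ISOMETRIC normalisation of the lineage (`FreeFlowSingleStep`'s header; the print's `Q`
satisfies `QQᵀ = I` for the WEIGHTED products (three0), L328–336, and becomes `BlockAveragingMatrix.Qmat b N` — a matrix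
coisometry, `Qmat_mul_transpose` — after the rescaling `g ↦ √N·g`; `blockDensity_gaussian_Qmat` below discharges `hQ` that
way).  In that frame the width parameter of `blockDensity` is the print's `a/L²` (not the `aL = a·L` of (kth)'s unweighted
second line used in the prose of Parts 4–5) and `aNext a_k (a/L²) = a_{k+1}/L²` at the closed form `a_k = a(1 −
L^{−2})/(1 − L^{−2k})` (L463) is `BlockAveragingComposition.aNext_aK`; the two frames differ by the constant Jacobian of the
isometry `Φ ↦ η^{3/2}Φ` of each lattice (Part 2 with `σ = id`; on the constants: `normConst_isometric_frame`, `𝒩_{a/L²,n} =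
L^{3n/2}𝒩_{aL,n}`), which no mass identity sees; `blockDensity_gaussian[Mixture]` themselves hold for every positive width, and Part 16
(`blockDensity_gaussian_avg`) transports Part 13 to the LITERAL frame of (kth)'s second line — the printed `Q = avgMat b N`
(`QQᵀ = N⁻¹·1`), width `aL`, output width `N·aNext a_k (aL/N)` `= L·a_{k+1}` for `aL = a·L`, `N = L³` (`literal_width`).

**What is NOT claimed.**  The Gaussian integrations themselves (I LEMMA `second`, `tiny`; II LEMMA 2.1, (cloudy3)) —
`GaussianSingleStep` by name (Part 13 COMPOSES its one-step theorem with (kth)'s normalization and Part 18 (v1.5) ITERATES it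
over the abstract tower `S k`, `T k`, `σ k`, Part 19 (v1.6) instantiates the closed-form widths `a_k` for blocks of size `L³`;
`Q_k = Q^k` on the concrete lattices `𝕋^{−k}_{M+N−k}` (`BlockAveragingMatrix.Qmat_comp`, `TorusBlockAveraging`) stays cited by
name — the carriers `S k` are abstract finite types — and the print's `d^{(k)}φ` form is the change of variables of Part 2 applied
to `second_lemma`'s `dΦ₀` form); the action scalings (I (71), II (oooo), §3.15's bullets 2–6) — `LocalizedStepAssembly` by
name; (representation2) as an identity of densities, the sums over `𝚷`, the conditional measures `dΦ_{k,𝛀ᶜ}dW_{k,𝚷}`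
(only the one-block Gaussian `dμ_{Ω_{k+1}}` of (sugar)−1 is typed, Parts 11 and 17); the identification of `det C_k`; anything of B1–B16 (TEMPLATE.md §4.1 row «D1 §2.1» ↔ B5
§A–§B (1.11)–(1.14) `(Te^{−S})(B) = ∫dA δ(B − QA)… = Z^{(0)}exp(−S₁(B))` — Bałaban's δ-function averaging has NO Gaussian
width `aL` and its normalization is the constrained Gaussian of pv16's `Beta.GaussianIntegral`; grade T for the
abelian Gaussian core, untouched).  NOT summit progress; NOT a statement about any Bałaban paper; NOT continuum; NOT
Clay.  Unit `b2b-balaban-template` gen 43 (journal CLAIM D1-RGSTEP-MEASURE-KERNEL).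

**Version.**  v1.1 — ADDITIVE to v1 (p239190, 2026-08-20, commit 06e6d71c1d73; every v1 declaration byte-identical): Part 10
«(first0)'s two lines agree» (`weighted_eq_unweighted`), Part 11 «II §3.8's dμ_{Ω_{k+1}} is a probability measure»
(`unitGaussian`, `integral_unitGaussian_density`, `unitGaussian_univ`, `isProbabilityMeasure_unitGaussian`), Part 12 «densities
as ℝ≥0∞-valued measurable functions» (`blockDensityE`, `lintegral_blockKernelE`, `lintegral_blockDensityE`, `rgStepE`,
`lintegral_rgStepE`, `densitySeqE`, `lintegral_densitySeqE` and the measurability lemmas), inserted before the examples;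
header extended accordingly.  v1.2 — ADDITIVE to v1.1 (p239457, commit d3f605d05706; every v1.1 declaration
byte-identical; one import added, `GaussianSingleStep`): Part 13 «(queen) → (queen2) with its constant and its measure»
(`sqNorm_eq_dotProduct`, `blockKernel_mul_gaussian_eq`, `blockDensity_gaussian`, `continuous_exp_neg_stringy`,
`integrable_gaussianMixtureKernel`, `blockDensity_gaussianMixture`), inserted before the examples.  v1.3 — ADDITIVE to
v1.2 (p239665; every v1.2 declaration byte-identical; one import added, `BlockAveragingMatrix`) + DOCFIX: reading (vi) (the
frame of Part 13) in the header and in `blockDensity_gaussian`'s docstring; Part 14 (`blockDensity_gaussian_Qmat`,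
`blockDensity_gaussianMixture_Qmat`, `normConst_isometric_frame`); Part 15 (`shearBy`, `shearBy_apply`,
`measurePreserving_shearBy`, `integrable_mixtureKernel`, `integral_integral_mixture`, `constant_by_mass`,
`constant_by_mass'`); Part 16 (`sqNorm_smul`, `blockDensity_gaussian_smul`, `avgMat`, `avgMat_mulVec`, `avgMat_eq_smul_Qmat`,
`blockDensity_gaussian_avg`, `literal_width`).  v1.4 — ADDITIVE to v1.3 (p239991, commit f1b40f941e28; every v1.3 declaration
byte-identical; one import added, the tree's `GaussianToolkit`): Part 17 (`unitGaussian_eq_pi_gaussianReal`,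
`measurePreserving_eval_unitGaussian`, `integral_eval_unitGaussian`, `integral_eval_sq_unitGaussian`,
`integral_eval_mul_eval_unitGaussian`, `covariance_unitGaussian`), inserted before the examples.  v1.5 — ADDITIVE to v1.4
(p240634, commit f848dc987a2a; every v1.4 declaration byte-identical; no import added): Part 18 (`relabelMat`, `relabelMat_mulVec`,
`scaleField_scaleField_inv`, `scaleField_sub_eq`, `sqNorm_scaleField_sub`, `blockDensity_const_mul`, `blockDensity_smul_transport`,
`blockDensity_gaussianMixture_smul`, `aNext_pos'`, `secondWidth`, `secondMean`, `secondK`, `secondWidth_pos`,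
`densitySeq_gaussianMixture`, `measurable_matrix_mulVec`, `secondK_eq`, `second_lemma`, `second_lemma_avg`, `secondWidth_avg_succ`),
inserted before the examples; the NOT-claimed paragraph narrowed accordingly.  v1.6 — ADDITIVE to v1.5 (p241049; every v1.5
declaration byte-identical; one import added, `BlockAveragingComposition`): Part 19 (`secondWidth_eq_aK`, `second_lemma_printed`).
v1.7 — ADDITIVE to v1.6 (p243024, commit 54e80dd33cbe; every v1.6 declaration byte-identical; no import added): Part 20 (`secondK_eq'`,
`second_lemma'`, `second_lemma_avg'`, `second_lemma_printed'`).  v1 — Parts 1–9.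
-/

noncomputable section

open MeasureTheory Real Finset
open scoped ENNReal

namespace Literature.MathematicalPhysics.QuantumFieldTheory.Dimock2011to13.RGStepNormalization

open LocalizedStepAssembly (scaleField scaleField_apply scaleConst scaleConst_sq_mul blockAvg blockAvg_scale Zseq)

/-! ## Part 1 — The normalization constant `𝒩_{a,Ω} = ∫exp(−½a|Φ|²)dΦ = (2π/a)^{|Ω|/2}` (footnote L358–360; III L189) -/

section NormConst

variable {Ω : Type*} [Fintype Ω]

/-- **The unweighted square norm** `|Φ|² = Σ_{x∈Ω}|Φ(x)|²` (*"In the second expression we use an unweighted sum"*,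
L353–355). [cite: Dimock2013, §2.1 (arXiv:1108.1335v2 TeX L353–355)] -/
def sqNorm (Φ : Ω → ℝ) : ℝ := ∑ x, Φ x ^ 2

/-- `0 ≤ |Φ|²`. [cite: Dimock2013, §2.1 (arXiv:1108.1335v2 TeX L353–355)] -/
theorem sqNorm_nonneg (Φ : Ω → ℝ) : 0 ≤ sqNorm Φ :=
  Finset.sum_nonneg fun x _ => sq_nonneg (Φ x)

/-- `|Φ|²` is continuous on `Ω → ℝ` (hence measurable). [cite: Dimock2013, §2.1 (arXiv:1108.1335v2 TeX L353–355)] -/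
theorem continuous_sqNorm : Continuous (sqNorm : (Ω → ℝ) → ℝ) := by
  unfold sqNorm
  exact continuous_finsetSum _ fun x _ => (continuous_apply x).pow 2

/-- **`𝒩_{a,n} := (2π/a)^{n/2}`**, written `(√(2π/a))ⁿ` (footnote L358–360: *"𝒩_{a,Ω} = ∫exp(−½a|Φ|²)dΦ = (2π/a)^{|Ω|/2}"*;
III L189: *"𝒩_{a,Ω} = (2π/a)^{|Ω|/2} where |Ω| is the number of elements in Ω"*). [cite: Dimock2013, §2.1 footnote
(arXiv:1108.1335v2 TeX L358–360); Dimock2013BalabanIII, §1 footnote (arXiv:1304.0705v1 TeX L189)] -/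
def normConst (a : ℝ) (n : ℕ) : ℝ := Real.sqrt (2 * π / a) ^ n

/-- `𝒩_{a,n} > 0` for `a > 0`. [cite: Dimock2013, §2.1 footnote (arXiv:1108.1335v2 TeX L358–360)] -/
theorem normConst_pos {a : ℝ} (ha : 0 < a) (n : ℕ) : 0 < normConst a n :=
  pow_pos (Real.sqrt_pos.2 (div_pos (mul_pos two_pos Real.pi_pos) ha)) n

/-- `𝒩_{a,n} = (2π/a)^{n/2}` as a real power, as printed. [cite: Dimock2013, §2.1 footnote (arXiv:1108.1335v2 TeX
L358–360)] -/
theorem normConst_eq_rpow {a : ℝ} (ha : 0 < a) (n : ℕ) :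
    normConst a n = (2 * π / a) ^ ((n : ℝ) / 2) := by
  have h0 : 0 ≤ 2 * π / a := (div_pos (mul_pos two_pos Real.pi_pos) ha).le
  unfold normConst
  rw [Real.sqrt_eq_rpow, ← Real.rpow_natCast, ← Real.rpow_mul h0]
  congr 1
  ring

/-- The one-dimensional Gaussian: `∫exp(−½at²)dt = √(2π/a)` for `a > 0` (the `|Ω| = 1` case of the footnote; Mathlib's
`integral_gaussian`). [cite: Dimock2013, §2.1 footnote (arXiv:1108.1335v2 TeX L358–360)] -/
theorem integral_exp_neg_half_mul_sq {a : ℝ} (ha : 0 < a) :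
    ∫ t : ℝ, exp (-(a / 2) * t ^ 2) = Real.sqrt (2 * π / a) := by
  rw [integral_gaussian]
  congr 1
  field_simp

/-- `exp(−½a|Φ|²) = Π_x exp(−½aΦ(x)²)` — the integrand of `𝒩_{a,Ω}` factorises over the sites. [cite: Dimock2013, §2.1 footnote (arXiv:1108.1335v2 TeX L358–360)] -/
theorem exp_neg_half_mul_sqNorm (a : ℝ) (Φ : Ω → ℝ) :
    exp (-(a / 2) * sqNorm Φ) = ∏ x, exp (-(a / 2) * Φ x ^ 2) := by
  rw [sqNorm, Finset.mul_sum, Real.exp_sum]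

/-- **THE NORMALIZATION CONSTANT** (footnote L358–360; L361–365 for `aL`): `∫_{Ω→ℝ} exp(−½a|Φ|²)dΦ = (2π/a)^{|Ω|/2} =
𝒩_{a,|Ω|}`, `dΦ = Π_{x∈Ω}dΦ(x)` Lebesgue. [cite: Dimock2013, §2.1 footnote and eq. for 𝒩_{aL,𝕋¹} (arXiv:1108.1335v2 TeX
L358–365); Dimock2013BalabanIII, §1 footnote (arXiv:1304.0705v1 TeX L189)] -/
theorem integral_exp_neg_half_mul_sqNorm {a : ℝ} (ha : 0 < a) :
    ∫ Φ : Ω → ℝ, exp (-(a / 2) * sqNorm Φ) = normConst a (Fintype.card Ω) := by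
  simp_rw [exp_neg_half_mul_sqNorm]
  rw [integral_fintype_prod_volume_eq_pow (fun t : ℝ => exp (-(a / 2) * t ^ 2)),
    integral_exp_neg_half_mul_sq ha]
  rfl

/-- The Gaussian weight `exp(−½a|Φ|²)` of `𝒩_{a,Ω}` is integrable on `Ω → ℝ` for `a > 0`. [cite: Dimock2013, §2.1 footnote (arXiv:1108.1335v2 TeX L358–360)] -/
theorem integrable_exp_neg_half_mul_sqNorm {a : ℝ} (ha : 0 < a) :
    Integrable (fun Φ : Ω → ℝ => exp (-(a / 2) * sqNorm Φ)) := by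
  simp_rw [exp_neg_half_mul_sqNorm]
  exact Integrable.fintype_prod (μ := fun _ : Ω => (volume : Measure ℝ))
    (f := fun (_ : Ω) (t : ℝ) => exp (-(a / 2) * t ^ 2)) fun _ => integrable_exp_neg_mul_sq (half_pos ha)

/-- **`𝒩_{aL,n}·(√L)ⁿ = 𝒩_{a,n}`**, i.e. `(2π/aL)^{n/2}L^{n/2} = (2π/a)^{n/2}` — the identity *"𝒩^{−1}_{aL,𝕋¹_{M+N}}
L^{−|𝕋¹_{M+N}|/2} = 𝒩^{−1}_{a,𝕋¹_{M+N}}"* of L394 in product form. [cite: Dimock2013, §2.1 (arXiv:1108.1335v2 TeX L394)] -/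
theorem normConst_mul_sqrt_pow {a L : ℝ} (ha : 0 < a) (hL : 0 < L) (n : ℕ) :
    normConst (a * L) n * Real.sqrt L ^ n = normConst a n := by
  unfold normConst
  rw [← mul_pow]
  congr 1
  rw [← Real.sqrt_mul (div_pos (mul_pos two_pos Real.pi_pos) (mul_pos ha hL)).le]
  congr 1
  field_simp

end NormConst

/-! ## Part 2 — The Jacobian of the rescaling `Φ ↦ Φ_L` (L406–410 `dΦ₀ = L^{−|𝕋^{−1}|/2}dφ`; (scaleddensity); §1.3) -/

section Jacobian

variable {S₀ S₁ : Type*} [Fintype S₀] [Fintype S₁]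

omit [Fintype S₀] [Fintype S₁] in
/-- The scaled field `φ_L = c·(φ ∘ σ⁻¹)` IS the dilation by `c` of the site-relabelled field (Mathlib's
`MeasurableEquiv.piCongrLeft`). [cite: Dimock2013, §2.1 (arXiv:1108.1335v2 TeX L377–381)] -/
theorem scaleField_eq_smul_relabel (c : ℝ) (σ : S₁ ≃ S₀) (φ : S₁ → ℝ) :
    scaleField c σ φ = c • (MeasurableEquiv.piCongrLeft (fun _ : S₀ => ℝ) σ φ) := by
  funext x
  simp only [scaleField, Pi.smul_apply, smul_eq_mul, MeasurableEquiv.coe_piCongrLeft,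
    Equiv.piCongrLeft_apply_eq_cast, cast_eq]

/-- Relabelling the sites (`φ ↦ φ ∘ σ⁻¹`, the `x ↦ x/L` of `Φ_{1,L}(x) = L^{−1/2}Φ₁(x/L)`) preserves Lebesgue measure:
`Π_y dφ(y) = Π_x dΦ(x)` (Mathlib's `volume_measurePreserving_piCongrLeft`) — the part of the change of variables `Φ₀ = φ_L`
with unit Jacobian. [cite: Dimock2013, §2.1 (arXiv:1108.1335v2 TeX L406–410)] -/
theorem measurePreserving_relabel (σ : S₁ ≃ S₀) :
    MeasurePreserving (MeasurableEquiv.piCongrLeft (fun _ : S₀ => ℝ) σ)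
      (volume : Measure (S₁ → ℝ)) (volume : Measure (S₀ → ℝ)) :=
  volume_measurePreserving_piCongrLeft (fun _ : S₀ => ℝ) σ

/-- **THE JACOBIAN OF THE RESCALING (Bochner form)**: `∫F(φ_c)dφ = |c|^{−|S₀|}·∫F(Φ)dΦ` for every `F`, where `φ_c =
scaleField c σ φ = c·φ(σ⁻¹·)` — the change of variables *"Φ₀ = φ_L … dΦ₀ = L^{−|𝕋^{−1}_{M+N−1}|/2}dφ"* (L406–410, `c =
L^{−1/2}`) and §1.3's *"φ = Φ_{L^{−N}}"* (L275, `c = L^{N/2}`).  Unconditional in `F` and `c` (Mathlib's conventions for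
non-integrable `F` and for `c = 0`). [cite: Dimock2013, §2.1 (arXiv:1108.1335v2 TeX L406–410) and §1.3 (TeX L275–281)] -/
theorem integral_comp_scaleField {F : Type*} [NormedAddCommGroup F] [NormedSpace ℝ F] (σ : S₁ ≃ S₀) (c : ℝ)
    (f : (S₀ → ℝ) → F) :
    ∫ φ : S₁ → ℝ, f (scaleField c σ φ) = |(c ^ Fintype.card S₀)⁻¹| • ∫ Φ : S₀ → ℝ, f Φ := by
  calc ∫ φ : S₁ → ℝ, f (scaleField c σ φ)
      = ∫ φ : S₁ → ℝ, (fun ψ : S₀ → ℝ => f (c • ψ))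
          (MeasurableEquiv.piCongrLeft (fun _ : S₀ => ℝ) σ φ) := by
        simp_rw [scaleField_eq_smul_relabel]
    _ = ∫ ψ : S₀ → ℝ, f (c • ψ) :=
        (measurePreserving_relabel σ).integral_comp' (fun ψ : S₀ → ℝ => f (c • ψ))
    _ = |(c ^ Fintype.card S₀)⁻¹| • ∫ Φ : S₀ → ℝ, f Φ := by
        rw [Measure.integral_comp_smul volume f c, Module.finrank_fintype_fun_eq_card]

/-- The dilation `Φ ↦ cΦ` of `ℝ^{|S₀|}` scales Lebesgue integrals of `ℝ≥0∞`-valued functions by `|c|^{−|S₀|}` (Mathlib's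
`Measure.map_addHaar_smul`) — the part of the change of variables `Φ₀ = φ_L` carrying the Jacobian `L^{−|𝕋|/2}`. [cite: Dimock2013, §2.1 (arXiv:1108.1335v2 TeX L406–410)] -/
theorem lintegral_comp_smul {c : ℝ} (hc : c ≠ 0) (g : (S₀ → ℝ) → ℝ≥0∞) :
    ∫⁻ ψ : S₀ → ℝ, g (c • ψ) = ENNReal.ofReal |(c ^ Fintype.card S₀)⁻¹| * ∫⁻ Φ : S₀ → ℝ, g Φ := by
  have h : ∫⁻ ψ : S₀ → ℝ, g (c • ψ)
      = ∫⁻ Φ, g Φ ∂(Measure.map (fun ψ : S₀ → ℝ => c • ψ) volume) := by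
    rw [show (fun ψ : S₀ → ℝ => c • ψ) = ⇑(MeasurableEquiv.smul₀ (α := S₀ → ℝ) c hc) from rfl,
      lintegral_map_equiv]
    rfl
  rw [h, Measure.map_addHaar_smul volume hc, lintegral_smul_measure, Module.finrank_fintype_fun_eq_card,
    smul_eq_mul]

/-- **THE JACOBIAN OF THE RESCALING (`ℝ≥0∞` form, densities as non-negative functions)**: `∫⁻g(φ_c)dφ =
|c|^{−|S₀|}·∫⁻g(Φ)dΦ` for `c ≠ 0` and every `g`. [cite: Dimock2013, §2.1 (arXiv:1108.1335v2 TeX L406–410)] -/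
theorem lintegral_comp_scaleField (σ : S₁ ≃ S₀) {c : ℝ} (hc : c ≠ 0) (g : (S₀ → ℝ) → ℝ≥0∞) :
    ∫⁻ φ : S₁ → ℝ, g (scaleField c σ φ)
      = ENNReal.ofReal |(c ^ Fintype.card S₀)⁻¹| * ∫⁻ Φ : S₀ → ℝ, g Φ := by
  calc ∫⁻ φ : S₁ → ℝ, g (scaleField c σ φ)
      = ∫⁻ φ : S₁ → ℝ, (fun ψ : S₀ → ℝ => g (c • ψ))
          (MeasurableEquiv.piCongrLeft (fun _ : S₀ => ℝ) σ φ) := by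
        simp_rw [scaleField_eq_smul_relabel]
    _ = ∫⁻ ψ : S₀ → ℝ, g (c • ψ) :=
        (measurePreserving_relabel σ).lintegral_comp_emb (MeasurableEquiv.measurableEmbedding _)
          (fun ψ : S₀ → ℝ => g (c • ψ))
    _ = ENNReal.ofReal |(c ^ Fintype.card S₀)⁻¹| * ∫⁻ Φ : S₀ → ℝ, g Φ := lintegral_comp_smul hc g

/-- **The Jacobian factor `L^{−n/2}`**, written `((√L)ⁿ)⁻¹` ((scaleddensity): *"L^{−|𝕋¹_{M+N−k}|/2}"*; L409: *"dΦ₀ =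
L^{−|𝕋^{−1}_{M+N−1}|/2}dφ"*). [cite: Dimock2013, §2.1 eqs. (scaleddensity) (arXiv:1108.1335v2 TeX L427–429) and (TeX
L408–410)] -/
def jac (L : ℝ) (n : ℕ) : ℝ := (Real.sqrt L ^ n)⁻¹

/-- `L^{−n/2} > 0` for `L > 0`. [cite: Dimock2013, §2.1 eq. (scaleddensity) (arXiv:1108.1335v2 TeX L425–429)] -/
theorem jac_pos {L : ℝ} (hL : 0 < L) (n : ℕ) : 0 < jac L n :=
  inv_pos.2 (pow_pos (Real.sqrt_pos.2 hL) n)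

/-- `jac L n = L^{−n/2}` as a real power, as printed. [cite: Dimock2013, §2.1 eq. (scaleddensity) (arXiv:1108.1335v2 TeX
L427–429)] -/
theorem jac_eq_rpow {L : ℝ} (hL : 0 < L) (n : ℕ) : jac L n = L ^ (-((n : ℝ) / 2)) := by
  unfold jac
  rw [Real.sqrt_eq_rpow, ← Real.rpow_natCast, ← Real.rpow_mul hL.le, Real.rpow_neg hL.le]
  congr 2
  ring

/-- For the print's scaling constant `c = L^{−1/2}` (`LocalizedStepAssembly.scaleConst`), the Jacobian of
`integral_comp_scaleField` is `|c^{−n}| = (√L)ⁿ = (jac L n)⁻¹ = L^{n/2}`. [cite: Dimock2013, §2.1 (arXiv:1108.1335v2 TeX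
L406–410)] -/
theorem abs_inv_scaleConst_pow {L : ℝ} (hL : 0 < L) (n : ℕ) :
    |(scaleConst L ^ n)⁻¹| = (jac L n)⁻¹ := by
  have _ := hL
  unfold scaleConst jac
  rw [inv_pow, inv_inv, abs_of_nonneg (pow_nonneg (Real.sqrt_nonneg _) _)]

/-- The scaling constant `L^{−1/2}` of *"f_L(x) = L^{−1/2}f(x/L)"* is non-zero for `L > 0` (so the dilation is invertible).
[cite: Dimock2013, Lemma 5 (scaling) proof (arXiv:1108.1335v2 TeX L814); Dimock2013, §2.1 (arXiv:1108.1335v2 TeX L377–381)] -/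
theorem scaleConst_ne_zero {L : ℝ} (hL : 0 < L) : scaleConst L ≠ 0 :=
  inv_ne_zero (Real.sqrt_pos.2 hL).ne'

/-- **`dΦ₀ = L^{−|𝕋|/2}dφ`** (L408–410) in the form used: for the print's `φ_L = L^{−1/2}φ(·/L)`,
`L^{−|S₀|/2}·∫F(φ_L)dφ = ∫F(Φ₀)dΦ₀`. [cite: Dimock2013, §2.1 (arXiv:1108.1335v2 TeX L406–410)] -/
theorem integral_comp_scaleField_scaleConst {F : Type*} [NormedAddCommGroup F] [NormedSpace ℝ F] {L : ℝ}
    (hL : 0 < L) (σ : S₁ ≃ S₀) (f : (S₀ → ℝ) → F) :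
    jac L (Fintype.card S₀) • ∫ φ : S₁ → ℝ, f (scaleField (scaleConst L) σ φ) = ∫ Φ : S₀ → ℝ, f Φ := by
  rw [integral_comp_scaleField, abs_inv_scaleConst_pow hL, smul_smul,
    mul_inv_cancel₀ (jac_pos hL _).ne', one_smul]

/-- The `k`-fold form *"dφ^{(k)} = L^{−k|𝕋^{−k}_{M+N−k}|/2}dφ"* of LEMMA `second` (L459–461): for `c = (L^{−1/2})^k` the
Jacobian is `(L^{|S₀|/2})^k`. [cite: Dimock2013, §2.1 Lemma `second` (arXiv:1108.1335v2 TeX L457–461)] -/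
theorem integral_comp_scaleField_scaleConst_pow {F : Type*} [NormedAddCommGroup F] [NormedSpace ℝ F] {L : ℝ}
    (hL : 0 < L) (k : ℕ) (σ : S₁ ≃ S₀) (f : (S₀ → ℝ) → F) :
    jac L (Fintype.card S₀) ^ k • ∫ φ : S₁ → ℝ, f (scaleField (scaleConst L ^ k) σ φ)
      = ∫ Φ : S₀ → ℝ, f Φ := by
  have hj : (jac L (Fintype.card S₀) ^ k) * |((scaleConst L ^ k) ^ Fintype.card S₀)⁻¹| = 1 := by
    rw [← pow_mul, mul_comm k, pow_mul, ← inv_pow, abs_pow, abs_inv_scaleConst_pow hL, ← mul_pow,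
      mul_inv_cancel₀ (jac_pos hL _).ne', one_pow]
  rw [integral_comp_scaleField, smul_smul, hj, one_smul]

end Jacobian

/-! ## Part 3 — (scaleddensity) `ρ_{k+1}(Φ) = ρ̃_{k+1}(Φ_L)L^{−|𝕋¹|/2}` and *"This preserves the integral"* (L382–390,
L425–435; II L2339, §3.15 L5664; III L196–198) -/

section ScaledDensity

variable {S₀ S₁ : Type*} [Fintype S₀] [Fintype S₁]

/-- **(scaleddensity)**: `ρ_{k+1}(Φ_{k+1}) := ρ̃_{k+1}(Φ_{k+1,L})·L^{−|𝕋¹_{M+N−k}|/2}` — the density on the unit lattice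
`S₁` (print `𝕋⁰_{M+N−k−1}`) obtained from a density `ρ̃` on the `L`-lattice `S₀` (print `𝕋¹_{M+N−k}`), `Φ_L = scaleField
L^{−1/2} σ Φ`. [cite: Dimock2013, §2.1 eq. (scaleddensity) (arXiv:1108.1335v2 TeX L425–429) and ρ₁ (TeX L382–385);
Dimock2013BalabanII, §3.3 (arXiv:1212.5562v2 TeX L2337–2340) and §3.15 (TeX L5663–5665); Dimock2013BalabanIII, §1
(arXiv:1304.0705v1 TeX L196–198)] -/
def scaledDensity (L : ℝ) (σ : S₁ ≃ S₀) (ρt : (S₀ → ℝ) → ℝ) : (S₁ → ℝ) → ℝ :=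
  fun Φ => ρt (scaleField (scaleConst L) σ Φ) * jac L (Fintype.card S₀)

omit [Fintype S₁] in
/-- (scaleddensity) unfolded: `ρ_{k+1}(Φ) = ρ̃(Φ_L)·L^{−|𝕋¹|/2}`. [cite: Dimock2013, §2.1 eq. (scaleddensity) (arXiv:1108.1335v2 TeX L425–429)] -/
theorem scaledDensity_apply (L : ℝ) (σ : S₁ ≃ S₀) (ρt : (S₀ → ℝ) → ℝ) (Φ : S₁ → ℝ) :
    scaledDensity L σ ρt Φ = ρt (scaleField (scaleConst L) σ Φ) * jac L (Fintype.card S₀) := rfl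

omit [Fintype S₁] in
/-- A non-negative `ρ̃` gives a non-negative `ρ_{k+1}` (`L > 0`): (scaleddensity) maps densities to densities. [cite: Dimock2013, §2.1 eq. (scaleddensity) (arXiv:1108.1335v2 TeX L425–429)] -/
theorem scaledDensity_nonneg {L : ℝ} (hL : 0 < L) (σ : S₁ ≃ S₀) {ρt : (S₀ → ℝ) → ℝ} (hρ : ∀ Ψ, 0 ≤ ρt Ψ)
    (Φ : S₁ → ℝ) : 0 ≤ scaledDensity L σ ρt Φ :=
  mul_nonneg (hρ _) (jac_pos hL _).le

/-- **"This preserves the integral"** (L386–390; (preserve)'s first equality L430–433): `∫ρ̃(Φ_L)L^{−|𝕋¹|/2}dΦ =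
∫ρ̃(Ψ)dΨ` for EVERY `ρ̃` — the Jacobian of `Φ ↦ Φ_L` is exactly `L^{+|𝕋¹|/2}`. [cite: Dimock2013, §2.1 (arXiv:1108.1335v2
TeX L386–390) and eq. (preserve) (TeX L430–435)] -/
theorem integral_scaledDensity {L : ℝ} (hL : 0 < L) (σ : S₁ ≃ S₀) (ρt : (S₀ → ℝ) → ℝ) :
    ∫ Φ : S₁ → ℝ, scaledDensity L σ ρt Φ = ∫ Ψ : S₀ → ℝ, ρt Ψ := by
  simp only [scaledDensity_apply]
  rw [integral_mul_const, integral_comp_scaleField, abs_inv_scaleConst_pow hL, smul_eq_mul, mul_comm,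
    ← mul_assoc, mul_inv_cancel₀ (jac_pos hL _).ne', one_mul]

/-- `ρ_{k+1}` of (scaleddensity) is integrable when `ρ̃_{k+1}` is (finite partition function preserved). [cite: Dimock2013, §2.1 eq. (scaleddensity) (arXiv:1108.1335v2 TeX L425–429)] -/
theorem integrable_scaledDensity {L : ℝ} (hL : 0 < L) (σ : S₁ ≃ S₀) {ρt : (S₀ → ℝ) → ℝ} (hρ : Integrable ρt) :
    Integrable (scaledDensity L σ ρt) := by
  have h1 : Integrable (fun ψ : S₀ → ℝ => ρt (scaleConst L • ψ)) :=
    (integrable_comp_smul_iff volume ρt (scaleConst_ne_zero hL)).2 hρ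
  have h2 : Integrable ((fun ψ : S₀ → ℝ => ρt (scaleConst L • ψ))
      ∘ (MeasurableEquiv.piCongrLeft (fun _ : S₀ => ℝ) σ)) :=
    ((measurePreserving_relabel σ).integrable_comp_emb (MeasurableEquiv.measurableEmbedding _)).2 h1
  have h3 : Integrable (fun Φ : S₁ → ℝ => ρt (scaleField (scaleConst L) σ Φ)) := by
    refine h2.congr (Filter.Eventually.of_forall fun Φ => ?_)
    simp only [Function.comp_apply, scaleField_eq_smul_relabel]
  exact h3.mul_const _

/-- **(scaleddensity) for `ℝ≥0∞`-valued densities**: `ρ_{k+1}(Φ) = ρ̃(Φ_L)·L^{−|𝕋¹|/2}`. [cite: Dimock2013, §2.1 eq.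
(scaleddensity) (arXiv:1108.1335v2 TeX L425–429)] -/
def scaledDensityE (L : ℝ) (σ : S₁ ≃ S₀) (g : (S₀ → ℝ) → ℝ≥0∞) : (S₁ → ℝ) → ℝ≥0∞ :=
  fun Φ => g (scaleField (scaleConst L) σ Φ) * ENNReal.ofReal (jac L (Fintype.card S₀))

/-- **"This preserves the integral"**, `ℝ≥0∞` form, NO hypothesis on the density: `∫⁻ρ̃(Φ_L)L^{−|𝕋¹|/2}dΦ = ∫⁻ρ̃`.
[cite: Dimock2013, §2.1 (arXiv:1108.1335v2 TeX L386–390) and eq. (preserve) (TeX L430–435)] -/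
theorem lintegral_scaledDensityE {L : ℝ} (hL : 0 < L) (σ : S₁ ≃ S₀) (g : (S₀ → ℝ) → ℝ≥0∞) :
    ∫⁻ Φ : S₁ → ℝ, scaledDensityE L σ g Φ = ∫⁻ Ψ : S₀ → ℝ, g Ψ := by
  unfold scaledDensityE
  rw [lintegral_mul_const' _ _ ENNReal.ofReal_ne_top, lintegral_comp_scaleField σ (scaleConst_ne_zero hL) g,
    abs_inv_scaleConst_pow hL, mul_comm (ENNReal.ofReal _) _, mul_assoc,
    ← ENNReal.ofReal_mul (inv_pos.2 (jac_pos hL _)).le, inv_mul_cancel₀ (jac_pos hL _).ne',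
    ENNReal.ofReal_one, mul_one]

end ScaledDensity

/-! ## Part 4 — (first0) ∕ (kth) ∕ (lime): the block-averaging convolution `ρ̃_{k+1} = 𝒩^{−1}_{aL}∫exp(−½aL|Φ_{k+1} −
QΦ_k|²)ρ_k dΦ_k` and *"the constant is chosen so that ∫ρ̃₁ = ∫ρ₀"* (L340–370, L414–424; II L2331–2336; III L190–195) -/

section BlockDensity

variable {S₀ S₀' : Type*} [Fintype S₀] [Fintype S₀']

/-- **(first0) ∕ (kth) ∕ (lime)**: `ρ̃_{k+1}(Φ_{k+1}) := 𝒩^{−1}_{aL,𝕋¹_{M+N−k}} ∫exp(−½aL|Φ_{k+1} − QΦ_k|²)ρ_k(Φ_k)dΦ_k` — here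
with the Gaussian width `aL` a single parameter and `Q` any map from fields on `S₀` (print `𝕋⁰_{M+N−k}`) to fields on
`S₀′` (print `𝕋¹_{M+N−k}`). [cite: Dimock2013, §2.1 eqs. (first0), (kth) (arXiv:1108.1335v2 TeX L340–349, L414–424);
Dimock2013BalabanII, §3.3 eq. (lime) (arXiv:1212.5562v2 TeX L2331–2336); Dimock2013BalabanIII, §1 (arXiv:1304.0705v1
TeX L190–195)] -/
def blockDensity (aL : ℝ) (Q : (S₀ → ℝ) → (S₀' → ℝ)) (ρ : (S₀ → ℝ) → ℝ) : (S₀' → ℝ) → ℝ :=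
  fun Φ₁ => (normConst aL (Fintype.card S₀'))⁻¹
    * ∫ Φ₀ : S₀ → ℝ, exp (-(aL / 2) * sqNorm (Φ₁ - Q Φ₀)) * ρ Φ₀

/-- (first0) ∕ (kth) unfolded. [cite: Dimock2013, §2.1 eqs. (first0), (kth) (arXiv:1108.1335v2 TeX L340–349, L414–424)] -/
theorem blockDensity_apply (aL : ℝ) (Q : (S₀ → ℝ) → (S₀' → ℝ)) (ρ : (S₀ → ℝ) → ℝ) (Φ₁ : S₀' → ℝ) :
    blockDensity aL Q ρ Φ₁ = (normConst aL (Fintype.card S₀'))⁻¹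
      * ∫ Φ₀ : S₀ → ℝ, exp (-(aL / 2) * sqNorm (Φ₁ - Q Φ₀)) * ρ Φ₀ := rfl

/-- A non-negative `ρ_k` gives a non-negative `ρ̃_{k+1}` (`aL > 0`): (kth) maps densities to densities. [cite: Dimock2013, §2.1 eqs. (first0), (kth) (arXiv:1108.1335v2 TeX L340–349, L414–424)] -/
theorem blockDensity_nonneg {aL : ℝ} (haL : 0 < aL) (Q : (S₀ → ℝ) → (S₀' → ℝ)) {ρ : (S₀ → ℝ) → ℝ}
    (hρ : ∀ Φ, 0 ≤ ρ Φ) (Φ₁ : S₀' → ℝ) : 0 ≤ blockDensity aL Q ρ Φ₁ :=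
  mul_nonneg (inv_pos.2 (normConst_pos haL _)).le
    (integral_nonneg fun Φ₀ => mul_nonneg (exp_pos _).le (hρ Φ₀))

omit [Fintype S₀] [Fintype S₀'] in
/-- The block averaging `(Qφ)(y) = w·Σ_{x∈B(y)}φ(x)` (`LocalizedStepAssembly.blockAvg`, print L318–320) is continuous,
hence measurable — an admissible `Q`. [cite: Dimock2013, §2.1 (arXiv:1108.1335v2 TeX L316–324)] -/
theorem continuous_blockAvg (B : S₀' → Finset S₀) (w : ℝ) :
    Continuous (blockAvg B w : (S₀ → ℝ) → (S₀' → ℝ)) := by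
  unfold blockAvg
  exact continuous_pi fun y => continuous_const.mul (continuous_finsetSum _ fun x _ => continuous_apply x)

/-- The block averaging `Q = blockAvg B w` is measurable (an admissible `Q` for (first0) ∕ (kth)). [cite: Dimock2013, §2.1
(arXiv:1108.1335v2 TeX L316–324)] -/
theorem measurable_blockAvg (B : S₀' → Finset S₀) (w : ℝ) :
    Measurable (blockAvg B w : (S₀ → ℝ) → (S₀' → ℝ)) :=
  (continuous_blockAvg B w).measurable

/-- **The shear** `(Φ₀, Φ₁) ↦ (Φ₀, Φ₁ − QΦ₀)` of the product field space, a measurable equivalence (inverse `(Φ₀, Ψ) ↦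
(Φ₀, Ψ + QΦ₀)`): along it the kernel `exp(−½aL|Φ₁ − QΦ₀|²)ρ(Φ₀)` becomes the PRODUCT `ρ(Φ₀)·exp(−½aL|Ψ|²)` — the device
behind *"the constant is chosen so that ∫ρ̃₁ = ∫ρ₀"*. [cite: Dimock2013, §2.1 (arXiv:1108.1335v2 TeX L366–370)] -/
def shear (Q : (S₀ → ℝ) → (S₀' → ℝ)) (hQ : Measurable Q) :
    (S₀ → ℝ) × (S₀' → ℝ) ≃ᵐ (S₀ → ℝ) × (S₀' → ℝ) where
  toFun p := (p.1, p.2 - Q p.1)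
  invFun p := (p.1, p.2 + Q p.1)
  left_inv p := by simp
  right_inv p := by simp
  measurable_toFun := measurable_fst.prodMk (measurable_snd.sub (hQ.comp measurable_fst))
  measurable_invFun := measurable_fst.prodMk (measurable_snd.add (hQ.comp measurable_fst))

omit [Fintype S₀] [Fintype S₀'] in
/-- The shear, unfolded. [cite: Dimock2013, §2.1 (arXiv:1108.1335v2 TeX L366–370)] -/
@[simp] theorem shear_apply (Q : (S₀ → ℝ) → (S₀' → ℝ)) (hQ : Measurable Q) (p : (S₀ → ℝ) × (S₀' → ℝ)) :
    shear Q hQ p = (p.1, p.2 - Q p.1) := rfl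

/-- **The shear preserves `dΦ₀dΦ₁`** — fibrewise translation invariance of Lebesgue measure `dΦ₁` (the mechanism of
*"the constant is chosen so that ∫ρ̃₁ = ∫ρ₀"*: for each `Φ₀` the `Φ₁`-integral of `exp(−½aL|Φ₁ − QΦ₀|²)` is `𝒩_{aL}`,
whatever `QΦ₀` is; Mathlib's `MeasurePreserving.skew_product` + `map_sub_right_eq_self`). [cite: Dimock2013, §2.1 (arXiv:1108.1335v2 TeX L366–370)] -/
theorem measurePreserving_shear (Q : (S₀ → ℝ) → (S₀' → ℝ)) (hQ : Measurable Q) :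
    MeasurePreserving (shear Q hQ) ((volume : Measure (S₀ → ℝ)).prod (volume : Measure (S₀' → ℝ)))
      ((volume : Measure (S₀ → ℝ)).prod (volume : Measure (S₀' → ℝ))) := by
  have h := (MeasurePreserving.id (volume : Measure (S₀ → ℝ))).skew_product
    (μc := (volume : Measure (S₀' → ℝ))) (μd := (volume : Measure (S₀' → ℝ)))
    (g := fun (x : S₀ → ℝ) (y : S₀' → ℝ) => y - Q x)
    (measurable_snd.sub (hQ.comp measurable_fst))
    (Filter.Eventually.of_forall fun x => map_sub_right_eq_self volume (Q x))
  exact h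

/-- The kernel `(Φ₀, Φ₁) ↦ exp(−½aL|Φ₁ − QΦ₀|²)ρ(Φ₀)` of (first0) ∕ (kth) is integrable on the product field space when `ρ`
is integrable (`aL > 0`, `Q` measurable): it is the product `ρ ⊗ exp(−½aL|·|²)` composed with the shear — the Tonelli
licence for *"the constant is chosen so that ∫ρ̃₁ = ∫ρ₀"*. [cite: Dimock2013, §2.1 (arXiv:1108.1335v2 TeX L366–370)] -/
theorem integrable_blockKernel {aL : ℝ} (haL : 0 < aL) {Q : (S₀ → ℝ) → (S₀' → ℝ)} (hQ : Measurable Q)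
    {ρ : (S₀ → ℝ) → ℝ} (hρ : Integrable ρ) :
    Integrable (fun p : (S₀ → ℝ) × (S₀' → ℝ) => exp (-(aL / 2) * sqNorm (p.2 - Q p.1)) * ρ p.1)
      ((volume : Measure (S₀ → ℝ)).prod (volume : Measure (S₀' → ℝ))) := by
  have hG : Integrable (fun p : (S₀ → ℝ) × (S₀' → ℝ) => ρ p.1 * exp (-(aL / 2) * sqNorm p.2))
      ((volume : Measure (S₀ → ℝ)).prod (volume : Measure (S₀' → ℝ))) :=
    hρ.mul_prod (integrable_exp_neg_half_mul_sqNorm haL)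
  have h2 := ((measurePreserving_shear Q hQ).integrable_comp_emb (shear Q hQ).measurableEmbedding).2 hG
  have hfun : (fun p : (S₀ → ℝ) × (S₀' → ℝ) => exp (-(aL / 2) * sqNorm (p.2 - Q p.1)) * ρ p.1)
      = (fun p : (S₀ → ℝ) × (S₀' → ℝ) => ρ p.1 * exp (-(aL / 2) * sqNorm p.2)) ∘ (shear Q hQ) := by
    funext p
    simp only [Function.comp_apply, shear_apply]
    ring
  rw [hfun]
  exact h2

/-- **"the constant is chosen so that ∫ρ̃₁(Φ₁)dΦ₁ = ∫ρ₀(Φ₀)dΦ₀"** (L366–370; (preserve)'s middle equality): for every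
INTEGRABLE `ρ_k`, every measurable `Q` and `aL > 0`, `∫ρ̃_{k+1} = ∫ρ_k`.  Proof as the print implies: Tonelli, the shear
`Φ₁ ↦ Φ₁ − QΦ₀` (translation invariance of `dΦ₁`), `∫∫ = (∫ρ_k)·𝒩_{aL,|𝕋¹|}` and the prefactor `𝒩^{−1}_{aL,|𝕋¹|}`.
[cite: Dimock2013, §2.1 (arXiv:1108.1335v2 TeX L356–370) and eq. (preserve) (TeX L430–435); Dimock2013BalabanIII, §1
(arXiv:1304.0705v1 TeX L187–204)] -/
theorem integral_blockDensity {aL : ℝ} (haL : 0 < aL) {Q : (S₀ → ℝ) → (S₀' → ℝ)} (hQ : Measurable Q)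
    {ρ : (S₀ → ℝ) → ℝ} (hρ : Integrable ρ) :
    ∫ Φ₁ : S₀' → ℝ, blockDensity aL Q ρ Φ₁ = ∫ Φ₀ : S₀ → ℝ, ρ Φ₀ := by
  have hF := integrable_blockKernel haL hQ hρ
  simp only [blockDensity_apply]
  rw [integral_const_mul]
  have h1 : ∫ Φ₁ : S₀' → ℝ, ∫ Φ₀ : S₀ → ℝ, exp (-(aL / 2) * sqNorm (Φ₁ - Q Φ₀)) * ρ Φ₀
      = ∫ p, exp (-(aL / 2) * sqNorm (p.2 - Q p.1)) * ρ p.1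
          ∂((volume : Measure (S₀ → ℝ)).prod (volume : Measure (S₀' → ℝ))) :=
    (integral_prod_symm _ hF).symm
  have h2 : ∫ p, exp (-(aL / 2) * sqNorm (p.2 - Q p.1)) * ρ p.1
          ∂((volume : Measure (S₀ → ℝ)).prod (volume : Measure (S₀' → ℝ)))
      = ∫ p, ρ p.1 * exp (-(aL / 2) * sqNorm p.2)
          ∂((volume : Measure (S₀ → ℝ)).prod (volume : Measure (S₀' → ℝ))) := by
    have h := (measurePreserving_shear Q hQ).integral_comp'
      (fun p : (S₀ → ℝ) × (S₀' → ℝ) => ρ p.1 * exp (-(aL / 2) * sqNorm p.2))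
    simp only [shear_apply] at h
    rw [← h]
    congr 1
    funext p
    ring
  have h3 : ∫ p, ρ p.1 * exp (-(aL / 2) * sqNorm p.2)
          ∂((volume : Measure (S₀ → ℝ)).prod (volume : Measure (S₀' → ℝ)))
      = (∫ Φ₀ : S₀ → ℝ, ρ Φ₀) * ∫ Ψ : S₀' → ℝ, exp (-(aL / 2) * sqNorm Ψ) :=
    integral_prod_mul (μ := (volume : Measure (S₀ → ℝ))) (ν := (volume : Measure (S₀' → ℝ))) ρ
      (fun Ψ : S₀' → ℝ => exp (-(aL / 2) * sqNorm Ψ))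
  rw [h1, h2, h3, integral_exp_neg_half_mul_sqNorm haL, mul_comm (∫ Φ₀ : S₀ → ℝ, ρ Φ₀) _, ← mul_assoc,
    inv_mul_cancel₀ (normConst_pos haL _).ne', one_mul]

/-- `ρ̃_{k+1}` of (kth) is integrable when `ρ_k` is (finite partition function preserved). [cite: Dimock2013, §2.1 eqs. (first0), (kth) (arXiv:1108.1335v2 TeX L340–349, L414–424)] -/
theorem integrable_blockDensity {aL : ℝ} (haL : 0 < aL) {Q : (S₀ → ℝ) → (S₀' → ℝ)} (hQ : Measurable Q)
    {ρ : (S₀ → ℝ) → ℝ} (hρ : Integrable ρ) : Integrable (blockDensity aL Q ρ) := by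
  have hF := integrable_blockKernel haL hQ hρ
  have h := hF.integral_prod_right
  exact h.const_mul _

end BlockDensity

/-! ## Part 5 — The RG step on densities and (preserve): `∫ρ_{k+1} = ∫ρ_k = ∫ρ₀`; *"for any k the partition function
can be expressed as Z_{M,N} = ∫ρ^N_k(Φ_k)dΦ_k"* (L430–435; III L200–204) -/

section Step

variable {S₀ S₀' S₁ : Type*} [Fintype S₀] [Fintype S₀'] [Fintype S₁]

/-- **THE RG STEP ON DENSITIES** ((kth) then (scaleddensity); II (lime) and L2339; III L190–198): from `ρ_k` on `S₀ → ℝ`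
(print `𝕋⁰_{M+N−k}`), block-average with width `aL` onto `S₀′ → ℝ` (print `𝕋¹_{M+N−k}`), then rescale to `S₁ → ℝ` (print
`𝕋⁰_{M+N−k−1}`) along `σ : S₁ ≃ S₀′` (*"y ↦ Ly"*). [cite: Dimock2013, §2.1 eqs. (kth), (scaleddensity) (arXiv:1108.1335v2
TeX L414–429); Dimock2013BalabanII, §3.3 (arXiv:1212.5562v2 TeX L2329–2340); Dimock2013BalabanIII, §1 (arXiv:1304.0705v1
TeX L187–199)] -/
def rgStep (a L : ℝ) (Q : (S₀ → ℝ) → (S₀' → ℝ)) (σ : S₁ ≃ S₀') (ρ : (S₀ → ℝ) → ℝ) : (S₁ → ℝ) → ℝ :=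
  scaledDensity L σ (blockDensity (a * L) Q ρ)

omit [Fintype S₁] in
/-- The step, unfolded: block-average at width `aL` ((kth)), then rescale ((scaleddensity)). [cite: Dimock2013, §2.1 eqs. (kth), (scaleddensity) (arXiv:1108.1335v2 TeX L414–429)] -/
theorem rgStep_eq (a L : ℝ) (Q : (S₀ → ℝ) → (S₀' → ℝ)) (σ : S₁ ≃ S₀') (ρ : (S₀ → ℝ) → ℝ) :
    rgStep a L Q σ ρ = scaledDensity L σ (blockDensity (a * L) Q ρ) := rfl

/-- **(preserve), one step**: `∫ρ_{k+1}(Φ_{k+1})dΦ_{k+1} = ∫ρ_k(Φ_k)dΦ_k` for integrable `ρ_k`, measurable `Q`, `a, L > 0`.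
[cite: Dimock2013, §2.1 eq. (preserve) (arXiv:1108.1335v2 TeX L430–435); Dimock2013BalabanIII, §1 (arXiv:1304.0705v1 TeX
L200–204)] -/
theorem integral_rgStep {a L : ℝ} (ha : 0 < a) (hL : 0 < L) {Q : (S₀ → ℝ) → (S₀' → ℝ)} (hQ : Measurable Q)
    (σ : S₁ ≃ S₀') {ρ : (S₀ → ℝ) → ℝ} (hρ : Integrable ρ) :
    ∫ Φ : S₁ → ℝ, rgStep a L Q σ ρ Φ = ∫ Φ : S₀ → ℝ, ρ Φ := by
  rw [rgStep_eq, integral_scaledDensity hL, integral_blockDensity (mul_pos ha hL) hQ hρ]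

/-- The step (kth) → (scaleddensity) preserves integrability (finite partition function). [cite: Dimock2013, §2.1 eqs. (kth), (scaleddensity) (arXiv:1108.1335v2 TeX L414–429)] -/
theorem integrable_rgStep {a L : ℝ} (ha : 0 < a) (hL : 0 < L) {Q : (S₀ → ℝ) → (S₀' → ℝ)} (hQ : Measurable Q)
    (σ : S₁ ≃ S₀') {ρ : (S₀ → ℝ) → ℝ} (hρ : Integrable ρ) : Integrable (rgStep a L Q σ ρ) :=
  integrable_scaledDensity hL σ (integrable_blockDensity (mul_pos ha hL) hQ hρ)

omit [Fintype S₁] in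
/-- The step (kth) → (scaleddensity) preserves non-negativity (densities stay densities). [cite: Dimock2013, §2.1 eqs. (kth), (scaleddensity) (arXiv:1108.1335v2 TeX L414–429)] -/
theorem rgStep_nonneg {a L : ℝ} (ha : 0 < a) (hL : 0 < L) (Q : (S₀ → ℝ) → (S₀' → ℝ)) (σ : S₁ ≃ S₀')
    {ρ : (S₀ → ℝ) → ℝ} (hρ : ∀ Φ, 0 ≤ ρ Φ) (Φ : S₁ → ℝ) : 0 ≤ rgStep a L Q σ ρ Φ :=
  scaledDensity_nonneg hL σ (blockDensity_nonneg (mul_pos ha hL) Q hρ) Φ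

end Step

section Tower

variable {S T : ℕ → Type*} [∀ k, Fintype (S k)] [∀ k, Fintype (T k)]

/-- **The tower of densities** *"We repeat this step a number of times. After k steps we will have a density ρ_k(Φ_k)
defined on functions Φ_k : 𝕋⁰_{M+N−k} → ℝ"* (L414–416): lattices `S k` (print `𝕋⁰_{M+N−k}`) and `T k` (print
`𝕋¹_{M+N−k}`), averaging maps `Q k`, relabellings `σ k : S (k+1) ≃ T k`; `ρ₀` given, `ρ_{k+1} = rgStep (Q k) (σ k) ρ_k`.
[cite: Dimock2013, §2.1 (arXiv:1108.1335v2 TeX L414–429); Dimock2013BalabanII, §3.3 (arXiv:1212.5562v2 TeX L2329–2340)] -/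
def densitySeq (a L : ℝ) (Q : ∀ k, (S k → ℝ) → (T k → ℝ)) (σ : ∀ k, S (k + 1) ≃ T k)
    (ρ₀ : (S 0 → ℝ) → ℝ) : ∀ k, (S k → ℝ) → ℝ
  | 0 => ρ₀
  | k + 1 => rgStep a L (Q k) (σ k) (densitySeq a L Q σ ρ₀ k)

/-- `ρ_0 = ρ₀` (the start of the tower, L340 *"starting with the density ρ₀"*). [cite: Dimock2013, §2.1 (arXiv:1108.1335v2
TeX L340–341, L414–416)] -/
@[simp] theorem densitySeq_zero (a L : ℝ) (Q : ∀ k, (S k → ℝ) → (T k → ℝ)) (σ : ∀ k, S (k + 1) ≃ T k)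
    (ρ₀ : (S 0 → ℝ) → ℝ) : densitySeq a L Q σ ρ₀ 0 = ρ₀ := rfl

/-- `ρ_{k+1} = rgStep ρ_k` (*"The next step is to define …"* L415–429). [cite: Dimock2013, §2.1 eqs. (kth), (scaleddensity) (arXiv:1108.1335v2 TeX L414–429)] -/
theorem densitySeq_succ (a L : ℝ) (Q : ∀ k, (S k → ℝ) → (T k → ℝ)) (σ : ∀ k, S (k + 1) ≃ T k)
    (ρ₀ : (S 0 → ℝ) → ℝ) (k : ℕ) :
    densitySeq a L Q σ ρ₀ (k + 1) = rgStep a L (Q k) (σ k) (densitySeq a L Q σ ρ₀ k) := rfl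

/-- Every `ρ_k` is integrable and **(preserve)**: `∫ρ_k(Φ_k)dΦ_k = ∫ρ₀(Φ₀)dΦ₀` — *"Then for any k the partition function can
be expressed as Z_{M,N} = ∫ρ^N_k(Φ_k)dΦ_k"* (III L200–204), for integrable `ρ₀`, measurable `Q_k`, `a, L > 0`.
[cite: Dimock2013, §2.1 eq. (preserve) (arXiv:1108.1335v2 TeX L430–435); Dimock2013BalabanIII, §1 (arXiv:1304.0705v1 TeX
L200–204)] -/
theorem integrable_densitySeq_and_integral {a L : ℝ} (ha : 0 < a) (hL : 0 < L)
    {Q : ∀ k, (S k → ℝ) → (T k → ℝ)} (hQ : ∀ k, Measurable (Q k)) (σ : ∀ k, S (k + 1) ≃ T k)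
    {ρ₀ : (S 0 → ℝ) → ℝ} (hρ₀ : Integrable ρ₀) :
    ∀ k, Integrable (densitySeq a L Q σ ρ₀ k)
      ∧ ∫ Φ : S k → ℝ, densitySeq a L Q σ ρ₀ k Φ = ∫ Φ : S 0 → ℝ, ρ₀ Φ
  | 0 => ⟨hρ₀, rfl⟩
  | k + 1 => by
      obtain ⟨hi, hI⟩ := integrable_densitySeq_and_integral ha hL hQ σ hρ₀ k
      refine ⟨?_, ?_⟩
      · rw [densitySeq_succ]
        exact integrable_rgStep ha hL (hQ k) (σ k) hi
      · rw [densitySeq_succ, integral_rgStep ha hL (hQ k) (σ k) hi, hI]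

/-- **`Z_{M,N} = ∫ρ^N_k(Φ_k)dΦ_k` for every `k`** (III L200–204; (preserve) L430–435). [cite: Dimock2013BalabanIII, §1
(arXiv:1304.0705v1 TeX L200–204); Dimock2013, §2.1 eq. (preserve) (arXiv:1108.1335v2 TeX L430–435)] -/
theorem integral_densitySeq {a L : ℝ} (ha : 0 < a) (hL : 0 < L) {Q : ∀ k, (S k → ℝ) → (T k → ℝ)}
    (hQ : ∀ k, Measurable (Q k)) (σ : ∀ k, S (k + 1) ≃ T k) {ρ₀ : (S 0 → ℝ) → ℝ} (hρ₀ : Integrable ρ₀)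
    (k : ℕ) : ∫ Φ : S k → ℝ, densitySeq a L Q σ ρ₀ k Φ = ∫ Φ : S 0 → ℝ, ρ₀ Φ :=
  (integrable_densitySeq_and_integral ha hL hQ σ hρ₀ k).2

/-- Densities stay non-negative along the tower (every `ρ_k` is a density). [cite: Dimock2013, §2.1 eqs. (kth), (scaleddensity) (arXiv:1108.1335v2 TeX L414–429)] -/
theorem densitySeq_nonneg {a L : ℝ} (ha : 0 < a) (hL : 0 < L) (Q : ∀ k, (S k → ℝ) → (T k → ℝ))
    (σ : ∀ k, S (k + 1) ≃ T k) {ρ₀ : (S 0 → ℝ) → ℝ} (hρ₀ : ∀ Φ, 0 ≤ ρ₀ Φ) :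
    ∀ k Φ, 0 ≤ densitySeq a L Q σ ρ₀ k Φ
  | 0 => hρ₀
  | k + 1 => fun Φ => by
      rw [densitySeq_succ]
      exact rgStep_nonneg ha hL (Q k) (σ k) (densitySeq_nonneg ha hL Q σ hρ₀ k) Φ

end Tower

/-! ## Part 6 — The constants of THEOREM 3.1 item 1: `𝒩^{−1}_{aL}L^{−|𝕋¹|/2} = 𝒩^{−1}_a` (L394), `Z_{k+1} = Z⁰_{k+1}L^{−|𝕋¹|/2}`
(II L5672) with `Z⁰_{k+1} = 𝒩^{−1}_{aL}(2π)^{|𝕋⁰|/2}(det C_k)^{1/2}Z_k` (II L3286) IS (Ziterate) (I L805–807) -/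

section Constants

/-- **`𝒩^{−1}_{aL,𝕋¹}L^{−|𝕋¹|/2} = 𝒩^{−1}_{a,𝕋¹}`** (L394, verbatim shape: inverse constant times the Jacobian factor).
[cite: Dimock2013, §2.1 (arXiv:1108.1335v2 TeX L394)] -/
theorem normConst_inv_mul_jac {a L : ℝ} (ha : 0 < a) (hL : 0 < L) (n : ℕ) :
    (normConst (a * L) n)⁻¹ * jac L n = (normConst a n)⁻¹ := by
  rw [← normConst_mul_sqrt_pow ha hL n, jac, mul_inv]

/-- **`Z⁰_{k+1} ≡ 𝒩^{−1}_{aL,𝕋¹_{M+N−k}}·g·Z_k`** with `g` the Gaussian factor `(2π)^{½|𝕋⁰_{M+N−k}|}(det C_k)^{1/2}` of the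
one-step integration (II L3284–3287; = LEMMA `tiny`'s constant L753; `g` = `GaussianSingleStep.fluctConst` by name, here
a real parameter), `n = |𝕋¹_{M+N−k}|`. [cite: Dimock2013BalabanII, §3.8 (arXiv:1212.5562v2 TeX L3284–3287); Dimock2013,
Lemma `tiny` eq. (understand) (arXiv:1108.1335v2 TeX L748–754)] -/
def Z0next (a L : ℝ) (n : ℕ) (g Zk : ℝ) : ℝ := (normConst (a * L) n)⁻¹ * g * Zk

/-- **"Identify Z_{k+1} = Z⁰_{k+1}L^{−|𝕋¹_{M+N−k}|/2}"** (II §3.15 L5672) IS LEMMA 5's **(Ziterate)** *"Z_{k+1} = Z_k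
𝒩^{−1}_{a,𝕋¹_{M+N−k}}(2π)^{|𝕋⁰_{M+N−k}|/2}(det C_k)^{1/2}"* (I L805–807): the Jacobian `L^{−|𝕋¹|/2}` of (scaleddensity)
converts `𝒩^{−1}_{aL}` into `𝒩^{−1}_a` (L394). [cite: Dimock2013BalabanII, §3.15 (arXiv:1212.5562v2 TeX L5672);
Dimock2013, Lemma 5 (scaling) eq. (Ziterate) (arXiv:1108.1335v2 TeX L797–807) and §2.1 (TeX L394)] -/
theorem Ziterate {a L : ℝ} (ha : 0 < a) (hL : 0 < L) (n : ℕ) (g Zk : ℝ) :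
    Z0next a L n g Zk * jac L n = Zk * ((normConst a n)⁻¹ * g) := by
  rw [Z0next, ← normConst_inv_mul_jac ha hL n]
  ring

/-- Gen 42's normalization sequence (`LocalizedStepAssembly.Zseq`, THEOREM 3.1 item 1: `Z₀ = 1`, `Z_{k+1} = Z_kz_k`) with
the one-step factors `z_k = 𝒩^{−1}_{a,n_k}·g_k` obeys (Ziterate) in the printed form `Z_{k+1} = Z⁰_{k+1}L^{−n_k/2}`.
[cite: Dimock2013BalabanII, Theorem 3.1 item 1 (arXiv:1212.5562v2 TeX L2393–2397) and §3.15 (TeX L5672); Dimock2013,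
eq. (Ziterate) (arXiv:1108.1335v2 TeX L805–807)] -/
theorem Zseq_succ_eq_Ziterate {a L : ℝ} (ha : 0 < a) (hL : 0 < L) (n : ℕ → ℕ) (g : ℕ → ℝ) (k : ℕ) :
    Zseq (fun j => (normConst a (n j))⁻¹ * g j) (k + 1)
      = Z0next a L (n k) (g k) (Zseq (fun j => (normConst a (n j))⁻¹ * g j) k) * jac L (n k) := by
  rw [Ziterate ha hL, Zseq]

end Constants

/-! ## Part 7 — (first): `ρ₁(Φ₁) = 𝒩^{−1}_a∫exp(−(a/2L²)‖Φ_{1,L} − QΦ₀‖²)ρ₀dΦ₀ = 𝒩^{−1}_a∫exp(−(a/2L²)‖Φ_{1,L} − Qφ_L‖²)ρ₀(φ_L)dφ^{(1)}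
= 𝒩^{−1}_a∫exp(−(a/2)‖Φ₁ − Qφ‖²)ρ₀(φ_L)dφ^{(1)}` (L394–411) -/

section First

variable {S₀ S₁ S₀' S₁' : Type*} [Fintype S₀] [Fintype S₁] [Fintype S₀'] [Fintype S₁']

/-- `|ψ_c|² = c²|ψ|²` for the unweighted square norm (with `c = L^{−1/2}`: `|ψ_L|² = L^{−1}|ψ|²`, so `½aL|ψ_L|² = ½a|ψ|²`).
[cite: Dimock2013, §2.1 eq. (first), last step (arXiv:1108.1335v2 TeX L400–403)] -/
theorem sqNorm_scaleField (c : ℝ) (σ : S₁ ≃ S₀) (ψ : S₁ → ℝ) :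
    sqNorm (scaleField c σ ψ) = c ^ 2 * sqNorm ψ := by
  unfold sqNorm
  rw [Finset.mul_sum]
  refine (Fintype.sum_equiv σ (fun y => c ^ 2 * ψ y ^ 2) (fun x => scaleField c σ ψ x ^ 2) fun y => ?_).symm
  rw [scaleField_apply]
  ring

omit [Fintype S₀] [Fintype S₁] in
/-- Scaling is linear: `(Φ − ψ)_L = Φ_L − ψ_L` (pointwise-difference form). [cite: Dimock2013, §2.1 (arXiv:1108.1335v2 TeX
L377–381)] -/
theorem scaleField_sub' (c : ℝ) (σ : S₁ ≃ S₀) (Φ ψ : S₁ → ℝ) :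
    scaleField c σ (Φ - ψ) = scaleField c σ Φ - scaleField c σ ψ := by
  funext x
  simp only [scaleField, Pi.sub_apply]
  ring

/-- **(first)** (L394–411), the three printed steps in one identity.  Sites: `S₀` = `𝕋⁰_{M+N}` (where `Φ₀` lives), `S₀′` =
`𝕋¹_{M+N}` (the block lattice), `S₁′` = `𝕋⁰_{M+N−1}` (where `Φ₁` lives), `S₁` = `𝕋^{−1}_{M+N−1}` (where `φ` lives);
relabellings `σ : S₁ ≃ S₀`, `σ′ : S₁′ ≃ S₀′` (*"y ↦ Ly"*) transporting the blocks (`B₀(σ′y) = σ(B₁y)`).  Then `ρ₁(Φ₁) =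
ρ̃₁(Φ_{1,L})L^{−|𝕋¹|/2}` EQUALS `𝒩^{−1}_{a,𝕋¹_{M+N}}·(L^{−|𝕋^{−1}_{M+N−1}|/2}·∫exp(−(a/2)|Φ₁ − Qφ|²)ρ₀(φ_L)dφ)`: *"taking
account that 𝒩^{−1}_{aL}L^{−|𝕋¹|/2} = 𝒩^{−1}_a"* (`normConst_inv_mul_jac`), *"the change of variables by Φ₀ = φ_L … dΦ₀ =
L^{−|𝕋^{−1}|/2}dφ ≡ dφ^{(1)}"* (`integral_comp_scaleField_scaleConst`), *"Q is scale invariant: Qφ_L = (Qφ)_L"* (gen 42's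
`LocalizedStepAssembly.blockAvg_scale`) and `½aL|ψ_L|² = ½a|ψ|²` (`sqNorm_scaleField`). [cite: Dimock2013, §2.1 eq.
(first) and the two sentences after it (arXiv:1108.1335v2 TeX L394–411)] -/
theorem first {a L : ℝ} (ha : 0 < a) (hL : 0 < L) (σ : S₁ ≃ S₀) (σ' : S₁' ≃ S₀') (B₀ : S₀' → Finset S₀)
    (B₁ : S₁' → Finset S₁) (hB : ∀ y, B₀ (σ' y) = (B₁ y).map σ.toEmbedding) (w : ℝ) (ρ₀ : (S₀ → ℝ) → ℝ)
    (Φ₁ : S₁' → ℝ) :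
    rgStep a L (blockAvg B₀ w) σ' ρ₀ Φ₁
      = (normConst a (Fintype.card S₀'))⁻¹ * (jac L (Fintype.card S₀)
          * ∫ φ : S₁ → ℝ, exp (-(a / 2) * sqNorm (Φ₁ - blockAvg B₁ w φ))
              * ρ₀ (scaleField (scaleConst L) σ φ)) := by
  have hc : scaleConst L ^ 2 * L = 1 := scaleConst_sq_mul hL
  rw [rgStep_eq, scaledDensity_apply, blockDensity_apply]
  -- step 1: the constant `𝒩^{−1}_{aL}L^{−|𝕋¹|/2} = 𝒩^{−1}_a`
  rw [mul_comm _ (jac L (Fintype.card S₀')), ← mul_assoc, mul_comm (jac L _), normConst_inv_mul_jac ha hL]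
  congr 1
  -- step 2: the change of variables `Φ₀ = φ_L`, `dΦ₀ = L^{−|𝕋^{−1}|/2}dφ`
  rw [← integral_comp_scaleField_scaleConst hL σ, smul_eq_mul]
  congr 1
  refine integral_congr_ae (Filter.Eventually.of_forall fun φ => ?_)
  -- step 3: `Q` is scale invariant and `½aL|ψ_L|² = ½a|ψ|²`
  simp only
  rw [blockAvg_scale σ σ' B₀ B₁ hB w (scaleConst L) φ, ← scaleField_sub', sqNorm_scaleField]
  congr 2
  linear_combination (-(a / 2) * sqNorm (Φ₁ - blockAvg B₁ w φ)) * hc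

end First

/-! ## Part 8 — §1.3 the scaled model: `ρ^N_0(Φ) = ρ^N(Φ_{L^{−N}})`, the dropped Jacobian, the relative partition function
(L266–281; III L158–162) -/

section ScaledModel

variable {Su Sf : Type*} [Fintype Su] [Fintype Sf]

/-- **`ρ^N_0(Φ) = ρ^N(Φ_{L^{−N}})`, `Φ_{L^{−N}}(x) = L^{N/2}Φ(L^Nx)`** (L266–274): the density on the UNIT lattice `Su` (print
`𝕋⁰_{M+N}`) from the density `ρ^N` on the FINE lattice `Sf` (print `𝕋^{−N}_M`), along `τ : Su ≃ Sf` (*"u ↦ L^{−N}u"*) with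
the constant `(√L)^N = L^{N/2}`. [cite: Dimock2013, §1.3 (arXiv:1108.1335v2 TeX L266–274); Dimock2013BalabanIII, §1
(arXiv:1304.0705v1 TeX L158–166)] -/
def unitLatticeDensity (L : ℝ) (N : ℕ) (τ : Su ≃ Sf) (ρN : (Sf → ℝ) → ℝ) : (Su → ℝ) → ℝ :=
  fun Φ => ρN (scaleField (Real.sqrt L ^ N) τ Φ)

/-- **The dropped Jacobian** (L275–281): `Z_{M,N} = ∫ρ^N(φ)dφ = (L^{N/2})^{|𝕋⁰_{M+N}|}·∫ρ^N_0(Φ)dΦ` — *"Making the change of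
variables φ = Φ_{L^{−N}} in the partition function we have Z_{M,N} = ∫ρ^N_0(Φ)dΦ … There should actually be a factor … here"*.
The kernel's factor is `((√L)^N)^{|𝕋⁰_{M+N}|} = L^{N|𝕋⁰_{M+N}|/2}` (L280 prints `(L^{N/2})^{|𝕋⁰_{M+N}|/2}`; immaterial as
printed, cf. `relativePartitionFunction_unitLattice`). [cite: Dimock2013, §1.3 (arXiv:1108.1335v2 TeX L275–281)] -/
theorem partitionFunction_unitLattice {L : ℝ} (hL : 0 < L) (N : ℕ) (τ : Su ≃ Sf) (ρN : (Sf → ℝ) → ℝ) :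
    ∫ φ : Sf → ℝ, ρN φ = (Real.sqrt L ^ N) ^ Fintype.card Sf * ∫ Φ : Su → ℝ, unitLatticeDensity L N τ ρN Φ := by
  have hc : 0 < (Real.sqrt L ^ N) ^ Fintype.card Sf := pow_pos (pow_pos (Real.sqrt_pos.2 hL) N) _
  unfold unitLatticeDensity
  rw [integral_comp_scaleField, smul_eq_mul, ← mul_assoc, abs_of_nonneg (inv_pos.2 hc).le,
    mul_inv_cancel₀ hc.ne', one_mul]

/-- **"since it makes no contribution to the relative partition function we have dropped it"** (L280–281): for two fine-
lattice densities (the print's `ρ^N` and its free version `V^N = 0`) the ratio of partition functions equals the ratio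
computed with the unit-lattice densities — the Jacobian `L^{N|𝕋⁰_{M+N}|/2}` cancels. [cite: Dimock2013, §1.3 (arXiv:1108.1335v2
TeX L275–281) and §1.2 (TeX L233–235)] -/
theorem relativePartitionFunction_unitLattice {L : ℝ} (hL : 0 < L) (N : ℕ) (τ : Su ≃ Sf)
    (ρN ρN0 : (Sf → ℝ) → ℝ) :
    (∫ φ : Sf → ℝ, ρN φ) / (∫ φ : Sf → ℝ, ρN0 φ)
      = (∫ Φ : Su → ℝ, unitLatticeDensity L N τ ρN Φ)
          / (∫ Φ : Su → ℝ, unitLatticeDensity L N τ ρN0 Φ) := by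
  rw [partitionFunction_unitLattice hL N τ ρN, partitionFunction_unitLattice hL N τ ρN0,
    mul_div_mul_left _ _ (pow_pos (pow_pos (Real.sqrt_pos.2 hL) N) _).ne']

end ScaledModel

/-! ## Part 10 (v1.1) — (first0)'s two lines agree: `(a/2L²)‖Ψ‖² = ½aL|Ψ|²` with `‖Ψ‖² = L³Σ_x|Ψ(x)|²` (L344–355) -/

section WeightedForm

variable {Ω : Type*} [Fintype Ω]

open LocalizedStepAssembly (nsq)

/-- **(first0), line 1 = line 2** (L344–355): with the *"natural metric for the lattice"* `‖Ψ‖² = L³Σ_{x∈𝕋¹}|Ψ(x)|²` (gen 42's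
`LocalizedStepAssembly.nsq` at spacing `η = L` over all sites) and the unweighted `|Ψ|² = Σ_x|Ψ(x)|²`, the two printed exponents
agree: `(a/2L²)‖Ψ‖² = ½aL|Ψ|²` (`L ≠ 0`) — reading (iv) of the header made a theorem. [cite: Dimock2013, §2.1 eq. (first0) and
the two norms (arXiv:1108.1335v2 TeX L342–355)] -/
theorem weighted_eq_unweighted (a : ℝ) {L : ℝ} (hL : L ≠ 0) (Ψ : Ω → ℝ) :
    a / (2 * L ^ 2) * nsq L Finset.univ Ψ = a * L / 2 * sqNorm Ψ := by
  unfold nsq sqNorm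
  rw [← Finset.mul_sum]
  field_simp

end WeightedForm

/-! ## Part 11 (v1.1) — II §3.8: *"the Gaussian measure with identity covariance dμ_{Ω_{k+1}}(W_k) = (2π)^{−½|Ω^{(k)}_{k+1}|}
exp(−½‖W_k‖²)dW_k"* (L3276–3279) IS A PROBABILITY MEASURE (the `a = 1` instance of Part 1) -/

section UnitGaussian

variable (Ω : Type*) [Fintype Ω]

/-- **`dμ_Ω(W) = (2π)^{−|Ω|/2}exp(−½|W|²)dW`** — the Gaussian measure with identity covariance on `Ω → ℝ` (II L3276–3279), as
Lebesgue measure with the printed density (`(2π)^{−|Ω|/2} = 𝒩^{−1}_{1,|Ω|}`). [cite: Dimock2013BalabanII, §3.8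
(arXiv:1212.5562v2 TeX L3276–3279)] -/
def unitGaussian : Measure (Ω → ℝ) :=
  (volume : Measure (Ω → ℝ)).withDensity
    fun W => ENNReal.ofReal ((normConst 1 (Fintype.card Ω))⁻¹ * exp (-(1 / 2) * sqNorm W))

/-- The printed density integrates to one: `∫(2π)^{−|Ω|/2}exp(−½|W|²)dW = 1` (Part 1 at `a = 1`). [cite: Dimock2013BalabanII,
§3.8 (arXiv:1212.5562v2 TeX L3276–3279); Dimock2013, §2.1 footnote (arXiv:1108.1335v2 TeX L358–360)] -/
theorem integral_unitGaussian_density :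
    ∫ W : Ω → ℝ, (normConst 1 (Fintype.card Ω))⁻¹ * exp (-(1 / 2) * sqNorm W) = 1 := by
  rw [integral_const_mul, integral_exp_neg_half_mul_sqNorm one_pos,
    inv_mul_cancel₀ (normConst_pos one_pos _).ne']

/-- `μ_Ω(everything) = 1`. [cite: Dimock2013BalabanII, §3.8 (arXiv:1212.5562v2 TeX L3276–3279)] -/
theorem unitGaussian_univ : unitGaussian Ω Set.univ = 1 := by
  rw [unitGaussian, withDensity_apply _ MeasurableSet.univ, Measure.restrict_univ,
    ← ofReal_integral_eq_lintegral_ofReal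
      (((integrable_exp_neg_half_mul_sqNorm one_pos).const_mul _))
      (Filter.Eventually.of_forall fun W =>
        mul_nonneg (inv_pos.2 (normConst_pos one_pos _)).le (exp_pos _).le),
    integral_unitGaussian_density, ENNReal.ofReal_one]

/-- **`dμ_{Ω_{k+1}}` is a probability measure** (II L3276–3279). [cite: Dimock2013BalabanII, §3.8 (arXiv:1212.5562v2 TeX
L3276–3279)] -/
instance isProbabilityMeasure_unitGaussian : IsProbabilityMeasure (unitGaussian Ω) :=
  ⟨unitGaussian_univ Ω⟩

end UnitGaussian

/-! ## Part 12 (v1.1) — Densities as `ℝ≥0∞`-valued measurable functions: (kth), (scaleddensity), (preserve) with NO finiteness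
hypothesis (Tonelli in place of Fubini) -/

section DensitiesE

variable {S₀ S₀' S₁ : Type*} [Fintype S₀] [Fintype S₀'] [Fintype S₁]

/-- `∫⁻ exp(−½aL|Ψ|²)dΨ = 𝒩_{aL,|𝕋¹|}` in `ℝ≥0∞` (footnote L358–365). [cite: Dimock2013, §2.1 footnote and eq. for 𝒩_{aL,𝕋¹}
(arXiv:1108.1335v2 TeX L358–365)] -/
theorem lintegral_ofReal_exp_neg_half_mul_sqNorm {aL : ℝ} (haL : 0 < aL) :
    ∫⁻ Ψ : S₀' → ℝ, ENNReal.ofReal (exp (-(aL / 2) * sqNorm Ψ))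
      = ENNReal.ofReal (normConst aL (Fintype.card S₀')) := by
  rw [← ofReal_integral_eq_lintegral_ofReal (integrable_exp_neg_half_mul_sqNorm haL)
    (Filter.Eventually.of_forall fun Ψ => (exp_pos _).le), integral_exp_neg_half_mul_sqNorm haL]

/-- The Gaussian weight `Φ₁ ↦ exp(−½aL|Φ₁ − Ψ|²)` (in `ℝ≥0∞`) is measurable. [cite: Dimock2013, §2.1 eqs. (first0), (kth)
(arXiv:1108.1335v2 TeX L340–349, L414–424)] -/
theorem measurable_ofReal_kernel (aL : ℝ) (Ψ : S₀' → ℝ) :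
    Measurable fun Φ₁ : S₀' → ℝ => ENNReal.ofReal (exp (-(aL / 2) * sqNorm (Φ₁ - Ψ))) :=
  (continuous_exp.comp (continuous_const.mul
    (continuous_sqNorm.comp (continuous_id.sub continuous_const)))).measurable.ennreal_ofReal

/-- **(first0) ∕ (kth) for `ℝ≥0∞`-valued densities**: `ρ̃_{k+1}(Φ_{k+1}) = 𝒩^{−1}_{aL}∫⁻exp(−½aL|Φ_{k+1} − QΦ_k|²)ρ_k(Φ_k)dΦ_k`.
[cite: Dimock2013, §2.1 eqs. (first0), (kth) (arXiv:1108.1335v2 TeX L340–349, L414–424); Dimock2013BalabanII, §3.3 eq. (lime)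
(arXiv:1212.5562v2 TeX L2331–2336)] -/
def blockDensityE (aL : ℝ) (Q : (S₀ → ℝ) → (S₀' → ℝ)) (g : (S₀ → ℝ) → ℝ≥0∞) : (S₀' → ℝ) → ℝ≥0∞ :=
  fun Φ₁ => ENNReal.ofReal ((normConst aL (Fintype.card S₀'))⁻¹)
    * ∫⁻ Φ₀ : S₀ → ℝ, ENNReal.ofReal (exp (-(aL / 2) * sqNorm (Φ₁ - Q Φ₀))) * g Φ₀

/-- **Tonelli form of "the constant is chosen so that ∫ρ̃₁ = ∫ρ₀"** (L366–370): for every MEASURABLE `ℝ≥0∞`-valued `ρ_k`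
(no finiteness) and measurable `Q`, `∫⁻∫⁻exp(−½aL|Φ₁ − QΦ₀|²)ρ_k(Φ₀)dΦ₀dΦ₁ = 𝒩_{aL,|𝕋¹|}·∫⁻ρ_k` — swap the integrals
(`lintegral_lintegral_swap`), translate `Φ₁ ↦ Φ₁ − QΦ₀` (`lintegral_sub_right_eq_self`), evaluate the Gaussian.
[cite: Dimock2013, §2.1 (arXiv:1108.1335v2 TeX L356–370)] -/
theorem lintegral_blockKernelE {aL : ℝ} (haL : 0 < aL) {Q : (S₀ → ℝ) → (S₀' → ℝ)} (hQ : Measurable Q)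
    {g : (S₀ → ℝ) → ℝ≥0∞} (hg : Measurable g) :
    ∫⁻ Φ₁ : S₀' → ℝ, ∫⁻ Φ₀ : S₀ → ℝ, ENNReal.ofReal (exp (-(aL / 2) * sqNorm (Φ₁ - Q Φ₀))) * g Φ₀
      = ENNReal.ofReal (normConst aL (Fintype.card S₀')) * ∫⁻ Φ₀ : S₀ → ℝ, g Φ₀ := by
  have hmeas : AEMeasurable (Function.uncurry fun (Φ₁ : S₀' → ℝ) (Φ₀ : S₀ → ℝ) =>
      ENNReal.ofReal (exp (-(aL / 2) * sqNorm (Φ₁ - Q Φ₀))) * g Φ₀)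
      ((volume : Measure (S₀' → ℝ)).prod (volume : Measure (S₀ → ℝ))) := by
    refine Measurable.aemeasurable ?_
    exact ((continuous_exp.measurable.comp ((continuous_const.mul continuous_sqNorm).measurable.comp
      (measurable_fst.sub (hQ.comp measurable_snd)))).ennreal_ofReal).mul (hg.comp measurable_snd)
  rw [lintegral_lintegral_swap hmeas]
  have inner : ∀ Φ₀ : S₀ → ℝ,
      ∫⁻ Φ₁ : S₀' → ℝ, ENNReal.ofReal (exp (-(aL / 2) * sqNorm (Φ₁ - Q Φ₀))) * g Φ₀
        = ENNReal.ofReal (normConst aL (Fintype.card S₀')) * g Φ₀ := by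
    intro Φ₀
    rw [lintegral_mul_const _ (measurable_ofReal_kernel aL (Q Φ₀)),
      lintegral_sub_right_eq_self (μ := (volume : Measure (S₀' → ℝ)))
        (fun Ψ : S₀' → ℝ => ENNReal.ofReal (exp (-(aL / 2) * sqNorm Ψ))) (Q Φ₀),
      lintegral_ofReal_exp_neg_half_mul_sqNorm haL]
  simp_rw [inner]
  rw [lintegral_const_mul _ hg]

/-- **`∫⁻ρ̃_{k+1} = ∫⁻ρ_k` for every measurable `ℝ≥0∞`-valued `ρ_k`** ((kth) preserves mass with NO finiteness hypothesis —
both sides may be `∞`). [cite: Dimock2013, §2.1 (arXiv:1108.1335v2 TeX L366–370) and eq. (preserve) (TeX L430–435)] -/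
theorem lintegral_blockDensityE {aL : ℝ} (haL : 0 < aL) {Q : (S₀ → ℝ) → (S₀' → ℝ)} (hQ : Measurable Q)
    {g : (S₀ → ℝ) → ℝ≥0∞} (hg : Measurable g) :
    ∫⁻ Φ₁ : S₀' → ℝ, blockDensityE aL Q g Φ₁ = ∫⁻ Φ₀ : S₀ → ℝ, g Φ₀ := by
  unfold blockDensityE
  rw [lintegral_const_mul' _ _ ENNReal.ofReal_ne_top, lintegral_blockKernelE haL hQ hg, ← mul_assoc,
    ← ENNReal.ofReal_mul (inv_pos.2 (normConst_pos haL _)).le, inv_mul_cancel₀ (normConst_pos haL _).ne',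
    ENNReal.ofReal_one, one_mul]

/-- `ρ̃_{k+1}` is measurable when `ρ_k` and `Q` are (so the step can be iterated). [cite: Dimock2013, §2.1 eq. (kth)
(arXiv:1108.1335v2 TeX L414–424)] -/
theorem measurable_blockDensityE (aL : ℝ) {Q : (S₀ → ℝ) → (S₀' → ℝ)} (hQ : Measurable Q)
    {g : (S₀ → ℝ) → ℝ≥0∞} (hg : Measurable g) : Measurable (blockDensityE aL Q g) := by
  have hF : Measurable fun p : (S₀' → ℝ) × (S₀ → ℝ) =>
      ENNReal.ofReal (exp (-(aL / 2) * sqNorm (p.1 - Q p.2))) * g p.2 :=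
    ((continuous_exp.measurable.comp ((continuous_const.mul continuous_sqNorm).measurable.comp
      (measurable_fst.sub (hQ.comp measurable_snd)))).ennreal_ofReal).mul (hg.comp measurable_snd)
  unfold blockDensityE
  exact (hF.lintegral_prod_right' (ν := (volume : Measure (S₀ → ℝ)))).const_mul _

omit [Fintype S₀'] [Fintype S₁] in
/-- The rescaling `Φ ↦ Φ_L` is measurable (a dilation of a site relabelling). [cite: Dimock2013, §2.1 (arXiv:1108.1335v2 TeX
L377–381)] -/
theorem measurable_scaleField (c : ℝ) (σ : S₁ ≃ S₀') :
    Measurable (scaleField c σ : (S₁ → ℝ) → (S₀' → ℝ)) := by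
  have h : (scaleField c σ : (S₁ → ℝ) → (S₀' → ℝ))
      = fun φ => c • (MeasurableEquiv.piCongrLeft (fun _ : S₀' => ℝ) σ φ) := by
    funext φ
    exact scaleField_eq_smul_relabel c σ φ
  rw [h]
  exact (MeasurableEquiv.measurable _).const_smul c

omit [Fintype S₁] in
/-- `ρ_{k+1}` of (scaleddensity) (`ℝ≥0∞` form) is measurable when `ρ̃_{k+1}` is. [cite: Dimock2013, §2.1 eq. (scaleddensity)
(arXiv:1108.1335v2 TeX L425–429)] -/
theorem measurable_scaledDensityE (L : ℝ) (σ : S₁ ≃ S₀') {g : (S₀' → ℝ) → ℝ≥0∞} (hg : Measurable g) :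
    Measurable (scaledDensityE L σ g) :=
  (hg.comp (measurable_scaleField (scaleConst L) σ)).mul_const _

/-- **The RG step on `ℝ≥0∞`-valued densities** ((kth) then (scaleddensity)). [cite: Dimock2013, §2.1 eqs. (kth), (scaleddensity)
(arXiv:1108.1335v2 TeX L414–429); Dimock2013BalabanIII, §1 (arXiv:1304.0705v1 TeX L187–199)] -/
def rgStepE (a L : ℝ) (Q : (S₀ → ℝ) → (S₀' → ℝ)) (σ : S₁ ≃ S₀') (g : (S₀ → ℝ) → ℝ≥0∞) : (S₁ → ℝ) → ℝ≥0∞ :=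
  scaledDensityE L σ (blockDensityE (a * L) Q g)

/-- **(preserve), one step, `ℝ≥0∞` form**: `∫⁻ρ_{k+1} = ∫⁻ρ_k` for every measurable `ρ_k ≥ 0` (no finiteness), measurable `Q`,
`a, L > 0`. [cite: Dimock2013, §2.1 eq. (preserve) (arXiv:1108.1335v2 TeX L430–435); Dimock2013BalabanIII, §1 (arXiv:1304.0705v1
TeX L200–204)] -/
theorem lintegral_rgStepE {a L : ℝ} (ha : 0 < a) (hL : 0 < L) {Q : (S₀ → ℝ) → (S₀' → ℝ)} (hQ : Measurable Q)
    (σ : S₁ ≃ S₀') {g : (S₀ → ℝ) → ℝ≥0∞} (hg : Measurable g) :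
    ∫⁻ Φ : S₁ → ℝ, rgStepE a L Q σ g Φ = ∫⁻ Φ : S₀ → ℝ, g Φ := by
  rw [rgStepE, lintegral_scaledDensityE hL, lintegral_blockDensityE (mul_pos ha hL) hQ hg]

omit [Fintype S₁] in
/-- The `ℝ≥0∞` step preserves measurability. [cite: Dimock2013, §2.1 eqs. (kth), (scaleddensity) (arXiv:1108.1335v2 TeX
L414–429)] -/
theorem measurable_rgStepE (a L : ℝ) {Q : (S₀ → ℝ) → (S₀' → ℝ)} (hQ : Measurable Q) (σ : S₁ ≃ S₀')
    {g : (S₀ → ℝ) → ℝ≥0∞} (hg : Measurable g) : Measurable (rgStepE a L Q σ g) :=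
  measurable_scaledDensityE L σ (measurable_blockDensityE (a * L) hQ hg)

end DensitiesE

section TowerE

variable {S T : ℕ → Type*} [∀ k, Fintype (S k)] [∀ k, Fintype (T k)]

/-- The tower of `ℝ≥0∞`-valued densities `ρ₀, ρ₁ = rgStepE ρ₀, …` over the lattices `S k` (print `𝕋⁰_{M+N−k}`), `T k` (print
`𝕋¹_{M+N−k}`). [cite: Dimock2013, §2.1 (arXiv:1108.1335v2 TeX L414–429); Dimock2013BalabanII, §3.3 (arXiv:1212.5562v2 TeX
L2329–2340)] -/
def densitySeqE (a L : ℝ) (Q : ∀ k, (S k → ℝ) → (T k → ℝ)) (σ : ∀ k, S (k + 1) ≃ T k)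
    (g₀ : (S 0 → ℝ) → ℝ≥0∞) : ∀ k, (S k → ℝ) → ℝ≥0∞
  | 0 => g₀
  | k + 1 => rgStepE a L (Q k) (σ k) (densitySeqE a L Q σ g₀ k)

/-- Every `ρ_k` of the `ℝ≥0∞` tower is measurable and **`∫⁻ρ_k = ∫⁻ρ₀`** — (preserve) ∕ *"for any k the partition function can be
expressed as Z_{M,N} = ∫ρ^N_k(Φ_k)dΦ_k"* with NO finiteness hypothesis (measurable `ρ₀ ≥ 0`, measurable `Q_k`, `a, L > 0`).
[cite: Dimock2013, §2.1 eq. (preserve) (arXiv:1108.1335v2 TeX L430–435); Dimock2013BalabanIII, §1 (arXiv:1304.0705v1 TeX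
L200–204)] -/
theorem measurable_densitySeqE_and_lintegral {a L : ℝ} (ha : 0 < a) (hL : 0 < L)
    {Q : ∀ k, (S k → ℝ) → (T k → ℝ)} (hQ : ∀ k, Measurable (Q k)) (σ : ∀ k, S (k + 1) ≃ T k)
    {g₀ : (S 0 → ℝ) → ℝ≥0∞} (hg₀ : Measurable g₀) :
    ∀ k, Measurable (densitySeqE a L Q σ g₀ k)
      ∧ ∫⁻ Φ : S k → ℝ, densitySeqE a L Q σ g₀ k Φ = ∫⁻ Φ : S 0 → ℝ, g₀ Φ
  | 0 => ⟨hg₀, rfl⟩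
  | k + 1 => by
      obtain ⟨hm, hI⟩ := measurable_densitySeqE_and_lintegral ha hL hQ σ hg₀ k
      refine ⟨measurable_rgStepE a L (hQ k) (σ k) hm, ?_⟩
      show ∫⁻ Φ, rgStepE a L (Q k) (σ k) (densitySeqE a L Q σ g₀ k) Φ = _
      rw [lintegral_rgStepE ha hL (hQ k) (σ k) hm, hI]

/-- **`Z_{M,N} = ∫⁻ρ_k dΦ_k` for every `k`**, `ℝ≥0∞` form. [cite: Dimock2013BalabanIII, §1 (arXiv:1304.0705v1 TeX L200–204);
Dimock2013, §2.1 eq. (preserve) (arXiv:1108.1335v2 TeX L430–435)] -/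
theorem lintegral_densitySeqE {a L : ℝ} (ha : 0 < a) (hL : 0 < L) {Q : ∀ k, (S k → ℝ) → (T k → ℝ)}
    (hQ : ∀ k, Measurable (Q k)) (σ : ∀ k, S (k + 1) ≃ T k) {g₀ : (S 0 → ℝ) → ℝ≥0∞} (hg₀ : Measurable g₀)
    (k : ℕ) : ∫⁻ Φ : S k → ℝ, densitySeqE a L Q σ g₀ k Φ = ∫⁻ Φ : S 0 → ℝ, g₀ Φ :=
  (measurable_densitySeqE_and_lintegral ha hL hQ σ hg₀ k).2

end TowerE

/-! ## Part 13 (v1.2) — (queen) → (queen2) WITH ITS CONSTANT AND ITS MEASURE: the block-averaging convolution (kth)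
maps LEMMA `second`'s Gaussian form at level `k` to the same form at level `k+1` — the lineage's one-step Gaussian
integration (`GaussianSingleStep.integral_exp_neg_stringy`, BY NAME) composed with the normalization `𝒩^{−1}_{aL}` of
(kth) (L447–465, L471–545; II LEMMA 2.1 L488–543) -/

section GaussianForm

open Matrix
open scoped Matrix
open FreeFlowSingleStep (aNext stringy)
open GaussianSingleStep (gaussConst gaussConst_pos integral_exp_neg_stringy integrable_exp_neg_stringy
  integral_integral_exp_neg_stringy_mul)

variable {κ ι σ : Type*} [Fintype κ] [Fintype ι] [Fintype σ]

/-- The unweighted square norm is the self dot product (the lineage's `GaussianSingleStep` writes `‖v‖²` as `v ⬝ᵥ v`).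
[cite: Dimock2013, §2.1 (arXiv:1108.1335v2 TeX L353–355)] -/
theorem sqNorm_eq_dotProduct (Φ : ι → ℝ) : sqNorm Φ = Φ ⬝ᵥ Φ := by
  simp only [sqNorm, dotProduct, sq]

/-- **The integrand of (kth) against a level-`k` Gaussian IS `exp(−stringy)`** (I (queen) L472–478; II (sweet)∕(stringy)
L499–513): `exp(−½aL|Φ_{k+1} − QΦ_k|²)·exp(−½a_k|Φ_k − Q_kφ|²) = exp(−((aL/2)‖Φ_{k+1} − QΦ_k‖² + (a_k/2)‖Φ_k − Q_kφ‖²))` with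
`FreeFlowSingleStep.stringy` by name. [cite: Dimock2013, §2.1 Lemma `second` proof eq. (queen) (arXiv:1108.1335v2 TeX L471–478);
Dimock2013BalabanII, §2.1 eqs. (sweet), (stringy) (arXiv:1212.5562v2 TeX L499–513)] -/
theorem blockKernel_mul_gaussian_eq (Qk : Matrix ι κ ℝ) (Q : Matrix σ ι ℝ) (ak aL : ℝ) (Φ' : σ → ℝ) (φ : κ → ℝ)
    (Φι : ι → ℝ) :
    exp (-(aL / 2) * sqNorm (Φ' - Q *ᵥ Φι)) * exp (-(ak / 2) * sqNorm (Φι - Qk *ᵥ φ))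
      = exp (-stringy Qk Q ak aL Φ' φ Φι) := by
  rw [← Real.exp_add, sqNorm_eq_dotProduct, sqNorm_eq_dotProduct, stringy]
  congr 1
  ring

variable [DecidableEq ι] [DecidableEq σ]

/-- **(kth) OF A GAUSSIAN, FIXED FINE FIELD — (queen) → (queen2) with the constant**: for `QQᵀ = 1`, `a_k > 0`, `aL > 0`,
`ρ̃_{k+1}(Φ_{k+1}) = 𝒩^{−1}_{aL,|𝕋¹|}∫exp(−½aL|Φ_{k+1} − QΦ_k|²)exp(−½a_k|Φ_k − Q_kφ|²)dΦ_k = 𝒩^{−1}_{aL,|𝕋¹|}·𝒵·exp(−½a′|Φ_{k+1} −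
Q_{k+1}φ|²)` with `a′ = aNext a_k aL` (= `a_{k+1}L^{−2}` in the isometric frame, reading (vi); `BlockAveragingComposition.aNext_aK`),
`Q_{k+1} = QQ_k` and `𝒵 = GaussianSingleStep.gaussConst Q a_k aL` — the lineage's `integral_exp_neg_stringy` inside this file's
`blockDensity`. [cite: Dimock2013, §2.1 Lemma `second` L447–465 with
proof (queen)–(queen2) L471–545 (arXiv:1108.1335v2 TeX); Dimock2013BalabanII, §2.1 Lemma 2.1 (mabel) L488–493 with proof
L497–543 (arXiv:1212.5562v2 TeX)] -/
theorem blockDensity_gaussian {Qk : Matrix ι κ ℝ} {Q : Matrix σ ι ℝ} (hQ : Q * Qᵀ = 1) {ak aL : ℝ} (hak : 0 < ak)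
    (haL : 0 < aL) (φ : κ → ℝ) (Φ' : σ → ℝ) :
    blockDensity aL (fun Φι : ι → ℝ => Q *ᵥ Φι) (fun Φι => exp (-(ak / 2) * sqNorm (Φι - Qk *ᵥ φ))) Φ'
      = (normConst aL (Fintype.card σ))⁻¹
        * (gaussConst Q ak aL * exp (-(aNext ak aL / 2) * sqNorm (Φ' - Q *ᵥ (Qk *ᵥ φ)))) := by
  rw [blockDensity_apply]
  simp_rw [blockKernel_mul_gaussian_eq]
  rw [integral_exp_neg_stringy hQ hak haL.le Φ' φ, sqNorm_eq_dotProduct]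

omit [DecidableEq ι] [DecidableEq σ] in
/-- `exp(−stringy)` is jointly continuous in `(Φ_k, φ)`. [cite: Dimock2013BalabanII, §2.1 eq. (stringy) (arXiv:1212.5562v2 TeX
L510–513)] -/
theorem continuous_exp_neg_stringy (Qk : Matrix ι κ ℝ) (Q : Matrix σ ι ℝ) (ak aL : ℝ) (Φ' : σ → ℝ) :
    Continuous fun p : (ι → ℝ) × (κ → ℝ) => exp (-stringy Qk Q ak aL Φ' p.2 p.1) := by
  unfold stringy
  fun_prop

/-- The kernel `(Φ_k, φ) ↦ w(φ)exp(−stringy(Φ_k, φ))` of (queen) is integrable for `dΦ_k ⊗ ν` when the fine-field weight `w` is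
`ν`-integrable (the `Φ_k`-integral is the bounded Gaussian `𝒵exp(−½a′|…|²) ≤ 𝒵`). [cite: Dimock2013, §2.1 Lemma `second` proof
eq. (queen) (arXiv:1108.1335v2 TeX L471–478)] -/
theorem integrable_gaussianMixtureKernel {Qk : Matrix ι κ ℝ} {Q : Matrix σ ι ℝ} (hQ : Q * Qᵀ = 1) {ak aL : ℝ}
    (hak : 0 < ak) (haL : 0 < aL) (ν : Measure (κ → ℝ)) [SFinite ν] {w : (κ → ℝ) → ℝ} (hw : Integrable w ν)
    (Φ' : σ → ℝ) :
    Integrable (Function.uncurry fun (Φι : ι → ℝ) (φ : κ → ℝ) => w φ * exp (-stringy Qk Q ak aL Φ' φ Φι))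
      ((volume : Measure (ι → ℝ)).prod ν) := by
  have hmeas : AEStronglyMeasurable
      (Function.uncurry fun (Φι : ι → ℝ) (φ : κ → ℝ) => w φ * exp (-stringy Qk Q ak aL Φ' φ Φι))
      ((volume : Measure (ι → ℝ)).prod ν) :=
    (hw.aestronglyMeasurable.comp_snd (μ := (volume : Measure (ι → ℝ)))).mul
      (continuous_exp_neg_stringy Qk Q ak aL Φ').aestronglyMeasurable
  refine (integrable_prod_iff' hmeas).2 ⟨Filter.Eventually.of_forall fun φ => ?_, ?_⟩
  · exact (integrable_exp_neg_stringy hQ hak haL.le Φ' φ).const_mul (w φ)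
  · have hg : 0 < gaussConst Q ak aL := gaussConst_pos Q hak haL.le
    have ha' : 0 ≤ aNext ak aL / 2 := by unfold aNext; positivity
    have h3 : ∀ φ : κ → ℝ,
        ∫ Φι : ι → ℝ, ‖(Function.uncurry fun (Φι : ι → ℝ) (φ : κ → ℝ) =>
            w φ * exp (-stringy Qk Q ak aL Φ' φ Φι)) (Φι, φ)‖
          = ‖w φ‖ * (gaussConst Q ak aL
              * exp (-(aNext ak aL / 2) * ((Φ' - Q *ᵥ (Qk *ᵥ φ)) ⬝ᵥ (Φ' - Q *ᵥ (Qk *ᵥ φ))))) := by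
      intro φ
      simp only [Function.uncurry_apply_pair, norm_mul, Real.norm_of_nonneg (exp_pos _).le]
      rw [integral_const_mul, integral_exp_neg_stringy hQ hak haL.le Φ' φ]
    have h4 : (fun φ : κ → ℝ => ∫ Φι : ι → ℝ, ‖(Function.uncurry fun (Φι : ι → ℝ) (φ : κ → ℝ) =>
        w φ * exp (-stringy Qk Q ak aL Φ' φ Φι)) (Φι, φ)‖)
        = fun φ => ‖w φ‖ * (gaussConst Q ak aL
            * exp (-(aNext ak aL / 2) * ((Φ' - Q *ᵥ (Qk *ᵥ φ)) ⬝ᵥ (Φ' - Q *ᵥ (Qk *ᵥ φ))))) :=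
      funext h3
    rw [h4]
    have hcont : Continuous fun φ : κ → ℝ => gaussConst Q ak aL
        * exp (-(aNext ak aL / 2) * ((Φ' - Q *ᵥ (Qk *ᵥ φ)) ⬝ᵥ (Φ' - Q *ᵥ (Qk *ᵥ φ)))) := by
      fun_prop
    refine (hw.norm.mul_const (gaussConst Q ak aL)).mono' (hw.aestronglyMeasurable.norm.mul hcont.aestronglyMeasurable)
      (Filter.Eventually.of_forall fun φ => ?_)
    have hx : 0 ≤ (Φ' - Q *ᵥ (Qk *ᵥ φ)) ⬝ᵥ (Φ' - Q *ᵥ (Qk *ᵥ φ)) := by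
      rw [← sqNorm_eq_dotProduct]; exact sqNorm_nonneg _
    have he : exp (-(aNext ak aL / 2) * ((Φ' - Q *ᵥ (Qk *ᵥ φ)) ⬝ᵥ (Φ' - Q *ᵥ (Qk *ᵥ φ)))) ≤ 1 := by
      rw [exp_le_one_iff, neg_mul]
      exact neg_nonpos.2 (mul_nonneg ha' hx)
    rw [Real.norm_of_nonneg (mul_nonneg (norm_nonneg _) (mul_nonneg hg.le (exp_pos _).le))]
    exact mul_le_mul_of_nonneg_left (mul_le_of_le_one_right hg.le he) (norm_nonneg _)

/-- **(kth) OF LEMMA `second`'s FORM — (queen) → (queen2) under the fine-field integral, constant and measure included**: if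
`ρ_k(Φ_k) = ∫ν(dφ) w(φ)exp(−½a_k|Φ_k − Q_kφ|²)` (print: `w(φ)ν(dφ) = 𝒩^{−1}_{a_k}ρ₀(φ_{L^k})dφ^{(k)}`, any measure `ν` and
integrable weight `w`), then `ρ̃_{k+1}(Φ_{k+1}) = 𝒩^{−1}_{aL,|𝕋¹|}·𝒵·∫ν(dφ) w(φ)exp(−½a′|Φ_{k+1} − Q_{k+1}φ|²)` — *"Thus we have
ρ̃_{k+1}(Φ_{k+1}) = const ∫exp(−(a_{k+1}/2L²)‖Φ_{k+1} − Q_{k+1}φ‖²)ρ₀(φ_{L^k})d^{(k)}φ"* (queen2) with `const = 𝒩^{−1}_{aL}𝒵`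
explicit; Fubini (`integrable_gaussianMixtureKernel`) + `GaussianSingleStep.integral_integral_exp_neg_stringy_mul`.
[cite: Dimock2013, §2.1 Lemma `second` L447–465 with proof (queen)–(queen2) L471–545 (arXiv:1108.1335v2 TeX);
Dimock2013BalabanII, §2.1 Lemma 2.1 (mabel) with proof L497–550 (arXiv:1212.5562v2 TeX)] -/
theorem blockDensity_gaussianMixture {Qk : Matrix ι κ ℝ} {Q : Matrix σ ι ℝ} (hQ : Q * Qᵀ = 1) {ak aL : ℝ}
    (hak : 0 < ak) (haL : 0 < aL) (ν : Measure (κ → ℝ)) [SFinite ν] {w : (κ → ℝ) → ℝ} (hw : Integrable w ν)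
    (Φ' : σ → ℝ) :
    blockDensity aL (fun Φι : ι → ℝ => Q *ᵥ Φι)
        (fun Φι => ∫ φ, w φ * exp (-(ak / 2) * sqNorm (Φι - Qk *ᵥ φ)) ∂ν) Φ'
      = (normConst aL (Fintype.card σ))⁻¹
        * (gaussConst Q ak aL
          * ∫ φ, w φ * exp (-(aNext ak aL / 2) * sqNorm (Φ' - Q *ᵥ (Qk *ᵥ φ))) ∂ν) := by
  rw [blockDensity_apply]
  congr 1
  have step1 : ∀ Φι : ι → ℝ,
      exp (-(aL / 2) * sqNorm (Φ' - Q *ᵥ Φι)) * ∫ φ, w φ * exp (-(ak / 2) * sqNorm (Φι - Qk *ᵥ φ)) ∂ν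
        = ∫ φ, w φ * exp (-stringy Qk Q ak aL Φ' φ Φι) ∂ν := by
    intro Φι
    rw [← integral_const_mul]
    refine integral_congr_ae (Filter.Eventually.of_forall fun φ => ?_)
    simp only
    rw [mul_left_comm, blockKernel_mul_gaussian_eq]
  simp_rw [step1]
  rw [integral_integral_swap (integrable_gaussianMixtureKernel hQ hak haL ν hw Φ')]
  have step2 : ∀ φ : κ → ℝ, ∫ Φι : ι → ℝ, w φ * exp (-stringy Qk Q ak aL Φ' φ Φι)
      = w φ * ∫ Φι : ι → ℝ, exp (-stringy Qk Q ak aL Φ' φ Φι) := fun φ => integral_const_mul _ _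
  simp_rw [step2]
  rw [integral_integral_exp_neg_stringy_mul hQ hak haL.le Φ' ν w]
  simp_rw [sqNorm_eq_dotProduct]

end GaussianForm

/-! ## Part 14 (v1.3) — The frame of Part 13 (reading (vi)): `hQ` discharged by the block geometry
(`BlockAveragingMatrix.Qmat`) and the constants of the two normalisations -/

section Frame

open Matrix
open scoped Matrix
open FreeFlowSingleStep (aNext)
open GaussianSingleStep (gaussConst)
open BlockAveragingMatrix (fibre Qmat Qmat_mul_transpose)

variable {κ ι σ : Type*} [Fintype κ] [Fintype ι] [Fintype σ] [DecidableEq ι] [DecidableEq σ]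

/-- **Part 13 for the print's block averaging** (isometric normalisation): with `Q := BlockAveragingMatrix.Qmat b N` — the
averaging over the blocks `B(y) = b⁻¹(y)` of equal size `N` (print `N = L³`), conjugated by `g ↦ √N g` — the hypothesis `QQᵀ = 1`
is `BlockAveragingMatrix.Qmat_mul_transpose` (*"Then QQᵀ = I"*, L335), so (queen) → (queen2) with its constant holds with NO
hypothesis on `Q`. [cite: Dimock2013, §2.1 L317–336 and Lemma `second` with proof (queen)–(queen2) L447–545 (arXiv:1108.1335v2
TeX)] -/
theorem blockDensity_gaussian_Qmat {b : ι → σ} {N : ℕ} (hb : ∀ y, (fibre b y).card = N) (hN : 0 < N)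
    (Qk : Matrix ι κ ℝ) {ak aL : ℝ} (hak : 0 < ak) (haL : 0 < aL) (φ : κ → ℝ) (Φ' : σ → ℝ) :
    blockDensity aL (fun Φι : ι → ℝ => Qmat b N *ᵥ Φι) (fun Φι => exp (-(ak / 2) * sqNorm (Φι - Qk *ᵥ φ))) Φ'
      = (normConst aL (Fintype.card σ))⁻¹
        * (gaussConst (Qmat b N) ak aL * exp (-(aNext ak aL / 2) * sqNorm (Φ' - Qmat b N *ᵥ (Qk *ᵥ φ)))) :=
  blockDensity_gaussian (Qmat_mul_transpose hb hN) hak haL φ Φ'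

/-- **Part 13's mixture form for the print's block averaging**: `Q := BlockAveragingMatrix.Qmat b N`, `hQ` discharged by
`Qmat_mul_transpose`; any fine-field measure `ν`, weight `w ∈ L¹(ν)`. [cite: Dimock2013, §2.1 L317–336 and Lemma `second` with
proof (queen)–(queen2) L447–545 (arXiv:1108.1335v2 TeX); Dimock2013BalabanII, §2.1 Lemma 2.1 with proof L488–550
(arXiv:1212.5562v2 TeX)] -/
theorem blockDensity_gaussianMixture_Qmat {b : ι → σ} {N : ℕ} (hb : ∀ y, (fibre b y).card = N) (hN : 0 < N)
    (Qk : Matrix ι κ ℝ) {ak aL : ℝ} (hak : 0 < ak) (haL : 0 < aL) (ν : Measure (κ → ℝ)) [SFinite ν]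
    {w : (κ → ℝ) → ℝ} (hw : Integrable w ν) (Φ' : σ → ℝ) :
    blockDensity aL (fun Φι : ι → ℝ => Qmat b N *ᵥ Φι)
        (fun Φι => ∫ φ, w φ * exp (-(ak / 2) * sqNorm (Φι - Qk *ᵥ φ)) ∂ν) Φ'
      = (normConst aL (Fintype.card σ))⁻¹
        * (gaussConst (Qmat b N) ak aL
          * ∫ φ, w φ * exp (-(aNext ak aL / 2) * sqNorm (Φ' - Qmat b N *ᵥ (Qk *ᵥ φ))) ∂ν) :=
  blockDensity_gaussianMixture (Qmat_mul_transpose hb hN) hak haL ν hw Φ'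

/-- **The constants of the two frames**: `𝒩_{a/L²,n} = (√L)^{3n}·𝒩_{aL,n}` (`a, L > 0`) — the normalisation at the isometric
width `a/L²` is the print's `𝒩_{aL,𝕋¹}` (L361–365) times the Jacobian `L^{3n/2}` of the isometry `Φ ↦ L^{3/2}Φ` of the
`L`-lattice (Part 2 with `σ = id`, `c = L^{3/2}`). [cite: Dimock2013, §2.1 eqs. (first0) with the two norms and 𝒩_{aL,𝕋¹}
(arXiv:1108.1335v2 TeX L342–365)] -/
theorem normConst_isometric_frame {a L : ℝ} (ha : 0 < a) (hL : 0 < L) (n : ℕ) :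
    normConst (a / L ^ 2) n = (Real.sqrt L ^ 3) ^ n * normConst (a * L) n := by
  unfold normConst
  rw [← mul_pow]
  congr 1
  have h3 : Real.sqrt L ^ 3 = Real.sqrt (L ^ 3) := by
    rw [Real.sqrt_eq_rpow, Real.sqrt_eq_rpow, ← Real.rpow_natCast, ← Real.rpow_mul hL.le, ← Real.rpow_natCast,
      ← Real.rpow_mul hL.le]
    norm_num
  rw [h3, ← Real.sqrt_mul (pow_pos hL 3).le]
  congr 1
  field_simp

end Frame

/-! ## Part 15 (v1.3) — *"But the constant must be 𝒩^{−1}_{a_{k+1},𝕋⁰_{M+N−k−1}} in order to preserve the identity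
(preserve)"* (I L553; II L550 *"The constant 𝒩^{−1}_{k,𝛀} can be evaluated by integrating over all fields"*): THE CONSTANT OF
A GAUSSIAN-MIXTURE DENSITY IS FIXED BY ITS MASS -/

section ConstantByMass

variable {S : Type*} [Fintype S] {X : Type*} [MeasurableSpace X]

/-- The shear `(x, Φ) ↦ (x, Φ − M x)` of `X × (S → ℝ)` over an arbitrary measurable parameter space `X` (the fine fields
`φ` with their measure `ν`), a measurable equivalence — the device of Part 4 with `ν` in place of `dΦ₀`. [cite: Dimock2013,
§2.1 Lemma `second` proof (arXiv:1108.1335v2 TeX L546–554)] -/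
def shearBy (M : X → (S → ℝ)) (hM : Measurable M) : X × (S → ℝ) ≃ᵐ X × (S → ℝ) where
  toFun p := (p.1, p.2 - M p.1)
  invFun p := (p.1, p.2 + M p.1)
  left_inv p := by simp
  right_inv p := by simp
  measurable_toFun := measurable_fst.prodMk (measurable_snd.sub (hM.comp measurable_fst))
  measurable_invFun := measurable_fst.prodMk (measurable_snd.add (hM.comp measurable_fst))

omit [Fintype S] in
/-- The shear, unfolded. [cite: Dimock2013, §2.1 Lemma `second` proof (arXiv:1108.1335v2 TeX L546–554)] -/
@[simp] theorem shearBy_apply (M : X → (S → ℝ)) (hM : Measurable M) (p : X × (S → ℝ)) :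
    shearBy M hM p = (p.1, p.2 - M p.1) := rfl

/-- The shear preserves `ν ⊗ dΦ` for every s-finite `ν` (fibrewise translation invariance of `dΦ`). [cite: Dimock2013, §2.1
Lemma `second` proof (arXiv:1108.1335v2 TeX L546–554)] -/
theorem measurePreserving_shearBy (ν : Measure X) [SFinite ν] {M : X → (S → ℝ)} (hM : Measurable M) :
    MeasurePreserving (shearBy M hM) (ν.prod (volume : Measure (S → ℝ))) (ν.prod (volume : Measure (S → ℝ))) := by
  have h := (MeasurePreserving.id ν).skew_product
    (μc := (volume : Measure (S → ℝ))) (μd := (volume : Measure (S → ℝ)))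
    (g := fun (x : X) (Φ : S → ℝ) => Φ - M x)
    (measurable_snd.sub (hM.comp measurable_fst))
    (Filter.Eventually.of_forall fun x => map_sub_right_eq_self volume (M x))
  exact h

/-- The Gaussian-mixture kernel `(φ, Φ) ↦ w(φ)exp(−½β|Φ − Mφ|²)` is integrable for `ν ⊗ dΦ` when `w ∈ L¹(ν)` (`β > 0`, `M`
measurable). [cite: Dimock2013, §2.1 Lemma `second` eq. (queen3) (arXiv:1108.1335v2 TeX L546–554)] -/
theorem integrable_mixtureKernel (ν : Measure X) [SFinite ν] {M : X → (S → ℝ)} (hM : Measurable M) {w : X → ℝ}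
    (hw : Integrable w ν) {β : ℝ} (hβ : 0 < β) :
    Integrable (fun p : X × (S → ℝ) => w p.1 * exp (-(β / 2) * sqNorm (p.2 - M p.1)))
      (ν.prod (volume : Measure (S → ℝ))) := by
  have hG : Integrable (fun p : X × (S → ℝ) => w p.1 * exp (-(β / 2) * sqNorm p.2))
      (ν.prod (volume : Measure (S → ℝ))) := hw.mul_prod (integrable_exp_neg_half_mul_sqNorm hβ)
  have h2 := ((measurePreserving_shearBy ν hM).integrable_comp_emb (shearBy M hM).measurableEmbedding).2 hG
  have hfun : (fun p : X × (S → ℝ) => w p.1 * exp (-(β / 2) * sqNorm (p.2 - M p.1)))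
      = (fun p : X × (S → ℝ) => w p.1 * exp (-(β / 2) * sqNorm p.2)) ∘ (shearBy M hM) := by
    funext p
    simp only [Function.comp_apply, shearBy_apply]
  rw [hfun]
  exact h2

/-- **Integrating a Gaussian mixture over all fields**: `∫dΦ ∫ν(dφ) w(φ)exp(−½β|Φ − Mφ|²) = 𝒩_{β,|S|}·∫ν(dφ) w(φ)` for every
s-finite `ν`, integrable `w`, measurable `M`, `β > 0` (Tonelli, the shear, Part 1). [cite: Dimock2013, §2.1 Lemma `second` proof
(arXiv:1108.1335v2 TeX L546–554); Dimock2013BalabanII, §2.1 Lemma 2.1 proof (arXiv:1212.5562v2 TeX L544–550)] -/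
theorem integral_integral_mixture (ν : Measure X) [SFinite ν] {M : X → (S → ℝ)} (hM : Measurable M) {w : X → ℝ}
    (hw : Integrable w ν) {β : ℝ} (hβ : 0 < β) :
    ∫ Φ : S → ℝ, ∫ x, w x * exp (-(β / 2) * sqNorm (Φ - M x)) ∂ν
      = normConst β (Fintype.card S) * ∫ x, w x ∂ν := by
  have hF := integrable_mixtureKernel ν hM hw hβ
  have h1 : ∫ Φ : S → ℝ, ∫ x, w x * exp (-(β / 2) * sqNorm (Φ - M x)) ∂ν
      = ∫ p, w p.1 * exp (-(β / 2) * sqNorm (p.2 - M p.1)) ∂(ν.prod (volume : Measure (S → ℝ))) :=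
    (integral_prod_symm _ hF).symm
  have h2 : ∫ p, w p.1 * exp (-(β / 2) * sqNorm (p.2 - M p.1)) ∂(ν.prod (volume : Measure (S → ℝ)))
      = ∫ p, w p.1 * exp (-(β / 2) * sqNorm p.2) ∂(ν.prod (volume : Measure (S → ℝ))) := by
    have h := (measurePreserving_shearBy ν hM).integral_comp'
      (fun p : X × (S → ℝ) => w p.1 * exp (-(β / 2) * sqNorm p.2))
    simp only [shearBy_apply] at h
    exact h
  rw [h1, h2, integral_prod_mul (μ := ν) (ν := (volume : Measure (S → ℝ))) w
      (fun Ψ : S → ℝ => exp (-(β / 2) * sqNorm Ψ)), integral_exp_neg_half_mul_sqNorm hβ, mul_comm]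

/-- **"But the constant must be `𝒩^{−1}_{a_{k+1},𝕋⁰_{M+N−k−1}}` in order to preserve the identity (preserve)"** (I L553; II L550
*"The constant 𝒩^{−1}_{k,𝛀} can be evaluated by integrating over all fields"*): if a density has the Gaussian-mixture form `ρ(Φ)
= K·∫ν(dφ) w(φ)exp(−½β|Φ − Mφ|²)` ((queen3) with `β = a_{k+1}`, `Mφ = Q_{k+1}φ`, `w(φ)ν(dφ) = ρ₀(φ_{L^{k+1}})d^{(k+1)}φ`), has
mass `m` (`= ∫ρ₀` by (preserve)) and `∫ν w = m ≠ 0` (the mass of `ρ₀(φ_{L^{k+1}})d^{(k+1)}φ`, Part 2), then `K = 𝒩^{−1}_{β,|S|}` —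
the constant of LEMMA `second` WITHOUT evaluating any determinant. [cite: Dimock2013, §2.1 Lemma `second` proof, (queen3) and
the sentence after it (arXiv:1108.1335v2 TeX L546–554); Dimock2013BalabanII, §2.1 Lemma 2.1 proof (arXiv:1212.5562v2 TeX
L544–550)] -/
theorem constant_by_mass (ν : Measure X) [SFinite ν] {M : X → (S → ℝ)} (hM : Measurable M) {w : X → ℝ}
    (hw : Integrable w ν) {β : ℝ} (hβ : 0 < β) {K m : ℝ} (hm : m ≠ 0) (hwm : ∫ x, w x ∂ν = m)
    (hρ : ∫ Φ : S → ℝ, K * ∫ x, w x * exp (-(β / 2) * sqNorm (Φ - M x)) ∂ν = m) :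
    K = (normConst β (Fintype.card S))⁻¹ := by
  rw [integral_const_mul, integral_integral_mixture ν hM hw hβ, hwm] at hρ
  have hKN : K * normConst β (Fintype.card S) = 1 := by
    have h2 : (K * normConst β (Fintype.card S) - 1) * m = 0 := by
      have h3 : K * (normConst β (Fintype.card S) * m) - m = 0 := sub_eq_zero.2 hρ
      linear_combination h3
    rcases mul_eq_zero.1 h2 with h | h
    · exact sub_eq_zero.1 h
    · exact absurd h hm
  exact eq_inv_of_mul_eq_one_left hKN

/-- The same for the mass hypothesis stated on the density `ρ` itself: `ρ = K·(mixture)` pointwise, `∫ρ = m`. [cite: Dimock2013,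
§2.1 Lemma `second` proof (arXiv:1108.1335v2 TeX L546–554)] -/
theorem constant_by_mass' (ν : Measure X) [SFinite ν] {M : X → (S → ℝ)} (hM : Measurable M) {w : X → ℝ}
    (hw : Integrable w ν) {β : ℝ} (hβ : 0 < β) {K m : ℝ} (hm : m ≠ 0) (hwm : ∫ x, w x ∂ν = m)
    {ρ : (S → ℝ) → ℝ} (hρK : ∀ Φ, ρ Φ = K * ∫ x, w x * exp (-(β / 2) * sqNorm (Φ - M x)) ∂ν)
    (hρm : ∫ Φ : S → ℝ, ρ Φ = m) :
    K = (normConst β (Fintype.card S))⁻¹ := by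
  refine constant_by_mass ν hM hw hβ hm hwm ?_
  rw [← hρm]
  exact integral_congr_ae (Filter.Eventually.of_forall fun Φ => (hρK Φ).symm)

end ConstantByMass

/-! ## Part 16 (v1.3) — (queen) → (queen2) IN THE LITERAL FRAME: the PRINTED averaging `(Qf)(y) = N⁻¹Σ_{x∈B(y)}f(x)`
(`QQᵀ = N⁻¹·1` for the unweighted dot product) — Part 13 transported along the isometry `g ↦ √N g` -/

section LiteralFrame

open Matrix
open scoped Matrix
open FreeFlowSingleStep (aNext stringy)
open GaussianSingleStep (gaussConst integral_exp_neg_stringy)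
open BlockAveragingMatrix (fibre Qmat Qmat_mul_transpose QD)

variable {κ ι σ : Type*} [Fintype κ] [Fintype ι] [Fintype σ]

omit [Fintype κ] [Fintype σ] in
/-- `|c·v|² = c²|v|²`. [cite: Dimock2013, §2.1 (arXiv:1108.1335v2 TeX L353–355)] -/
theorem sqNorm_smul (c : ℝ) (v : ι → ℝ) : sqNorm (c • v) = c ^ 2 * sqNorm v := by
  unfold sqNorm
  rw [Finset.mul_sum]
  refine Finset.sum_congr rfl fun x _ => ?_
  rw [Pi.smul_apply, smul_eq_mul]
  ring

variable [DecidableEq ι] [DecidableEq σ]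

/-- **Part 13 for a SCALED coisometry** `Q = c·Q̂`, `Q̂Q̂ᵀ = 1`, `c ≠ 0` (so `QQᵀ = c²·1`): `𝒩^{−1}_{aL}∫exp(−½aL|Φ′ − QΦ_k|²)
exp(−½a_k|Φ_k − Q_kφ|²)dΦ_k = 𝒩^{−1}_{aL}·𝒵(Q̂, a_k, aLc²)·exp(−½(aNext a_k (aLc²)/c²)|Φ′ − QQ_kφ|²)` — Part 13 at width `aLc²`
and point `c⁻¹Φ′` (`|Φ′ − cQ̂Φ|² = c²|c⁻¹Φ′ − Q̂Φ|²`). [cite: Dimock2013, §2.1 Lemma `second` with proof (queen)–(queen2) L447–545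
(arXiv:1108.1335v2 TeX); Dimock2013BalabanII, §2.1 Lemma 2.1 with proof L488–550 (arXiv:1212.5562v2 TeX)] -/
theorem blockDensity_gaussian_smul {Qh : Matrix σ ι ℝ} (hQ : Qh * Qhᵀ = 1) {c : ℝ} (hc : c ≠ 0) {Qk : Matrix ι κ ℝ}
    {ak aL : ℝ} (hak : 0 < ak) (haL : 0 < aL) (φ : κ → ℝ) (Φ' : σ → ℝ) :
    blockDensity aL (fun Φι : ι → ℝ => (c • Qh) *ᵥ Φι) (fun Φι => exp (-(ak / 2) * sqNorm (Φι - Qk *ᵥ φ))) Φ'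
      = (normConst aL (Fintype.card σ))⁻¹
        * (gaussConst Qh ak (aL * c ^ 2)
          * exp (-(aNext ak (aL * c ^ 2) / c ^ 2 / 2) * sqNorm (Φ' - (c • Qh) *ᵥ (Qk *ᵥ φ)))) := by
  have hc2 : 0 < c ^ 2 := by positivity
  rw [blockDensity_apply]
  congr 1
  have key : ∀ Φι : ι → ℝ,
      exp (-(aL / 2) * sqNorm (Φ' - (c • Qh) *ᵥ Φι)) * exp (-(ak / 2) * sqNorm (Φι - Qk *ᵥ φ))
        = exp (-stringy Qk Qh ak (aL * c ^ 2) (c⁻¹ • Φ') φ Φι) := by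
    intro Φι
    rw [← blockKernel_mul_gaussian_eq]
    have hv : Φ' - (c • Qh) *ᵥ Φι = c • (c⁻¹ • Φ' - Qh *ᵥ Φι) := by
      rw [smul_sub, smul_smul, mul_inv_cancel₀ hc, one_smul, Matrix.smul_mulVec]
    rw [hv, sqNorm_smul]
    congr 2
    ring
  simp_rw [key]
  rw [integral_exp_neg_stringy hQ hak (mul_pos haL hc2).le (c⁻¹ • Φ') φ, ← sqNorm_eq_dotProduct]
  have hw : c⁻¹ • Φ' - Qh *ᵥ (Qk *ᵥ φ) = c⁻¹ • (Φ' - (c • Qh) *ᵥ (Qk *ᵥ φ)) := by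
    rw [smul_sub, Matrix.smul_mulVec, smul_smul, inv_mul_cancel₀ hc, one_smul]
  rw [hw, sqNorm_smul]
  congr 2
  field_simp

/-- **The printed averaging as a matrix**: `(avgMat b N) y x = N⁻¹·[b x = y]`, i.e. `(Qf)(y) = N⁻¹Σ_{x∈B(y)}f(x)` with `N = L³`
(L317–321) — `BlockAveragingMatrix.QD` as a matrix; `= (√N)⁻¹·Qmat b N`. [cite: Dimock2013, §2.1 (arXiv:1108.1335v2 TeX
L317–327)] -/
def avgMat (b : ι → σ) (N : ℕ) : Matrix σ ι ℝ := fun y x => if b x = y then ((N : ℝ))⁻¹ else 0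

omit [Fintype κ] [Fintype σ] [DecidableEq ι] in
/-- `avgMat b N *ᵥ f = QD b N f` — the matrix IS the printed operator `Q` of L317–321 (gen 30's `BlockAveragingMatrix.QD`).
[cite: Dimock2013, §2.1 (arXiv:1108.1335v2 TeX L317–321)] -/
theorem avgMat_mulVec (b : ι → σ) (N : ℕ) (f : ι → ℝ) (y : σ) : (avgMat b N *ᵥ f) y = QD b N f y := by
  simp only [Matrix.mulVec, dotProduct, avgMat, QD, fibre]
  rw [Finset.sum_filter, Finset.mul_sum]
  refine Finset.sum_congr rfl fun x _ => ?_
  split_ifs <;> simp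

omit [Fintype κ] [Fintype ι] [Fintype σ] [DecidableEq ι] in
/-- `avgMat = (√N)⁻¹·Qmat` — the printed `Q` is the isometric `Qmat` (gen 30) scaled by `(√N)⁻¹`, hence `QQᵀ = N⁻¹·1`.
[cite: Dimock2013, §2.1 (arXiv:1108.1335v2 TeX L317–336)] -/
theorem avgMat_eq_smul_Qmat (b : ι → σ) (N : ℕ) : avgMat b N = (Real.sqrt N)⁻¹ • Qmat b N := by
  ext y x
  simp only [avgMat, Qmat, Matrix.smul_apply, smul_eq_mul]
  split_ifs
  · rw [← mul_inv, Real.mul_self_sqrt (Nat.cast_nonneg N)]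
  · simp

/-- **(queen) → (queen2) FOR THE PRINTED `Q`** (blocks of equal size `N`, literal unweighted frame of (kth)'s second line):
`𝒩^{−1}_{aL}∫exp(−½aL|Φ′ − QΦ_k|²)exp(−½a_k|Φ_k − Q_kφ|²)dΦ_k = 𝒩^{−1}_{aL}·𝒵(Qmat, a_k, aL/N)·exp(−½(N·aNext a_k (aL/N))|Φ′ −
QQ_kφ|²)`, `hQ` discharged by the geometry.  With the print's numbers (`aL = a·L`, `N = L³`): `N·aNext a_k (aL/N) = L·(L²·aNext
a_k (a/L²)) = L·a_{k+1}` (`literal_width` below + `BlockAveragingComposition.aNext_aK`) — the unweighted coefficient of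
(queen2)'s `(a_{k+1}/2L²)‖Φ_{k+1} − Q_{k+1}φ‖²` on the `L`-lattice (`‖·‖² = L³Σ`, Part 10). [cite: Dimock2013, §2.1 L317–336 and
Lemma `second` with proof (queen)–(queen2) L447–545 (arXiv:1108.1335v2 TeX)] -/
theorem blockDensity_gaussian_avg {b : ι → σ} {N : ℕ} (hb : ∀ y, (fibre b y).card = N) (hN : 0 < N)
    (Qk : Matrix ι κ ℝ) {ak aL : ℝ} (hak : 0 < ak) (haL : 0 < aL) (φ : κ → ℝ) (Φ' : σ → ℝ) :
    blockDensity aL (fun Φι : ι → ℝ => avgMat b N *ᵥ Φι) (fun Φι => exp (-(ak / 2) * sqNorm (Φι - Qk *ᵥ φ))) Φ'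
      = (normConst aL (Fintype.card σ))⁻¹
        * (gaussConst (Qmat b N) ak (aL / N)
          * exp (-((N : ℝ) * aNext ak (aL / N) / 2) * sqNorm (Φ' - avgMat b N *ᵥ (Qk *ᵥ φ)))) := by
  have hNr : (0 : ℝ) < N := by exact_mod_cast hN
  have hc : (Real.sqrt N)⁻¹ ≠ 0 := inv_ne_zero (Real.sqrt_pos.2 hNr).ne'
  have hc2 : ((Real.sqrt (N : ℝ))⁻¹) ^ 2 = ((N : ℝ))⁻¹ := by
    rw [inv_pow, Real.sq_sqrt hNr.le]
  rw [avgMat_eq_smul_Qmat, blockDensity_gaussian_smul (Qmat_mul_transpose hb hN) hc hak haL φ Φ', hc2,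
    ← div_eq_mul_inv, div_inv_eq_mul, mul_comm (aNext ak (aL / N)) (N : ℝ)]

/-- **The print's numbers**: with `aL = a·L` and `N = L³`, `N·aNext a_k (aL/N) = L·(L²·aNext a_k (a/L²))` (`L ≠ 0`); and `L²·aNext
a_k (a/L²) = a_{k+1}` at the closed form `a_k = a(1 − L^{−2})/(1 − L^{−2k})` is `BlockAveragingComposition.aNext_aK` — so the width
of `blockDensity_gaussian_avg` is `L·a_{k+1}`, the unweighted form of (queen2)'s `(a_{k+1}/2L²)‖·‖²`. [cite: Dimock2013, §2.1 Lemma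
`second` L462–464 and eqs. (fifty), (queen2) L532–545 (arXiv:1108.1335v2 TeX)] -/
theorem literal_width (ak a : ℝ) {L : ℝ} (hL : L ≠ 0) :
    (L ^ 3 : ℝ) * aNext ak (a * L / L ^ 3) = L * (L ^ 2 * aNext ak (a / L ^ 2)) := by
  have h : a * L / L ^ 3 = a / L ^ 2 := by field_simp
  rw [h]
  ring

end LiteralFrame

/-! ## Part 17 (v1.4) — II §3.8: *"the Gaussian measure with identity covariance"* `dμ_{Ω_{k+1}}` (L3276–3279) IS Mathlib's
product of standard Gaussians, and its covariance IS the identity -/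

section IdentityCovariance

open ProbabilityTheory

variable (Ω : Type*) [Fintype Ω]

/-- **`dμ_Ω = ⊗_{x∈Ω} N(0,1)`**: the measure with the printed density `(2π)^{−|Ω|/2}exp(−½|W|²)dW` (Part 11) is the product
over the sites of Mathlib's standard real Gaussians `gaussianReal 0 1` (the tree's `GaussianToolkit.pi_gaussianReal_eq_withDensity`
and `prod_gaussianPDF_eq`: `Π_x φ(W(x)) = (√(2π))^{−|Ω|}exp(−Σ_xW(x)²/2)`). [cite: Dimock2013BalabanII, §3.8 "the Gaussian
measure with identity covariance" (arXiv:1212.5562v2 TeX L3276–3279)] -/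
theorem unitGaussian_eq_pi_gaussianReal :
    unitGaussian Ω = Measure.pi fun _ : Ω => gaussianReal 0 1 := by
  rw [unitGaussian, GaussianToolkit.pi_gaussianReal_eq_withDensity]
  congr 1
  funext W
  rw [GaussianToolkit.prod_gaussianPDF_eq]
  congr 1
  congr 1
  · unfold normConst
    rw [div_one, inv_pow]
  · congr 1
    unfold sqNorm
    ring

/-- **Each site variable `W(x)` is a standard Gaussian** under `dμ_Ω`: `W ↦ W(x)` pushes `μ_Ω` to `N(0,1)` (Mathlib's
`measurePreserving_eval` for the product). [cite: Dimock2013BalabanII, §3.8 (arXiv:1212.5562v2 TeX L3276–3279)] -/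
theorem measurePreserving_eval_unitGaussian (x : Ω) :
    MeasurePreserving (fun W : Ω → ℝ => W x) (unitGaussian Ω) (gaussianReal 0 1) := by
  rw [unitGaussian_eq_pi_gaussianReal]
  exact measurePreserving_eval (fun _ : Ω => gaussianReal 0 1) x

/-- `∫t² dN(0,1)(t) = 1` (Mathlib: variance `1`, mean `0`). [folklore] -/
private theorem integral_sq_gaussianReal_zero_one : ∫ t, t ^ 2 ∂gaussianReal 0 1 = 1 := by
  have hv := variance_eq_sub (μ := gaussianReal 0 1) (memLp_id_gaussianReal 2)
  rw [variance_id_gaussianReal] at hv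
  have h0 : ∫ x, id x ∂gaussianReal 0 1 = 0 := integral_id_gaussianReal
  rw [h0] at hv
  simp only [Pi.pow_apply, id_eq, NNReal.coe_one] at hv
  linarith [hv]

/-- **Mean zero**: `∫W(x) dμ_Ω(W) = 0`. [cite: Dimock2013BalabanII, §3.8 (arXiv:1212.5562v2 TeX L3276–3279)] -/
theorem integral_eval_unitGaussian (x : Ω) : ∫ W, W x ∂unitGaussian Ω = 0 := by
  have h := integral_map (μ := unitGaussian Ω) (φ := fun W : Ω → ℝ => W x)
    (measurable_pi_apply x).aemeasurable (f := fun t : ℝ => t) aestronglyMeasurable_id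
  rw [(measurePreserving_eval_unitGaussian Ω x).map_eq, integral_id_gaussianReal] at h
  exact h.symm

/-- **Unit variance**: `∫W(x)² dμ_Ω(W) = 1`. [cite: Dimock2013BalabanII, §3.8 (arXiv:1212.5562v2 TeX L3276–3279)] -/
theorem integral_eval_sq_unitGaussian (x : Ω) : ∫ W, W x ^ 2 ∂unitGaussian Ω = 1 := by
  have h := integral_map (μ := unitGaussian Ω) (φ := fun W : Ω → ℝ => W x)
    (measurable_pi_apply x).aemeasurable (f := fun t : ℝ => t ^ 2) (by fun_prop)
  rw [(measurePreserving_eval_unitGaussian Ω x).map_eq, integral_sq_gaussianReal_zero_one] at h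
  exact h.symm

/-- **Distinct sites are uncorrelated**: `∫W(x)W(y) dμ_Ω(W) = 0` for `x ≠ y` — the site variables are independent under the
product measure (Mathlib's `iIndepFun_pi`) and have mean zero. [cite: Dimock2013BalabanII, §3.8 (arXiv:1212.5562v2 TeX
L3276–3279)] -/
theorem integral_eval_mul_eval_unitGaussian {x y : Ω} (hxy : x ≠ y) :
    ∫ W, W x * W y ∂unitGaussian Ω = 0 := by
  have hind : IndepFun (fun W : Ω → ℝ => W x) (fun W : Ω → ℝ => W y) (unitGaussian Ω) := by
    rw [unitGaussian_eq_pi_gaussianReal]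
    exact (iIndepFun_pi (μ := fun _ : Ω => gaussianReal 0 1) (X := fun _ => id)
      (fun _ => aemeasurable_id)).indepFun hxy
  rw [hind.integral_fun_mul_eq_mul_integral (measurable_pi_apply x).aestronglyMeasurable
    (measurable_pi_apply y).aestronglyMeasurable]
  change (∫ W, W x ∂unitGaussian Ω) * (∫ W, W y ∂unitGaussian Ω) = 0
  rw [integral_eval_unitGaussian, zero_mul]

/-- **"Identity covariance"** (II L3276) as a theorem: `∫W(x)W(y) dμ_Ω(W) = δ_{xy}`. [cite: Dimock2013BalabanII, §3.8 "We also
introduce the Gaussian measure with identity covariance dμ_{Ω_{k+1}}(W_k) = (2π)^{−½|Ω^{(k)}_{k+1}|}exp(−½‖W_k‖²)dW_k"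
(arXiv:1212.5562v2 TeX L3276–3279)] -/
theorem covariance_unitGaussian [DecidableEq Ω] (x y : Ω) :
    ∫ W, W x * W y ∂unitGaussian Ω = if x = y then 1 else 0 := by
  split_ifs with h
  · subst h
    simp_rw [← pow_two]
    exact integral_eval_sq_unitGaussian Ω x
  · exact integral_eval_mul_eval_unitGaussian Ω h

end IdentityCovariance

/-! ## Part 18 (v1.5) — LEMMA `second` ASSEMBLED: the induction over the tower (I L447–465, proof L471–554).  *"Lemma.
ρ_k(Φ_k) = 𝒩^{−1}_{a_k,𝕋⁰_{M+N−k}} ∫exp(−(a_k/2)‖Φ_k − Q_kφ‖²)ρ₀(φ_{L^k})d^{(k)}φ"* — for EVERY `k`, every integrable `ρ₀` of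
non-zero mass and every tower of scaled coisometries `Q = c_kQ̂_k` (`Q̂_kQ̂_kᵀ = 1`, `c_k ≠ 0`: the isometric `Qmat`, `c = 1`,
and the printed `avgMat = (√N)⁻¹Qmat` alike): `ρ_{k+1}` IS a Gaussian mixture over the level-0 fields with width `β_k`,
mean map `M_k` and constant `K_k` given by the printed recursions ((queen) → (queen2) → (queen3): Parts 13∕16, then the
rescaling of Part 3), and `K_k = 𝒩^{−1}_{β_k,|S_{k+1}|}` BY MASS (Part 15) — *"But the constant must be
𝒩^{−1}_{a_{k+1},𝕋⁰_{M+N−k−1}} in order to preserve the identity (preserve)"*.  The print's `d^{(k)}φ`-form integrates over the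
rescaled fine fields `φ = (Φ₀)_{L^{−k}}`; here the parameter stays `Φ₀` on `S 0` with `dΦ₀` and the rescalings are absorbed
in `M_k` (the change of variables of Part 2, `integral_comp_scaleField_scaleConst_pow`, relates the two) -/

section TowerAlgebra

open Matrix
open scoped Matrix

variable {S₀ S₁ : Type*} [Fintype S₀] [Fintype S₁]

/-- The rescaling-and-relabelling `φ ↦ φ_c = c·(φ ∘ τ⁻¹)` (gen 42's `scaleField c τ`) AS A MATRIX: `(relabelMat c τ) x y =
c·[y = τ⁻¹x]`. [cite: Dimock2013, §2.1 "Φ_{1,L}(x) = L^{−1/2}Φ₁(x/L)" (arXiv:1108.1335v2 TeX L377–381)] -/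
def relabelMat [DecidableEq S₁] (c : ℝ) (τ : S₁ ≃ S₀) : Matrix S₀ S₁ ℝ := fun x y => if y = τ.symm x then c else 0

omit [Fintype S₀] in
/-- `relabelMat c τ *ᵥ φ = φ_c`. [cite: Dimock2013, §2.1 (arXiv:1108.1335v2 TeX L377–381)] -/
theorem relabelMat_mulVec [DecidableEq S₁] (c : ℝ) (τ : S₁ ≃ S₀) (φ : S₁ → ℝ) :
    relabelMat c τ *ᵥ φ = scaleField c τ φ := by
  funext x
  simp only [Matrix.mulVec, dotProduct, relabelMat, scaleField]
  rw [Finset.sum_eq_single (τ.symm x)]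
  · simp
  · intro y _ hy
    simp [hy]
  · intro h
    exact absurd (Finset.mem_univ _) h

omit [Fintype S₀] [Fintype S₁] in
/-- `(v_{c⁻¹})_c = v`: rescaling by `c⁻¹` along `τ⁻¹` then by `c` along `τ` is the identity (`c ≠ 0`). [cite: Dimock2013, §2.1
(arXiv:1108.1335v2 TeX L377–381, L406–411)] -/
theorem scaleField_scaleField_inv {c : ℝ} (hc : c ≠ 0) (τ : S₁ ≃ S₀) (v : S₀ → ℝ) :
    scaleField c τ (scaleField c⁻¹ τ.symm v) = v := by
  funext x
  simp only [scaleField, Equiv.symm_symm, Equiv.apply_symm_apply]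
  rw [← mul_assoc, mul_inv_cancel₀ hc, one_mul]

omit [Fintype S₀] [Fintype S₁] in
/-- `Φ_c − v = (Φ − v_{c⁻¹})_c`. [cite: Dimock2013, §2.1 (arXiv:1108.1335v2 TeX L377–381, L406–411)] -/
theorem scaleField_sub_eq {c : ℝ} (hc : c ≠ 0) (τ : S₁ ≃ S₀) (Φ : S₁ → ℝ) (v : S₀ → ℝ) :
    scaleField c τ Φ - v = scaleField c τ (Φ - scaleField c⁻¹ τ.symm v) := by
  rw [scaleField_sub', scaleField_scaleField_inv hc]

/-- **`|Φ_c − v|² = c²|Φ − v_{c⁻¹}|²`** — a Gaussian in `Φ_L` about `v` is a Gaussian in `Φ` about the rescaled mean (*"Replacing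
Φ_{k+1} by Φ_{k+1,L}"*, (queen2) → (queen3)). [cite: Dimock2013, §2.1 Lemma `second` proof, (queen2)–(queen3) (arXiv:1108.1335v2
TeX L538–552)] -/
theorem sqNorm_scaleField_sub {c : ℝ} (hc : c ≠ 0) (τ : S₁ ≃ S₀) (Φ : S₁ → ℝ) (v : S₀ → ℝ) :
    sqNorm (scaleField c τ Φ - v) = c ^ 2 * sqNorm (Φ - scaleField c⁻¹ τ.symm v) := by
  rw [scaleField_sub_eq hc, sqNorm_scaleField]

end TowerAlgebra

section MixtureSmul

open Matrix
open scoped Matrix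
open FreeFlowSingleStep (aNext)
open GaussianSingleStep (gaussConst)

variable {κ ι σ : Type*} [Fintype κ] [Fintype ι] [Fintype σ]

omit [Fintype κ] in
/-- Constants pass through the block-averaging convolution (kth). [cite: Dimock2013, §2.1 eq. (kth) (arXiv:1108.1335v2 TeX
L414–424)] -/
theorem blockDensity_const_mul (aL : ℝ) (Q : (ι → ℝ) → (σ → ℝ)) (K : ℝ) (ρ : (ι → ℝ) → ℝ) (Φ' : σ → ℝ) :
    blockDensity aL Q (fun Φι => K * ρ Φι) Φ' = K * blockDensity aL Q ρ Φ' := by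
  simp only [blockDensity_apply]
  rw [mul_left_comm, ← integral_const_mul K]
  congr 1
  refine integral_congr_ae (Filter.Eventually.of_forall fun Φι => ?_)
  simp only
  ring

omit [Fintype κ] in
/-- **Transport along `g ↦ cg`**: (kth) with the map `cQ̂` at width `aL` is (kth) with `Q̂` at width `aLc²` read at `c⁻¹Φ′`, up
to the ratio `𝒩_{aLc²}/𝒩_{aL}` of the normalization constants (`c ≠ 0`, `aL > 0`; any `ρ`). [cite: Dimock2013, §2.1 eq. (kth)
and the two normalisations L317–336, L350–355 (arXiv:1108.1335v2 TeX L414–424)] -/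
theorem blockDensity_smul_transport (Qh : Matrix σ ι ℝ) {c : ℝ} (hc : c ≠ 0) {aL : ℝ} (haL : 0 < aL)
    (ρ : (ι → ℝ) → ℝ) (Φ' : σ → ℝ) :
    blockDensity aL (fun Φι : ι → ℝ => (c • Qh) *ᵥ Φι) ρ Φ'
      = (normConst aL (Fintype.card σ))⁻¹ * normConst (aL * c ^ 2) (Fintype.card σ)
        * blockDensity (aL * c ^ 2) (fun Φι : ι → ℝ => Qh *ᵥ Φι) ρ (c⁻¹ • Φ') := by
  have hc2 : 0 < c ^ 2 := by positivity
  have hN : normConst (aL * c ^ 2) (Fintype.card σ) ≠ 0 := (normConst_pos (mul_pos haL hc2) _).ne'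
  rw [blockDensity_apply, blockDensity_apply, mul_assoc, ← mul_assoc (normConst _ _), mul_inv_cancel₀ hN, one_mul]
  congr 1
  refine integral_congr_ae (Filter.Eventually.of_forall fun Φι => ?_)
  simp only
  have hv : Φ' - (c • Qh) *ᵥ Φι = c • (c⁻¹ • Φ' - Qh *ᵥ Φι) := by
    rw [smul_sub, smul_smul, mul_inv_cancel₀ hc, one_smul, Matrix.smul_mulVec]
  rw [hv, sqNorm_smul]
  congr 2
  ring

variable [DecidableEq ι] [DecidableEq σ]

/-- **(queen) → (queen2) under the fine-field integral, for a scaled coisometry `Q = cQ̂`** (`Q̂Q̂ᵀ = 1`, `c ≠ 0`): Part 13's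
`blockDensity_gaussianMixture` transported — width `aLc²`, output width `aNext a_k (aLc²)/c²`, constant `𝒩^{−1}_{aL}·𝒵(Q̂, a_k,
aLc²)`. [cite: Dimock2013, §2.1 Lemma `second` with proof (queen)–(queen2) L447–545 (arXiv:1108.1335v2 TeX); Dimock2013BalabanII,
§2.1 Lemma 2.1 with proof L488–550 (arXiv:1212.5562v2 TeX)] -/
theorem blockDensity_gaussianMixture_smul {Qh : Matrix σ ι ℝ} (hQ : Qh * Qhᵀ = 1) {c : ℝ} (hc : c ≠ 0)
    {Qk : Matrix ι κ ℝ} {ak aL : ℝ} (hak : 0 < ak) (haL : 0 < aL) (ν : Measure (κ → ℝ)) [SFinite ν]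
    {w : (κ → ℝ) → ℝ} (hw : Integrable w ν) (Φ' : σ → ℝ) :
    blockDensity aL (fun Φι : ι → ℝ => (c • Qh) *ᵥ Φι)
        (fun Φι => ∫ φ, w φ * exp (-(ak / 2) * sqNorm (Φι - Qk *ᵥ φ)) ∂ν) Φ'
      = (normConst aL (Fintype.card σ))⁻¹
        * (gaussConst Qh ak (aL * c ^ 2)
          * ∫ φ, w φ * exp (-(aNext ak (aL * c ^ 2) / c ^ 2 / 2)
              * sqNorm (Φ' - (c • Qh) *ᵥ (Qk *ᵥ φ))) ∂ν) := by
  have hc2 : 0 < c ^ 2 := by positivity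
  have hN : normConst (aL * c ^ 2) (Fintype.card σ) ≠ 0 := (normConst_pos (mul_pos haL hc2) _).ne'
  rw [blockDensity_smul_transport Qh hc haL, blockDensity_gaussianMixture hQ hak (mul_pos haL hc2) ν hw (c⁻¹ • Φ'),
    mul_assoc, ← mul_assoc (normConst _ _), mul_inv_cancel₀ hN, one_mul]
  congr 2
  refine integral_congr_ae (Filter.Eventually.of_forall fun φ => ?_)
  simp only
  have hw' : c⁻¹ • Φ' - Qh *ᵥ (Qk *ᵥ φ) = c⁻¹ • (Φ' - (c • Qh) *ᵥ (Qk *ᵥ φ)) := by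
    rw [smul_sub, Matrix.smul_mulVec, smul_smul, inv_mul_cancel₀ hc, one_smul]
  rw [hw', sqNorm_smul]
  congr 2
  field_simp

omit [Fintype κ] [Fintype ι] [Fintype σ] [DecidableEq ι] [DecidableEq σ] in
/-- `aNext b c > 0` for `b, c > 0` (`= bc/(b + c)`). [cite: Dimock2013, §2.1 (ak) (arXiv:1108.1335v2 TeX L515–518)] -/
theorem aNext_pos' {b c : ℝ} (hb : 0 < b) (hc : 0 < c) : 0 < aNext b c := by
  unfold aNext
  positivity

end MixtureSmul

section Second

open Matrix
open scoped Matrix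
open FreeFlowSingleStep (aNext)
open GaussianSingleStep (gaussConst)
open BlockAveragingMatrix (fibre Qmat Qmat_mul_transpose)

variable {S T : ℕ → Type*} [∀ k, Fintype (S k)] [∀ k, Fintype (T k)] [∀ k, DecidableEq (S k)]
  [∀ k, DecidableEq (T k)]

/-- **The widths of LEMMA `second` along the tower** (level `k+1`): `β_0 = a` (`a_1 = a`, (first)); `β_{k+1} = L⁻¹·(aNext β_k
(aLc_{k+1}²)/c_{k+1}²)` — Part 16's output width, then the rescaling `(L^{−1/2})²` of Part 3 (for the printed `avgMat`, `c² =
L^{−3}`: `β_{k+1} = L²·aNext β_k (a/L²)`, cf. `literal_width` and `BlockAveragingComposition.aNext_aK`: `= a_{k+2}`).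
[cite: Dimock2013, §2.1 Lemma `second` L462–464, (fifty)–(queen3) L532–552 (arXiv:1108.1335v2 TeX)] -/
def secondWidth (a L : ℝ) (c : ℕ → ℝ) : ℕ → ℝ
  | 0 => a
  | k + 1 => scaleConst L ^ 2 * (aNext (secondWidth a L c k) (a * L * c (k + 1) ^ 2) / c (k + 1) ^ 2)

/-- **The mean maps of LEMMA `second`** `M_k : (S 0 → ℝ) → (S (k+1) → ℝ)` as matrices (print `Q_{k+1}φ` read in the unit-lattice
field `Φ_{k+1}`): `M_0 = R_0·Q_0`, `M_{k+1} = R_{k+1}·Q_{k+1}·M_k` with `Q_k = c_kQ̂_k` the averaging and `R_k = relabelMat L^{1/2}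
σ_k⁻¹` the inverse rescaling. [cite: Dimock2013, §2.1 Lemma `second` L447–465 with "Q_{k+1} = QQ_k" L439–443 and (queen3)
L546–552 (arXiv:1108.1335v2 TeX)] -/
def secondMean (L : ℝ) (c : ℕ → ℝ) (Qh : ∀ k, Matrix (T k) (S k) ℝ) (σ : ∀ k, S (k + 1) ≃ T k) :
    ∀ k, Matrix (S (k + 1)) (S 0) ℝ
  | 0 => relabelMat (scaleConst L)⁻¹ (σ 0).symm * (c 0 • Qh 0)
  | k + 1 => relabelMat (scaleConst L)⁻¹ (σ (k + 1)).symm * (c (k + 1) • Qh (k + 1)) * secondMean L c Qh σ k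

/-- **The constants of LEMMA `second` along the tower**, by the printed recursion: `K_0 = 𝒩^{−1}_{a,|T 0|}` ((first):
`𝒩^{−1}_{aL}L^{−|𝕋¹|/2} = 𝒩^{−1}_a`), `K_{k+1} = L^{−|T_{k+1}|/2}·K_k·𝒩^{−1}_{aL,|T_{k+1}|}·𝒵(Q̂_{k+1}, β_k, aLc_{k+1}²)`
((queen2)'s `const`, then (scaleddensity)). [cite: Dimock2013, §2.1 Lemma `second` proof (queen)–(queen3) L471–554
(arXiv:1108.1335v2 TeX)] -/
def secondK (a L : ℝ) (c : ℕ → ℝ) (Qh : ∀ k, Matrix (T k) (S k) ℝ) : ℕ → ℝ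
  | 0 => (normConst a (Fintype.card (T 0)))⁻¹
  | k + 1 => jac L (Fintype.card (T (k + 1))) * (secondK a L c Qh k
      * ((normConst (a * L) (Fintype.card (T (k + 1))))⁻¹
        * gaussConst (Qh (k + 1)) (secondWidth a L c k) (a * L * c (k + 1) ^ 2)))

/-- The widths stay positive (`a, L > 0`, `c_k ≠ 0`). [cite: Dimock2013, §2.1 Lemma `second` L462–464 (arXiv:1108.1335v2 TeX)] -/
theorem secondWidth_pos {a L : ℝ} (ha : 0 < a) (hL : 0 < L) {c : ℕ → ℝ} (hc : ∀ k, c k ≠ 0) :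
    ∀ k, 0 < secondWidth a L c k
  | 0 => ha
  | k + 1 => by
      have hck : 0 < c (k + 1) ^ 2 := by have := hc (k + 1); positivity
      have hs : 0 < scaleConst L ^ 2 := by have := scaleConst_ne_zero hL; positivity
      exact mul_pos hs (div_pos (aNext_pos' (secondWidth_pos ha hL hc k) (mul_pos (mul_pos ha hL) hck)) hck)

/-- **LEMMA `second` — THE STRUCTURE, by induction over the tower**: for `a, L > 0`, a tower of scaled coisometries `Q_k =
c_kQ̂_k` (`Q̂_kQ̂_kᵀ = 1`, `c_k ≠ 0`), relabellings `σ_k` and an integrable `ρ₀`, for EVERY `k` the density after `k+1` steps is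
`ρ_{k+1}(Φ) = K_k ∫ρ₀(Φ₀)exp(−½β_k|Φ − M_kΦ₀|²)dΦ₀` with `K_k`, `β_k`, `M_k` the printed recursions (`secondK`, `secondWidth`,
`secondMean`).  Base: (first) in matrix clothing (Parts 2–4, `normConst_inv_mul_jac`, `sqNorm_scaleField_sub`); step: (queen)
→ (queen2) under the `Φ₀`-integral (`blockDensity_gaussianMixture_smul`, i.e. Part 13 ∕ gen 30's Gaussian step) then (queen2) →
(queen3) by the rescaling (`scaledDensity`, `sqNorm_scaleField_sub`). [cite: Dimock2013, §2.1 Lemma `second` L447–465 with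
proof L471–554 (arXiv:1108.1335v2 TeX); Dimock2013BalabanII, §2.1 Lemma 2.1 L488–550 (arXiv:1212.5562v2 TeX)] -/
theorem densitySeq_gaussianMixture {a L : ℝ} (ha : 0 < a) (hL : 0 < L) {c : ℕ → ℝ} (hc : ∀ k, c k ≠ 0)
    {Qh : ∀ k, Matrix (T k) (S k) ℝ} (hQ : ∀ k, Qh k * (Qh k)ᵀ = 1) (σ : ∀ k, S (k + 1) ≃ T k)
    {ρ₀ : (S 0 → ℝ) → ℝ} (hρ₀ : Integrable ρ₀) :
    ∀ (k : ℕ) (Φ : S (k + 1) → ℝ),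
      densitySeq a L (fun k Φk => (c k • Qh k) *ᵥ Φk) σ ρ₀ (k + 1) Φ
        = secondK a L c Qh k
          * ∫ Φ₀, ρ₀ Φ₀ * exp (-(secondWidth a L c k / 2) * sqNorm (Φ - secondMean L c Qh σ k *ᵥ Φ₀))
  | 0, Φ => by
      have hs : scaleConst L ≠ 0 := scaleConst_ne_zero hL
      have h1 : scaleConst L ^ 2 * L = 1 := scaleConst_sq_mul hL
      rw [densitySeq_succ, densitySeq_zero, rgStep_eq, scaledDensity_apply, blockDensity_apply, mul_comm _ (jac L _),
        ← mul_assoc, mul_comm (jac L _), normConst_inv_mul_jac ha hL]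
      simp only [secondK, secondWidth, secondMean]
      congr 1
      refine integral_congr_ae (Filter.Eventually.of_forall fun Φ₀ => ?_)
      simp only
      rw [mul_comm (exp _), sqNorm_scaleField_sub hs, ← Matrix.mulVec_mulVec, relabelMat_mulVec]
      congr 2
      linear_combination
        (-(1 / 2) * a * sqNorm (Φ - scaleField (scaleConst L)⁻¹ (σ 0).symm ((c 0 • Qh 0) *ᵥ Φ₀))) * h1
  | k + 1, Φ => by
      have hs : scaleConst L ≠ 0 := scaleConst_ne_zero hL
      have IH : densitySeq a L (fun k Φk => (c k • Qh k) *ᵥ Φk) σ ρ₀ (k + 1)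
          = fun Ψ => secondK a L c Qh k * ∫ Φ₀, ρ₀ Φ₀ * exp (-(secondWidth a L c k / 2)
              * sqNorm (Ψ - secondMean L c Qh σ k *ᵥ Φ₀)) :=
        funext fun Ψ => densitySeq_gaussianMixture ha hL hc hQ σ hρ₀ k Ψ
      have hexp : ∀ X : ℝ,
          -(aNext (secondWidth a L c k) (a * L * c (k + 1) ^ 2) / c (k + 1) ^ 2 / 2) * (scaleConst L ^ 2 * X)
            = -(scaleConst L ^ 2 * (aNext (secondWidth a L c k) (a * L * c (k + 1) ^ 2) / c (k + 1) ^ 2) / 2) * X :=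
        fun X => by ring
      have step := blockDensity_gaussianMixture_smul (hQ (k + 1)) (hc (k + 1)) (Qk := secondMean L c Qh σ k)
        (secondWidth_pos ha hL hc k) (mul_pos ha hL) (volume : Measure (S 0 → ℝ)) hρ₀
        (scaleField (scaleConst L) (σ (k + 1)) Φ)
      rw [densitySeq_succ, IH, rgStep_eq, scaledDensity_apply, blockDensity_const_mul, step]
      simp only [secondK, secondWidth, secondMean, ← integral_const_mul, ← integral_mul_const]
      refine integral_congr_ae (Filter.Eventually.of_forall fun Φ₀ => ?_)
      simp only
      rw [sqNorm_scaleField_sub hs, ← relabelMat_mulVec, hexp]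
      simp only [Matrix.mulVec_mulVec, ← Matrix.mul_assoc]
      ring

omit [∀ k, Fintype (S k)] [∀ k, Fintype (T k)] [∀ k, DecidableEq (S k)] [∀ k, DecidableEq (T k)] in
/-- A matrix acts measurably (a linear map of finite-dimensional spaces). [cite: Dimock2013, §2.1 "Let Q also denote the
associated linear operator" (arXiv:1108.1335v2 TeX L322–327)] -/
theorem measurable_matrix_mulVec {m n : Type*} [Fintype m] [Fintype n] (M : Matrix m n ℝ) :
    Measurable fun v : n → ℝ => M *ᵥ v :=
  (continuous_const.matrix_mulVec continuous_id).measurable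

/-- **"But the constant must be `𝒩^{−1}_{a_{k+1},𝕋⁰_{M+N−k−1}}` in order to preserve the identity (preserve)"** (L552–554) — FOR
EVERY `k`: the recursively defined constant `K_k` of `densitySeq_gaussianMixture` EQUALS `𝒩^{−1}_{β_k,|S_{k+1}|}` whenever `∫ρ₀ ≠
0` — Part 15's `constant_by_mass'` fed with (preserve) (`integral_densitySeq`); no determinant is evaluated (in particular
`Π_j 𝒵_j·L^{−|T_j|/2}·𝒩^{−1}_{aL}` collapses to a single `𝒩^{−1}`). [cite: Dimock2013, §2.1 Lemma `second` proof, (queen3) and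
the sentence after it (arXiv:1108.1335v2 TeX L546–554); Dimock2013BalabanII, §2.1 Lemma 2.1 proof L550 (arXiv:1212.5562v2
TeX)] -/
theorem secondK_eq {a L : ℝ} (ha : 0 < a) (hL : 0 < L) {c : ℕ → ℝ} (hc : ∀ k, c k ≠ 0)
    {Qh : ∀ k, Matrix (T k) (S k) ℝ} (hQ : ∀ k, Qh k * (Qh k)ᵀ = 1) (σ : ∀ k, S (k + 1) ≃ T k)
    {ρ₀ : (S 0 → ℝ) → ℝ} (hρ₀ : Integrable ρ₀) (hm : ∫ Φ₀, ρ₀ Φ₀ ≠ 0) (k : ℕ) :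
    secondK a L c Qh k = (normConst (secondWidth a L c k) (Fintype.card (S (k + 1))))⁻¹ :=
  constant_by_mass' (volume : Measure (S 0 → ℝ)) (measurable_matrix_mulVec (secondMean L c Qh σ k)) hρ₀
    (secondWidth_pos ha hL hc k) hm rfl (densitySeq_gaussianMixture ha hL hc hQ σ hρ₀ k)
    (integral_densitySeq ha hL (fun k => measurable_matrix_mulVec (c k • Qh k)) σ hρ₀ (k + 1))

/-- **LEMMA `second`** (I L447–465), ASSEMBLED: *"ρ_k(Φ_k) = 𝒩^{−1}_{a_k,𝕋⁰_{M+N−k}} ∫exp(−(a_k/2)‖Φ_k − Q_kφ‖²)ρ₀(φ_{L^k})d^{(k)}φ"*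
— here: for every `k`, `ρ_{k+1}(Φ) = 𝒩^{−1}_{β_k,|S_{k+1}|} ∫ρ₀(Φ₀)exp(−½β_k|Φ − M_kΦ₀|²)dΦ₀` (`a, L > 0`, scaled coisometries
`c_kQ̂_k`, integrable `ρ₀` with `∫ρ₀ ≠ 0`; widths `β_k` = `secondWidth`, for the printed `Q` and `L³`-blocks the printed `a_{k+1}`
by `literal_width` ∕ `BlockAveragingComposition.aNext_aK`; the print's `d^{(k)}φ` is the pushforward of `dΦ₀` under `Φ₀ ↦
(Φ₀)_{L^{−k}}`, Part 2). [cite: Dimock2013, §2.1 Lemma `second` L447–465 with proof L471–554 (arXiv:1108.1335v2 TeX);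
Dimock2013BalabanII, §2.1 Lemma 2.1 L488–550 (arXiv:1212.5562v2 TeX)] -/
theorem second_lemma {a L : ℝ} (ha : 0 < a) (hL : 0 < L) {c : ℕ → ℝ} (hc : ∀ k, c k ≠ 0)
    {Qh : ∀ k, Matrix (T k) (S k) ℝ} (hQ : ∀ k, Qh k * (Qh k)ᵀ = 1) (σ : ∀ k, S (k + 1) ≃ T k)
    {ρ₀ : (S 0 → ℝ) → ℝ} (hρ₀ : Integrable ρ₀) (hm : ∫ Φ₀, ρ₀ Φ₀ ≠ 0) (k : ℕ) (Φ : S (k + 1) → ℝ) :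
    densitySeq a L (fun k Φk => (c k • Qh k) *ᵥ Φk) σ ρ₀ (k + 1) Φ
      = (normConst (secondWidth a L c k) (Fintype.card (S (k + 1))))⁻¹
        * ∫ Φ₀, ρ₀ Φ₀ * exp (-(secondWidth a L c k / 2) * sqNorm (Φ - secondMean L c Qh σ k *ᵥ Φ₀)) := by
  rw [densitySeq_gaussianMixture ha hL hc hQ σ hρ₀ k Φ, secondK_eq ha hL hc hQ σ hρ₀ hm k]

/-- **LEMMA `second` FOR THE PRINTED AVERAGING OPERATORS** `(Q_kf)(y) = N_k⁻¹Σ_{x∈B_k(y)}f(x)` (Part 16's `avgMat (b k) (N k)`,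
blocks of equal size `N_k`): NO hypothesis on the `Q_k` — `avgMat = (√N)⁻¹·Qmat` (`avgMat_eq_smul_Qmat`) and `QmatQmatᵀ = 1`
(`Qmat_mul_transpose`) feed `second_lemma` with `c_k = (√N_k)⁻¹`. [cite: Dimock2013, §2.1 L317–336 and Lemma `second` L447–465
with proof L471–554 (arXiv:1108.1335v2 TeX)] -/
theorem second_lemma_avg {a L : ℝ} (ha : 0 < a) (hL : 0 < L) {b : ∀ k, S k → T k} {N : ℕ → ℕ}
    (hb : ∀ k y, (fibre (b k) y).card = N k) (hN : ∀ k, 0 < N k) (σ : ∀ k, S (k + 1) ≃ T k)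
    {ρ₀ : (S 0 → ℝ) → ℝ} (hρ₀ : Integrable ρ₀) (hm : ∫ Φ₀, ρ₀ Φ₀ ≠ 0) (k : ℕ) (Φ : S (k + 1) → ℝ) :
    densitySeq a L (fun k Φk => avgMat (b k) (N k) *ᵥ Φk) σ ρ₀ (k + 1) Φ
      = (normConst (secondWidth a L (fun k => (Real.sqrt (N k))⁻¹) k) (Fintype.card (S (k + 1))))⁻¹
        * ∫ Φ₀, ρ₀ Φ₀ * exp (-(secondWidth a L (fun k => (Real.sqrt (N k))⁻¹) k / 2)
            * sqNorm (Φ - secondMean L (fun k => (Real.sqrt (N k))⁻¹) (fun k => Qmat (b k) (N k)) σ k *ᵥ Φ₀)) := by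
  have hc : ∀ k, (Real.sqrt (N k))⁻¹ ≠ 0 := fun k =>
    inv_ne_zero (Real.sqrt_pos.2 (by exact_mod_cast hN k)).ne'
  have hQ : ∀ k, Qmat (b k) (N k) * (Qmat (b k) (N k))ᵀ = 1 := fun k => Qmat_mul_transpose (hb k) (hN k)
  simp only [avgMat_eq_smul_Qmat]
  exact second_lemma ha hL hc hQ σ hρ₀ hm k Φ

omit [∀ k, Fintype (S k)] [∀ k, Fintype (T k)] [∀ k, DecidableEq (S k)] [∀ k, DecidableEq (T k)] in
/-- **The printed widths**: for blocks of size `N_k = L³` (`c_k² = L^{−3}`) the recursion reads `β_{k+1} = L²·aNext β_k (a/L²)` —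
with `β_0 = a = a_1`, this is `β_k = a_{k+1}` for the closed form `a_k = a(1 − L^{−2})/(1 − L^{−2k})` by
`BlockAveragingComposition.aNext_aK` (`L²·aNext a_k (a/L²) = a_{k+1}`, by name). [cite: Dimock2013, §2.1 Lemma `second` L462–464
and (ak) L515–518 (arXiv:1108.1335v2 TeX)] -/
theorem secondWidth_avg_succ {a L : ℝ} (hL : 0 < L) {N : ℕ → ℕ} (hN : ∀ k, ((N k : ℕ) : ℝ) = L ^ 3) (k : ℕ) :
    secondWidth a L (fun k => (Real.sqrt (N k))⁻¹) (k + 1)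
      = L ^ 2 * aNext (secondWidth a L (fun k => (Real.sqrt (N k))⁻¹) k) (a / L ^ 2) := by
  have hs2 : scaleConst L ^ 2 = L⁻¹ := eq_inv_of_mul_eq_one_left (scaleConst_sq_mul hL)
  have hN0 : (0 : ℝ) ≤ N (k + 1) := Nat.cast_nonneg _
  have hL3 : (L ^ 3 : ℝ) ≠ 0 := by positivity
  simp only [secondWidth]
  rw [inv_pow, Real.sq_sqrt hN0, hN, hs2]
  have h : a * L * (L ^ 3)⁻¹ = a / L ^ 2 := by field_simp
  rw [h]
  field_simp

end Second

/-! ## Part 19 (v1.6) — LEMMA `second` WITH THE PRINTED WIDTHS `a_k = a(1 − L^{−2})/(1 − L^{−2k})` (L462–464): blocks of size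
`L³`, the closed form of gen 30 (`BlockAveragingComposition.aNext_aK`, the tree's `King1986.aK`) IMPORTED and instantiated -/

section PrintedWidths

open Matrix
open scoped Matrix
open FreeFlowSingleStep (aNext)
open King1986 (aK aK_one)
open BlockAveragingComposition (aNext_aK)
open BlockAveragingMatrix (fibre Qmat)

variable {S T : ℕ → Type*} [∀ k, Fintype (S k)] [∀ k, Fintype (T k)] [∀ k, DecidableEq (S k)]
  [∀ k, DecidableEq (T k)]

omit [∀ k, Fintype (S k)] [∀ k, Fintype (T k)] [∀ k, DecidableEq (S k)] [∀ k, DecidableEq (T k)] in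
/-- **`β_k = a_{k+1}`**: for blocks of size `N_k = L³` (`L > 1`, `a > 0`) the widths of `second_lemma_avg` ARE the printed
*"a_k = a(1 − L^{−2})/(1 − L^{−2k})"* (the tree's `King1986.aK a L (k+1)`): `β_0 = a = a_1` (`King1986.aK_one`) and `β_{k+1} =
L²·aNext a_{k+1} (a/L²) = a_{k+2}` (`secondWidth_avg_succ` + gen 30's `BlockAveragingComposition.aNext_aK`). [cite: Dimock2013, §2.1
Lemma `second` L462–464 and (ak) L515–518 (arXiv:1108.1335v2 TeX)] -/
theorem secondWidth_eq_aK {a L : ℝ} (ha : 0 < a) (hL : 1 < L) {N : ℕ → ℕ} (hN : ∀ k, ((N k : ℕ) : ℝ) = L ^ 3) :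
    ∀ k, secondWidth a L (fun k => (Real.sqrt (N k))⁻¹) k = aK a L (k + 1)
  | 0 => by
      simp only [secondWidth, zero_add]
      exact (aK_one hL).symm
  | k + 1 => by
      have hL2 : (L ^ 2 : ℝ) ≠ 0 := by positivity
      rw [secondWidth_avg_succ (lt_trans zero_lt_one hL) hN k, secondWidth_eq_aK ha hL hN k, div_eq_mul_inv,
        aNext_aK ha hL (Nat.succ_le_succ (Nat.zero_le k))]
      field_simp

/-- **LEMMA `second` AS PRINTED** (I L447–465) for the printed averaging operators on blocks of size `L³`: *"ρ_k(Φ_k) =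
𝒩^{−1}_{a_k,𝕋⁰_{M+N−k}} ∫exp(−(a_k/2)‖Φ_k − Q_kφ‖²)ρ₀(φ_{L^k})d^{(k)}φ … a_k = a(1 − L^{−2})/(1 − L^{−2k})"* — here `ρ_{k+1}(Φ) =
𝒩^{−1}_{a_{k+1},|S_{k+1}|}∫ρ₀(Φ₀)exp(−½a_{k+1}|Φ − M_kΦ₀|²)dΦ₀` for every `k` (`a > 0`, `L > 1`, integrable `ρ₀` with `∫ρ₀ ≠ 0`; `a_{k+1}
= King1986.aK a L (k+1)`; the mean maps `M_k = secondMean`; the `d^{(k)}φ`-form by Part 2's change of variables). [cite: Dimock2013,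
§2.1 Lemma `second` L447–465 with proof L471–554 (arXiv:1108.1335v2 TeX); Dimock2013BalabanII, §2.1 Lemma 2.1 L488–550
(arXiv:1212.5562v2 TeX)] -/
theorem second_lemma_printed {a L : ℝ} (ha : 0 < a) (hL : 1 < L) {b : ∀ k, S k → T k} {N : ℕ → ℕ}
    (hb : ∀ k y, (fibre (b k) y).card = N k) (hN : ∀ k, ((N k : ℕ) : ℝ) = L ^ 3) (σ : ∀ k, S (k + 1) ≃ T k)
    {ρ₀ : (S 0 → ℝ) → ℝ} (hρ₀ : Integrable ρ₀) (hm : ∫ Φ₀, ρ₀ Φ₀ ≠ 0) (k : ℕ) (Φ : S (k + 1) → ℝ) :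
    densitySeq a L (fun k Φk => avgMat (b k) (N k) *ᵥ Φk) σ ρ₀ (k + 1) Φ
      = (normConst (aK a L (k + 1)) (Fintype.card (S (k + 1))))⁻¹
        * ∫ Φ₀, ρ₀ Φ₀ * exp (-(aK a L (k + 1) / 2)
            * sqNorm (Φ - secondMean L (fun k => (Real.sqrt (N k))⁻¹) (fun k => Qmat (b k) (N k)) σ k *ᵥ Φ₀)) := by
  have hL0 : 0 < L := lt_trans zero_lt_one hL
  have hN' : ∀ k, 0 < N k := fun k => by
    have h : (0 : ℝ) < (N k : ℝ) := by rw [hN k]; positivity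
    exact_mod_cast h
  rw [second_lemma_avg ha hL0 hb hN' σ hρ₀ hm k Φ, secondWidth_eq_aK ha hL hN k]

end PrintedWidths

/-! ## Part 20 (v1.7) — LEMMA `second` for EVERY integrable `ρ₀` (binder economy: the mass hypothesis dropped).  The constants `K_k`
do not depend on `ρ₀`, so Part 18's `secondK_eq` evaluated at the reference Gaussian `exp(−½|Φ₀|²)` of Part 1 (integrable, mass
`𝒩_{1,|S 0|} ≠ 0`) identifies them once and for all — an outside reader's observation (cell journal l.23919, XREAD X1 INFO-1, probe
P5), lifted here with thanks -/

section BinderEconomy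

open Matrix
open scoped Matrix
open FreeFlowSingleStep (aNext)
open King1986 (aK)
open BlockAveragingMatrix (fibre Qmat)

variable {S T : ℕ → Type*} [∀ k, Fintype (S k)] [∀ k, Fintype (T k)] [∀ k, DecidableEq (S k)]
  [∀ k, DecidableEq (T k)]

/-- **`K_k = 𝒩^{−1}_{β_k,|S_{k+1}|}` with NO density in the statement**: `secondK_eq` at the reference Gaussian `ρ₀ = exp(−½|Φ₀|²)`
(`integrable_exp_neg_half_mul_sqNorm`, mass `normConst 1 |S 0| ≠ 0` by `integral_exp_neg_half_mul_sqNorm`). [cite: Dimock2013, §2.1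
Lemma `second` proof, (queen3) and the sentence after it (arXiv:1108.1335v2 TeX L546–554)] -/
theorem secondK_eq' {a L : ℝ} (ha : 0 < a) (hL : 0 < L) {c : ℕ → ℝ} (hc : ∀ k, c k ≠ 0)
    {Qh : ∀ k, Matrix (T k) (S k) ℝ} (hQ : ∀ k, Qh k * (Qh k)ᵀ = 1) (σ : ∀ k, S (k + 1) ≃ T k) (k : ℕ) :
    secondK a L c Qh k = (normConst (secondWidth a L c k) (Fintype.card (S (k + 1))))⁻¹ := by
  have hρ : Integrable (fun Φ : S 0 → ℝ => exp (-(1 / 2) * sqNorm Φ)) :=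
    integrable_exp_neg_half_mul_sqNorm one_pos
  have hm : ∫ Φ : S 0 → ℝ, exp (-(1 / 2) * sqNorm Φ) ≠ 0 := by
    rw [integral_exp_neg_half_mul_sqNorm one_pos]
    exact (normConst_pos one_pos _).ne'
  exact secondK_eq ha hL hc hQ σ hρ hm k

/-- **LEMMA `second` for EVERY integrable `ρ₀`** (mass zero included): `second_lemma` with the hypothesis `∫ρ₀ ≠ 0` dropped.
[cite: Dimock2013, §2.1 Lemma `second` L447–465 with proof L471–554 (arXiv:1108.1335v2 TeX); Dimock2013BalabanII, §2.1 Lemma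
2.1 L488–550 (arXiv:1212.5562v2 TeX)] -/
theorem second_lemma' {a L : ℝ} (ha : 0 < a) (hL : 0 < L) {c : ℕ → ℝ} (hc : ∀ k, c k ≠ 0)
    {Qh : ∀ k, Matrix (T k) (S k) ℝ} (hQ : ∀ k, Qh k * (Qh k)ᵀ = 1) (σ : ∀ k, S (k + 1) ≃ T k)
    {ρ₀ : (S 0 → ℝ) → ℝ} (hρ₀ : Integrable ρ₀) (k : ℕ) (Φ : S (k + 1) → ℝ) :
    densitySeq a L (fun k Φk => (c k • Qh k) *ᵥ Φk) σ ρ₀ (k + 1) Φ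
      = (normConst (secondWidth a L c k) (Fintype.card (S (k + 1))))⁻¹
        * ∫ Φ₀, ρ₀ Φ₀ * exp (-(secondWidth a L c k / 2) * sqNorm (Φ - secondMean L c Qh σ k *ᵥ Φ₀)) := by
  rw [densitySeq_gaussianMixture ha hL hc hQ σ hρ₀ k Φ, secondK_eq' ha hL hc hQ σ k]

/-- **LEMMA `second` for the printed averaging operators, EVERY integrable `ρ₀`**: `second_lemma_avg` without `∫ρ₀ ≠ 0`.
[cite: Dimock2013, §2.1 L317–336 and Lemma `second` L447–465 with proof L471–554 (arXiv:1108.1335v2 TeX)] -/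
theorem second_lemma_avg' {a L : ℝ} (ha : 0 < a) (hL : 0 < L) {b : ∀ k, S k → T k} {N : ℕ → ℕ}
    (hb : ∀ k y, (fibre (b k) y).card = N k) (hN : ∀ k, 0 < N k) (σ : ∀ k, S (k + 1) ≃ T k)
    {ρ₀ : (S 0 → ℝ) → ℝ} (hρ₀ : Integrable ρ₀) (k : ℕ) (Φ : S (k + 1) → ℝ) :
    densitySeq a L (fun k Φk => avgMat (b k) (N k) *ᵥ Φk) σ ρ₀ (k + 1) Φ
      = (normConst (secondWidth a L (fun k => (Real.sqrt (N k))⁻¹) k) (Fintype.card (S (k + 1))))⁻¹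
        * ∫ Φ₀, ρ₀ Φ₀ * exp (-(secondWidth a L (fun k => (Real.sqrt (N k))⁻¹) k / 2)
            * sqNorm (Φ - secondMean L (fun k => (Real.sqrt (N k))⁻¹) (fun k => Qmat (b k) (N k)) σ k *ᵥ Φ₀)) := by
  have hc : ∀ k, (Real.sqrt (N k))⁻¹ ≠ 0 := fun k =>
    inv_ne_zero (Real.sqrt_pos.2 (by exact_mod_cast hN k)).ne'
  have hQ : ∀ k, Qmat (b k) (N k) * (Qmat (b k) (N k))ᵀ = 1 :=
    fun k => BlockAveragingMatrix.Qmat_mul_transpose (hb k) (hN k)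
  simp only [avgMat_eq_smul_Qmat]
  exact second_lemma' ha hL hc hQ σ hρ₀ k Φ

/-- **LEMMA `second` AS PRINTED, EVERY integrable `ρ₀`**: `second_lemma_printed` (widths `a_{k+1} = King1986.aK a L (k+1)`, blocks of
size `L³`, `L > 1`) without `∫ρ₀ ≠ 0`. [cite: Dimock2013, §2.1 Lemma `second` L447–465 with proof L471–554 (arXiv:1108.1335v2 TeX)] -/
theorem second_lemma_printed' {a L : ℝ} (ha : 0 < a) (hL : 1 < L) {b : ∀ k, S k → T k} {N : ℕ → ℕ}
    (hb : ∀ k y, (fibre (b k) y).card = N k) (hN : ∀ k, ((N k : ℕ) : ℝ) = L ^ 3) (σ : ∀ k, S (k + 1) ≃ T k)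
    {ρ₀ : (S 0 → ℝ) → ℝ} (hρ₀ : Integrable ρ₀) (k : ℕ) (Φ : S (k + 1) → ℝ) :
    densitySeq a L (fun k Φk => avgMat (b k) (N k) *ᵥ Φk) σ ρ₀ (k + 1) Φ
      = (normConst (aK a L (k + 1)) (Fintype.card (S (k + 1))))⁻¹
        * ∫ Φ₀, ρ₀ Φ₀ * exp (-(aK a L (k + 1) / 2)
            * sqNorm (Φ - secondMean L (fun k => (Real.sqrt (N k))⁻¹) (fun k => Qmat (b k) (N k)) σ k *ᵥ Φ₀)) := by
  have hL0 : 0 < L := lt_trans zero_lt_one hL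
  have hN' : ∀ k, 0 < N k := fun k => by
    have h : (0 : ℝ) < (N k : ℝ) := by rw [hN k]; positivity
    exact_mod_cast h
  rw [second_lemma_avg' ha hL0 hb hN' σ hρ₀ k Φ, secondWidth_eq_aK ha hL hN k]

end BinderEconomy

/-! ## Part 9 — Non-vacuity -/

/-- `𝒩_{2π,n} = 1` (`a = 2π`: `√(2π/2π) = 1`). -/
example (n : ℕ) : normConst (2 * π) n = 1 := by
  simp [normConst]

/-- `jac L 2 = L⁻¹` for `L ≥ 0` (`(√L)² = L`): the Jacobian `L^{−|𝕋|/2}` on a two-site lattice. -/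
example {L : ℝ} (hL : 0 ≤ L) : jac L 2 = L⁻¹ := by
  simp [jac, Real.sq_sqrt hL]

/-- One-site lattices everywhere, `Q = id`, `σ = id`: the step preserves the mass of any integrable density. -/
example {a L : ℝ} (ha : 0 < a) (hL : 0 < L) {ρ : (Unit → ℝ) → ℝ} (hρ : Integrable ρ) :
    ∫ Φ, rgStep a L (fun Φ : Unit → ℝ => Φ) (Equiv.refl Unit) ρ Φ = ∫ Φ, ρ Φ :=
  integral_rgStep ha hL measurable_id _ hρ

end Literature.MathematicalPhysics.QuantumFieldTheory.Dimock2011to13.RGStepNormalization
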